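import Summits.QuantumFields.YangMills.Theorems.BalabanUVNodesN06Thm312313AtPinsStateSUZ4
import Summits.QuantumFields.YangMills.Theorems.BalabanUVNodesN06Rgd2LegAtPinsPhysPU
import Literature.MathematicalPhysics.QuantumFieldTheory.Balaban1983to89.B9SectBStepUClosedSUOfSections
import Literature.MathematicalPhysics.QuantumFieldTheory.Balaban1983to89.Node00.OpsYExpsOfRecordV2
import Literature.MathematicalPhysics.QuantumFieldTheory.Balaban1983to89.B9LettersZSchemasMono
import Literature.MathematicalPhysics.QuantumFieldTheory.Balaban1983to89.B9LeafXCodedKnitU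
import Literature.MathematicalPhysics.QuantumFieldTheory.Balaban1983to89.B9SectBStepUGuardedR
import Summits.QuantumFields.YangMills.Theorems.BalabanUVNodesN06StateLayerAtPinsPU
import Literature.MathematicalPhysics.QuantumFieldTheory.Balaban1983to89.B9Eq3132FromStateR
import Literature.MathematicalPhysics.QuantumFieldTheory.Balaban1983to89.B9RWSumsDefinitePinsPairMDir4Rows
import Summits.QuantumFields.YangMills.Theorems.BalabanUVNodesN06G0LayerFromThm310AtPinsGUS
import Summits.QuantumFields.YangMills.Theorems.BalabanUVNodesN06DivLegAtPinsPhysR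
import Summits.QuantumFields.YangMills.Theorems.BalabanUVNodesN06HHLegAtPinsPhysRU
import Summits.QuantumFields.YangMills.Theorems.BalabanUVNodesN06XdYdLegAtPinsPhysPU
import Summits.QuantumFields.YangMills.Theorems.BalabanUVNodesN06WELegAtPinsPhysPUB
import Summits.QuantumFields.YangMills.Theorems.BalabanUVNodesN06WGpLegAtPinsPhysPU
import Summits.QuantumFields.YangMills.Theorems.BalabanUVNodesN06RgdH43LegAtPinsPhysPU
import Summits.QuantumFields.YangMills.Theorems.BalabanUVNodesN06L3131HLegAtPinsPhysPU
import Literature.MathematicalPhysics.QuantumFieldTheory.Balaban1983to89.B9PlaquetteBinderOfReg335Y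
import Summits.QuantumFields.YangMills.Theorems.BalabanUVNodesN06CutL2LettersAtPinsPhysR
import Summits.QuantumFields.YangMills.Theorems.BalabanUVNodesN06DirKinematicsAtPinsR
import Summits.QuantumFields.YangMills.Theorems.BalabanUVNodesN06DirKinematics3AtPinsR
import Summits.QuantumFields.YangMills.Theorems.BalabanUVNodesN06Proj349AtPinsPhysRC
import Literature.MathematicalPhysics.QuantumFieldTheory.Balaban1983to89.B9Ineq349SiteThresholdRateNamed
import Literature.MathematicalPhysics.QuantumFieldTheory.Balaban1983to89.B9Thm31GpMajFromPinsPairMR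
import Summits.QuantumFields.YangMills.Theorems.BalabanUVNodesN06CurrentMajAtPinsIdPhys
import Literature.MathematicalPhysics.QuantumFieldTheory.Balaban1983to89.B9Ineq349SiteFacesAtLettersR
import Literature.MathematicalPhysics.QuantumFieldTheory.Balaban1983to89.B9Eq3132FacesAtLettersR
import Literature.MathematicalPhysics.QuantumFieldTheory.Balaban1983to89.B9Thm314Thm315LayerR
import Summits.QuantumFields.YangMills.Theorems.BalabanUVNodesN06ProbeZeroAtPinsPhysR
import Summits.QuantumFields.YangMills.Theorems.BalabanUVNodesN06MixedLegAtPinsPhysR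
import Summits.QuantumFields.YangMills.Theorems.BalabanUVNodesN06MixedFactorAtPinsPhysR
import Summits.QuantumFields.YangMills.Theorems.BalabanUVNodesN06SplitMajorantsAtPinsPhysR
import Summits.QuantumFields.YangMills.Theorems.BalabanUVNodesN06StepL2AtPinsPhysR
import Summits.QuantumFields.YangMills.Theorems.BalabanUVNodesN06HgVacuousRC
import Literature.MathematicalPhysics.QuantumFieldTheory.Balaban1983to89.B9Thm39FacesAtLettersRC
import Literature.MathematicalPhysics.QuantumFieldTheory.Balaban1983to89.B9Thm315SectEStarRepAtLettersR
import Literature.MathematicalPhysics.QuantumFieldTheory.Balaban1983to89.B9LeafXClassAntitone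
import Literature.MathematicalPhysics.QuantumFieldTheory.Balaban1983to89.Node00.CarriersYP
import Summits.QuantumFields.YangMills.Theorems.BalabanUVNodesN06WalkLettersAtRecordR
import Summits.QuantumFields.YangMills.Theorems.BalabanUVNodesN06Row17FromRow19LettersDir
import Summits.QuantumFields.YangMills.Theorems.BalabanUVNodesN06Proj349AtPinsPhys
import Literature.MathematicalPhysics.QuantumFieldTheory.Balaban1983to89.B9CoReadingCoordsInputLoc
import Summits.QuantumFields.YangMills.Theorems.BalabanUVNodesN06SectBOfFrameV7
import Summits.QuantumFields.YangMills.Theorems.BalabanUVNodesN06SectDUnitsAtPinsPhys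
import Literature.MathematicalPhysics.QuantumFieldTheory.Balaban1983to89.B9CoReadingCoordsHolderAdmReadings
import Literature.MathematicalPhysics.QuantumFieldTheory.Balaban1983to89.B9CoReadingCoordsHolderSAdmReadings
import Summits.QuantumFields.YangMills.Theorems.BalabanUVNodesN06DirKinematics3AtPins
import Summits.QuantumFields.YangMills.Theorems.BalabanUVNodesN06Ids3152AtPinsPhys

/-!
# BalabanUVNodes ∕ N06 ([B9], `Dag.B9_main`) — THE STAGE-11 CERTIFICATE, EDITION 79 «UF» = EDITION 77 «UD» (the certificate of record, FLAG №8 CLOSED director-ym №296) WITH THREE LANDED DISPLAY ECONOMIES FOLDED: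
# (t5) the (α3) Sect.-B step is read through dag-n06-c's CLOSED face `B9SectBStepUClosedSUOfSections.sectBStepU_C37GY_su_extraYPb_closed` (p733848 = `B9SectBStepUClosedSU` p732773 ∘ dag-n06-j's `B9Thm310DeltaAIsUnitOfRegYP335AtLettersY.hunitA_of_sections` p732167 —
# THE GUARDED Thm-3.11 INPUT `hunitA` OF EDITION 76∕77 IS A THEOREM for the section-carrying sub-family `(f, ιB, hι)` the block already displays: Thm 3.3 via Thm 3.10 (3.105)–(3.106) on print's class, lit-balaban's member assembler; its body = edition 77's `hunitA` binder token for token, ref-G READ-546∕550);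
# (P-DISP 1+2) rows 20∕21 are read through dag-n06-l's face v1.4 `…Thm312313AtPinsStateSUZ4.t312_t313_of_pins_stateSUZ4` (p733825): of the eight displayed Z-letters of `hZ8` FOUR stay (`hZ4` = gD2 gQs1 c1_2 c1_1), `gQs2` ∕ `dgQs` are READ from `hlettersH12` (they were duplicates), `rgd2` (R∇\*_UG₁ : 𝔠⁽⁰⁾ → 𝔠_W⁽¹⁾) is DERIVED by dag-n06-l's leg
# `…N06Rgd2LegAtPinsPhysPU.hrgd2_of_pinsP_geo9Y` (p730751: the printed identity (3.152) `RD\*G₁ = RG′D\*` + Thm 3.1 `h31` + (3.49) `h49`, fed the certificate's own member-wise `Ids3152`), `q2 q1` (the Q letters) are DERIVED by the face from the pin `hQco12` (`B9QLettersAtPins.hasMaj_Q_of_pins`, [4] (2.60)) (successor of edition 77 `…V6EPairUD`; R-generic; print-literal twin = the UG successor)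
CONE CENSUS (№289 (1)(b) ∕ №290 (1)(e), two lines): raw-class Step letters remaining in the cone of this certificate: 0 (edition 77's list unchanged: `gXH_bHZKPG_of_pins`, `hletters13_of_pins*`, `Letters313IM*`, `tDv`, the two raw `hG0P` conjuncts, `δKG ρG hθK hρG hρSG hρδG hB₃g hδ₃g` ALL ABSENT) · unguarded Reg335-keyed binders remaining in the cone: 0 of print's thresholded species (as editions 76∕77; the class-transfer binders `hRP1 hRP2 hP1 hP2` declared, discharged in the print-literal twin) ·
№277 rider: NO `hunitA`-universal binder anywhere — the guarded, class-keyed, section-premised `hunitA` is no longer displayed at all, it is SUPPLIED (A2: the supplier's premise is print's class at `c35Y` on a section-carrying member, inhabited by `U = 1`).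
BINDER DIFF vs edition 77 (394 → 378 displayed): REMOVED `M₂ hM₂ hrepr hsumR hsumL MInv aInv aW hMInv haInv haW hunitA hMd mNB hnbrB hMr` (the (α3) block's basis ∕ threshold ∕ neighbour bookkeeping and its GUARDED Thm-3.11 input — all SUPPLIED by the closed face), `hdgQs` (W1: it IS `(hlettersH12 …).dgQs`), `hZ8` (↦ `hZ4`);
ADDED `hM₀B : nbrM₀Y … (2(d+1)) ≤ M⋆` (ONE member-floor threshold of the `hM₀ hM₀'` species, the closed face's neighbour radius) and `hZ4` (conjuncts 1, 3, 5, 6 of `hZ8` VERBATIM); RETYPED nothing else. NO new numeric is displayed: the leg's `hB₃r : constA c_R⁻¹ B₀ C_P (rowConst261 geo9Y σW) (ℓ+1) ≤ B₃`, the face's `hB12₃q : (ℓ+1)²e^{2δ12₃(ℓ+4)} ≤ B12₃` and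
`hM12q : 2 log(ℓ+1) ≤ δ12₃(2(ℓ+1)²−1)·M12` are ABSORBED exactly as edition 77 absorbed `hADB12` — the face is called at an opaque constant `B12F ≥ B12₃, 2·A_D, C_A3, C_Q` and at the threshold `M₀' ≥ M_q := 2 log(ℓ+1)∕(δ12₃(2(ℓ+1)²−1))` (`δ12₃ > 0` from `hρ₃12 hρ12 hσ12`), every `B12₃`-typed input weakened by `B9LettersZSchemasMono.kernel_mono ∕ lettersHZ_mono ∕ letters313DZ_mono ∕ letters313DMZ_mono`.
CONCLUSION IDENTICAL to edition 77: `B9LeafX (Y9OfRecordUPb N θ.toStage3Params Mstar (opsYNuStOfRecordV4PE N θ.toStage3Params Mstar 𝔯 (sectEStYOfRecordV7 N θ.toStage3Params Mstar 𝔢₀) 𝔴 𝔈) f bR ιB C38)`.  PROOF = edition 77's VERBATIM except: `hBU := fun h32 h33 => sectBStepU_C37GY_su_extraYPb_closed θ.toStage3Params Mstar f bR ιB C38 hN hι hM₀B h32 h33` (dag-n06-c's recipe I.29486);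
`obtain ⟨Mr2, hr2⟩ := hrgd2_of_pinsP_geo9Y …` beside the `rgdH` leg (inputs `h31 h49` + pins + the W-budget `hbudW hδ3W hδFP`), its threshold folded into `M₀'`; the rows face = SUZ4 with `hZ4` (four weakenings), `hQco12`, `hrgd2_13 := fun x … U hU hU' => (hr2 x … U hU hU' (hids x …).2).mono …`, `hM12q hB12₃q` from `M₀'`∕`B12F`; the state layer reads `hZ4`.1 ∕ .2.1; `hlettersD13` reads `(hlettersH12 …).dgQs`.
HONEST FRAMING.  Kernel bookkeeping over LANDED modules (p730751 · p732167 · p732773 · p733825 · p733848); every member REMAINS a DISPLAYED hypothesis of printed species or a landed pin fact; COUNT-NEUTRAL; NOT a discharge of N06; K1⁹ NOT closed; one finite 𝕋⁴ programme at fixed `ε` — NOT continuum ∕ OS ∕ mass gap ∕ Clay. 0 `def`, 0 `sorry`.  Cell `pub-ymgap` (D-0062), Track A node N06 [B9], seat `pub-ymgap-dag-n06-d` (g20), 2026-08-29.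
-/

noncomputable section

namespace Summit.QuantumFields.YangMills.BalabanUVNodes.N06AtOpsYNuOfRecordV6EPairUF

open Literature.MathematicalPhysics.QuantumFieldTheory.Balaban1983to89 open Literature.MathematicalPhysics.QuantumFieldTheory.Balaban1983to89.T4Continuum (T4Family) open Literature.MathematicalPhysics.QuantumFieldTheory.Balaban1983to89.Node00 open Literature.MathematicalPhysics.QuantumFieldTheory.Balaban1983to89.B9PinMembersKLevelV1 (MemberY geo9Y bg9Y) open Literature.MathematicalPhysics.QuantumFieldTheory.Balaban1983to89.B9PinGeometryKLevelV1 (dOmegaY OmKY inΛY unitDistY c35Y) open Literature.MathematicalPhysics.QuantumFieldTheory.Balaban1983to89.B7Prop2SpecialUnitary (specialUnitaryUnits specialUnitaryUnits_le_unitaryUnits) open Literature.MathematicalPhysics.QuantumFieldTheory.Balaban1983to89.B9Ineq347GAAtLetters (hGA_opsYOfLetters) open Literature.MathematicalPhysics.QuantumFieldTheory.Balaban1983to89.B9Ineq344LocalPairHolds (hGp_opsYOfLetters_holds) open Literature.MathematicalPhysics.QuantumFieldTheory.Balaban1983to89.B9Cor35ComparisonsGAAtLetters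
 (hGA_e_opsYOfLetters hGA_h1_opsYOfLetters hGA_e4_opsYOfLetters hGA_h2_opsYOfLetters hGA_l2_opsYOfLetters) open Literature.MathematicalPhysics.QuantumFieldTheory.Balaban1983to89.B9CoReadingCoordsHolderAdm (holderProbesKA bond_h1ReadsNbr_of_pinsA) open Literature.MathematicalPhysics.QuantumFieldTheory.Balaban1983to89.B9CoReadingCoordsHolderAdmReadings (bond_coReadsHHolderNbr_of_pinsA bond_inputReadsFam_of_pinsA) open Literature.MathematicalPhysics.QuantumFieldTheory.Balaban1983to89.B9CoReadingCoordsHolderSAdm (holderProbesSA site_h1ReadsNbr_of_pinsSA) open Literature.MathematicalPhysics.QuantumFieldTheory.Balaban1983to89.B9CoReadingCoordsHolderSAdmReadings (site_inputReadsFam_of_pinsSA) open Summit.QuantumFields.YangMills.BalabanUVNodes.N06DirKinematicsAtPinsR (h36HA_of_dir_pinsR h36_of_dirSq_pinsR h36A_of_dirSq_pinsR) open Summit.QuantumFields.YangMills.BalabanUVNodes.N06DirKinematics3AtPinsR (h36H_of_dir_pins₃R) open Literature.MathematicalPhysics.QuantumFieldTheory.Balaban1983to89.B9RWSums346MixedFactorAtRecordClosed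 (MRec aRec BRec δRec) open Summit.QuantumFields.YangMills.BalabanUVNodes.N06CurrentMajAtPinsIdPhys (hBJ_of_pins_P) open Literature.MathematicalPhysics.QuantumFieldTheory.Balaban1983to89.B9WalkLettersOps (opsWalkY dirOpsWalkY dirLettersWalkY kappaWalkY thetaWalkY KcWalkY agreeWalkY rdWalkY) open Literature.MathematicalPhysics.QuantumFieldTheory.Balaban1983to89.B9WalkLettersOpsFacts (staticOK_opsWalkY bounded_kappaWalkY) open Summit.QuantumFields.YangMills.BalabanUVNodes.N06WalkLettersAtRecordR (localityDir_opsWalkY_of_agree identities₂_opsWalkY_of_reg335R) open Summit.QuantumFields.YangMills.BalabanUVNodes.N06XdYdLegAtPinsPhysPU (hXd_of_pinsP_geo9Y pYDH_of_pinsP_geo9Y) open Summit.QuantumFields.YangMills.BalabanUVNodes.N06DgLegAtPinsPhysPU (hκ13_of_pinsP dgDH_dgDHd_of_pinsP_geo9Y) open Literature.MathematicalPhysics.QuantumFieldTheory.Balaban1983to89.B9SmoothHolderClassP (bHZPG bHZKP bHZKPG) open Summit.QuantumFields.YangMills.BalabanUVNodes.N06WELegAtPinsPhysPUB (hκX_of_pinsP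 hWE_of_pinsP_geo9Y_budget) open Summit.QuantumFields.YangMills.BalabanUVNodes.N06WGpLegAtPinsPhysPU (hwGp_of_pinsP_geo9Y) open Summit.QuantumFields.YangMills.BalabanUVNodes.N06RgdH43LegAtPinsPhysPU (hrgdH_of_pinsP43_geo9Y) open Summit.QuantumFields.YangMills.BalabanUVNodes.N06L3131HLegAtPinsPhysPU (hL3131H_of_pinsP43_geo9Y) open Literature.MathematicalPhysics.QuantumFieldTheory.Balaban1983to89.B9SmoothHolderClassPProducers (CTel) open Literature.MathematicalPhysics.QuantumFieldTheory.Balaban1983to89.B6RandomWalkHom (HasMajorantHom) open Literature.MathematicalPhysics.QuantumFieldTheory.Balaban1983to89.B9Ineq349SiteThresholdRateNamed (thrM349 cg349 cg349_pos fineEntryS_le_named) open Literature.MathematicalPhysics.QuantumFieldTheory.Balaban1983to89.B9Thm39ReadingAtLetters (basis39 κ39) open Literature.MathematicalPhysics.QuantumFieldTheory.Balaban1983to89.B9MultiscaleSmoothPartitionYNear (rNear) open Literature.MathematicalPhysics.QuantumFieldTheory.Balaban1983to89.B9Thm313WholeDvHolderAtPinsGraded (thetaL CJG) open Literature.MathematicalPhysics.QuantumFieldTheory.Balaban1983to89.B9PlaquetteBinderOfReg335Y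 (plaqV_binder_of_regYR_budget_SU budget_nonneg) open Literature.MathematicalPhysics.QuantumFieldTheory.Balaban1983to89.B9SectDSup (weightNorm) open Literature.MathematicalPhysics.QuantumFieldTheory.Balaban1983to89.B9MultiscaleSmoothPartitionYLip (CLip) open Literature.MathematicalPhysics.QuantumFieldTheory.Balaban1983to89.B9GradViaDivLettersTransported (taxiS taxiB) open Literature.MathematicalPhysics.QuantumFieldTheory.Balaban1983to89.B9OpsRTransport (ops312RY) open Literature.MathematicalPhysics.QuantumFieldTheory.Balaban1983to89.B9Ineq349SiteFacesAtLettersR (s349_site_of_t37_display348_of_R) open Literature.MathematicalPhysics.QuantumFieldTheory.Balaban1983to89.B9Eq3132FacesAtLettersR (s3132Nu_opsYSectE_of_step12_R_of_refinesY) open Literature.MathematicalPhysics.QuantumFieldTheory.Balaban1983to89.B9Thm314Thm315LayerR (thm314_pair_layerOfLettersR) open Literature.MathematicalPhysics.QuantumFieldTheory.Balaban1983to89.B9Eq335ClassBridgePV1 (regY335_of_regYP335 regY336_of_regYP336) open Literature.MathematicalPhysics.QuantumFieldTheory.Balaban1983to89.B9BackgroundsKLevelV1P (bg9YP) open Summit.QuantumFields.YangMills.BalabanUVNodes.N06ProbeZeroAtPinsPhysR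 (hX0_of_pinsR) open Summit.QuantumFields.YangMills.BalabanUVNodes.N06MixedLegAtPinsPhysR (l2MixedLegs37_of_pinsR) open Summit.QuantumFields.YangMills.BalabanUVNodes.N06MixedFactorAtPinsPhysR (h36H_with_factor_of_pinsR) open Summit.QuantumFields.YangMills.BalabanUVNodes.N06SplitMajorantsAtPinsPhysR (split_majorants_of_letter_schemasR) open Summit.QuantumFields.YangMills.BalabanUVNodes.N06StepL2AtPinsPhysR (stepL2_of_letter_schemas_residualR) open Summit.QuantumFields.YangMills.BalabanUVNodes.N06HgVacuousRC (hg_obligation_vacuousRC) open Summit.QuantumFields.YangMills.BalabanUVNodes.N06Thm312313AtPinsStateSUZ4 (t312_t313_of_pins_stateSUZ4) open Summit.QuantumFields.YangMills.BalabanUVNodes.N06Rgd2LegAtPinsPhysPU (hrgd2_of_pinsP_geo9Y) open Literature.MathematicalPhysics.QuantumFieldTheory.Balaban1983to89.B9SectBStepUClosedSUOfSections (sectBStepU_C37GY_su_extraYPb_closed) open Literature.MathematicalPhysics.QuantumFieldTheory.Balaban1983to89.Node00.OpsYExpsOfRecordV2 (expsYOfRecordV2) open Literature.MathematicalPhysics.QuantumFieldTheory.Balaban1983to89.B9Thm39FacesAtLettersRC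 (t39_hksum_oneCube_opsYOfLetters_FRC) open Literature.MathematicalPhysics.QuantumFieldTheory.Balaban1983to89.B9Thm39PureGaugeClassAtLettersR (oneCubeOps39YFR) open Literature.MathematicalPhysics.QuantumFieldTheory.Balaban1983to89.B9Thm311Thm315FacesAtLettersR (t311_of_pins_opsYOfLettersR) open Literature.MathematicalPhysics.QuantumFieldTheory.Balaban1983to89.B9Thm315SectEStarRepAtLettersR (DecayMidOnStY t315_opsYNuStOfRecordV4PE_sectEStYOfRecordV7_of_3185_onR) open Literature.MathematicalPhysics.QuantumFieldTheory.Balaban1983to89.B9BackgroundsKLevelV1R (RegFamY MemOfFam mem_of_reg335R bg9YR regYP335 regYP336 regYP335_one kernelFamilyR kernelFamilyRY siteKernelR hKernelR rwExpansionR rwKernelExpansionR fineKernelR) open Literature.MathematicalPhysics.QuantumFieldTheory.Balaban1983to89.B9LeafXClassAntitone (ClassIncl residualGpAtOne_R residualGAGlobAtOne_R rwSumsYieldIneqs_R rwKernelSumYields_R thm37Printed_antitone cor38Printed_antitone thm39Printed_antitone thm310Printed_antitone thm311Printed_antitone thm312Printed_antitone thm313Printed_antitone thm314Printed_antitone thm315FullPrinted_antitone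 stmt349Printed_antitone stmt3132Printed_antitone thm314LocalPrinted_antitone) open Literature.MathematicalPhysics.QuantumFieldTheory.Balaban1983to89.B9PinCarriersKLevelV1R (b9LeafX_carriersYR b9LeafX_carriersYP_iff) open Literature.MathematicalPhysics.QuantumFieldTheory.Balaban1983to89.B9PinCarriersKLevelV1P (carriersYP) open Literature.MathematicalPhysics.QuantumFieldTheory.Balaban1983to89.B9PinGeometryKLevelV1B (c35B c35B_pos ten_L3_le_c35B ten_L4_le_c35B c35Y_le_ten) open Literature.MathematicalPhysics.QuantumFieldTheory.Balaban1983to89.DagBinding (B9LeafX) open Summit.QuantumFields.YangMills.BalabanUVNodes.N06Ids3152AtPinsPhys (ids3124_ids3152_of_hZ_pins) open Literature.MathematicalPhysics.QuantumFieldTheory.Balaban1983to89.Node00.OpsYNablaBridge (cf_mul_etaS_of_hcfk)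
open Literature.MathematicalPhysics.QuantumFieldTheory.Balaban1983to89.B9Cor35ComparisonsGpCAtLetters (hGp_e_opsYOfLetters hGp_h1_opsYOfLetters hC_opsYOfLetters) open Literature.MathematicalPhysics.QuantumFieldTheory.Balaban1983to89.B9Cor35ComparisonsEH (hE4_of_hGA_e4 hH2_of_hGA_h2) open Literature.MathematicalPhysics.QuantumFieldTheory.Balaban1983to89.B9GeoLemma21KLevelV1 (geo9Y_len_pos) open Literature.MathematicalPhysics.QuantumFieldTheory.Balaban1983to89.B9Thm311Whole (PosDefOfOps) open Literature.MathematicalPhysics.QuantumFieldTheory.Balaban1983to89.B9Thm39WholeBlk (Conv348Blk)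
open Literature.MathematicalPhysics.QuantumFieldTheory.Balaban1983to89.B9Thm39WholeBlkViaDatum (EK39OfOpsBlkVia) open Literature.MathematicalPhysics.QuantumFieldTheory.Balaban1983to89.B9Thm39ReadingFaithful (repSite39F) open Literature.MathematicalPhysics.QuantumFieldTheory.Balaban1983to89.B9Thm39OneCubeReadingAtLettersY (oneCubeOps39YF oneCubeReading39) open Literature.MathematicalPhysics.QuantumFieldTheory.Balaban1983to89.B9RowSum261DefiniteFaces (rowConst261) open Literature.MathematicalPhysics.QuantumFieldTheory.Balaban1983to89.B9Thm312Whole (GeoOK FormSmall HasRWExpOfOps HasRWExpHOfOps PosDefKOfOps cNorm PosDefEnd) open Literature.MathematicalPhysics.QuantumFieldTheory.Balaban1983to89.B11SectG (BlockNorm HasMaj)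
open Literature.MathematicalPhysics.QuantumFieldTheory.Balaban1983to89.B9GeoNormsKLevelV1 (geo9K_dist_nonneg geo9K_supNorm_nonneg) open Literature.MathematicalPhysics.QuantumFieldTheory.Balaban1983to89.B9GeoLemma21KLevelV1 (geo9Y_dist_triangle geo9Y_dist_comm) open Literature.MathematicalPhysics.QuantumFieldTheory.Balaban1983to89.B9GeoNormsKLevelModelSignsV1 (modelSignsOn_geo9K) open Literature.MathematicalPhysics.QuantumFieldTheory.Balaban1983to89.B9Thm34Ext (toB6) open Literature.MathematicalPhysics.QuantumFieldTheory.Balaban1983to89.B9CoRealizesRelAtLetters (RelB maj342_relB_left maj342_relB_right dist_eq_of_relB len_eq_of_relB relB_refl)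
open Literature.MathematicalPhysics.QuantumFieldTheory.Balaban1983to89.B9SectCDiffDict (maj342) open Literature.MathematicalPhysics.QuantumFieldTheory.Balaban1983to89.B6Ineq2142KLevelV1 (β) open Literature.MathematicalPhysics.QuantumFieldTheory.Balaban1983to89.B9CarrierBlockMultiplicity (card_sameCarrier_le_kIdx)
open Literature.MathematicalPhysics.QuantumFieldTheory.Balaban1983to89.B9Thm311ReadingAtLetters (ops311Y) open Literature.MathematicalPhysics.QuantumFieldTheory.Balaban1983to89.B9Thm311ReadingCoords (PosDefTr) open Literature.MathematicalPhysics.QuantumFieldTheory.Balaban1983to89.B9PinGeometryKLevelV1 (kLab) open Literature.MathematicalPhysics.QuantumFieldTheory.Balaban1983to89.B9Thm314GpFlatTorusGeometry (tdistK OmegaC) open Literature.MathematicalPhysics.QuantumFieldTheory.Balaban1983to89.B9Thm314WholePinGeometry (locDataY) open Literature.MathematicalPhysics.QuantumFieldTheory.Balaban1983to89.B9Thm314WholePair (locData₂) open Literature.MathematicalPhysics.QuantumFieldTheory.Balaban1983to89.B9Thm314WholePairWalks (pairWalkSets) open Literature.MathematicalPhysics.QuantumFieldTheory.Balaban1983to89.B9Thm314WholeSummation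 (WalkSetsSpec WalkWeightsSummable) open Literature.MathematicalPhysics.QuantumFieldTheory.Balaban1983to89.B9SectCWalkTermsAllNorms (Thm310AllNormsPrinted) open Literature.MathematicalPhysics.QuantumFieldTheory.Balaban1983to89.B9Thm314WholeExpansionReads (ExpansionReads) open Literature.MathematicalPhysics.QuantumFieldTheory.Balaban1983to89.B9Thm314WholeCancellationLayer (pairOp) open Literature.MathematicalPhysics.QuantumFieldTheory.Balaban1983to89.B9Thm37Whole (Ops Sizes StaticOK Local342)
open Literature.MathematicalPhysics.QuantumFieldTheory.Balaban1983to89.B9Cor38Whole (WalkReading) open Literature.MathematicalPhysics.QuantumFieldTheory.Balaban1983to89.B9Thm310Whole (Ops310 WalkReading310 Sizes310 StaticOK310 Locality310 Local342G) open Literature.MathematicalPhysics.QuantumFieldTheory.Balaban1983to89.B9Thm310WholeDir (DirLetters310 Identities310₂) open Literature.MathematicalPhysics.QuantumFieldTheory.Balaban1983to89.B9RWSumsDefinitePins (PinPrims) open Literature.MathematicalPhysics.QuantumFieldTheory.Balaban1983to89.B9RWSumsDefinitePinsPair (PairPrims) open Literature.MathematicalPhysics.QuantumFieldTheory.Balaban1983to89.B9RWSumsDefinitePinsPairM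 (MixedPrims E310YPairM) open Literature.MathematicalPhysics.QuantumFieldTheory.Balaban1983to89.B9RWSumsDefinitePinsPairMDir (E37YPairMDir) open Literature.MathematicalPhysics.QuantumFieldTheory.Balaban1983to89.B9RWSumsDefinitePinsPairMDir4Rows (rows131819_definite_geo9Y_pairM_dir₄) open Literature.MathematicalPhysics.QuantumFieldTheory.Balaban1983to89.B9Thm37WholeDir (DirLetters37 Identities₂) open Literature.MathematicalPhysics.QuantumFieldTheory.Balaban1983to89.B9Cor38WholeDir (LocalityDir) open Literature.MathematicalPhysics.QuantumFieldTheory.Balaban1983to89.B9Thm37KLetterDir (HolderV37Dir FactorsInputPair37Dir) open Literature.MathematicalPhysics.QuantumFieldTheory.Balaban1983to89.B9RWSums344InputFam (InputReadsFam sliceProbe) open Literature.MathematicalPhysics.QuantumFieldTheory.Balaban1983to89.B9RWSums344InputPair (InputLegsPair37 InputLegsPair310 FactorsInputPair310) open Literature.MathematicalPhysics.QuantumFieldTheory.Balaban1983to89.B9RWSums346MixedPair (L2MixedLegs310 FactorsL2Mixed310) open Literature.MathematicalPhysics.QuantumFieldTheory.Balaban1983to89.B9CoReadingCoordsTranspose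 (TrIdx trBasis isTransposePair_GcoK_trBasis isTransposePair_DcoK_GcoK_trBasis isTransposePair_GcoS_trBasis isTransposePair_DcoS_GcoS_trBasis) open Literature.MathematicalPhysics.QuantumFieldTheory.Balaban1983to89.B9Thm311SymmAtRecordV4 (symm0_parSymY symmG_parSymY) open Literature.MathematicalPhysics.QuantumFieldTheory.Balaban1983to89.B9Thm311AdjointPairs (GpY_isSymmTr) open Literature.MathematicalPhysics.QuantumFieldTheory.Balaban1983to89.B9RWSums346SecondDiff (familyOp DirOps310 L2SecondLegs310) open Literature.MathematicalPhysics.QuantumFieldTheory.Balaban1983to89.B9RWSums346SecondDiffGp (DirOps37 L2SecondLegs37) open Literature.MathematicalPhysics.QuantumFieldTheory.Balaban1983to89.B9Thm37Glue (IsTransposePair) open Literature.MathematicalPhysics.QuantumFieldTheory.Balaban1983to89.B9RWSumsReadsNbr (H1ReadsNbr) open Literature.MathematicalPhysics.QuantumFieldTheory.Balaban1983to89.B9RWSums346Two (L2TwoLegs310 FactorsL2_310)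
open Literature.MathematicalPhysics.QuantumFieldTheory.Balaban1983to89.B9RWSums343Holder (HolderProbes HolderLegs310 FactorsHolder310) open Literature.MathematicalPhysics.QuantumFieldTheory.Balaban1983to89.B9RWSums343HolderGp (HolderLegs37) open Literature.MathematicalPhysics.QuantumFieldTheory.Balaban1983to89.B9Thm39ReadingCoords (cR39)
open Literature.MathematicalPhysics.QuantumFieldTheory.Balaban1983to89.B9CoReadingCoords (XBK evBK blkBK GcoK DcoK DscoK LcoK coordOpK cdBₗ cdsBₗ) open Literature.MathematicalPhysics.QuantumFieldTheory.Balaban1983to89.B9CoReadingCoordsS (XSK evSK blkSK sIK sIK_faithful off_bound_evSK GcoS DcoS DscoS LcoS) open Literature.MathematicalPhysics.QuantumFieldTheory.Balaban1983to89.B9CoReadingCoordsL2S (sIK_dist_le_one site_l2ReadsNbr012_of_pins site_l2ReadsNbr345_of_pins) open Literature.MathematicalPhysics.QuantumFieldTheory.Balaban1983to89.B9CoReadingCoordsL2Pair (bond_l2ReadsNbr345_of_pins) open Literature.MathematicalPhysics.QuantumFieldTheory.Balaban1983to89.B9Ineq349SiteComposite (cdSL cdsSL) open Literature.MathematicalPhysics.QuantumFieldTheory.Balaban1983to89.B9Thm312WholeL2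 (StepL2) open Literature.MathematicalPhysics.QuantumFieldTheory.Balaban1983to89.B9Thm312WholeHHolderNbr (CoReadsHHolderNbr) open Literature.MathematicalPhysics.QuantumFieldTheory.Balaban1983to89.B9Thm311ReadingCoords (IsSymmTr) open Summit.QuantumFields.YangMills.BalabanUVNodes.N06CoReadingsOfPins (bond_coReadings3_of_pins bond_coReadingsLap_of_pins site_coReadings4_of_pins bond_l2ReadsNbr3_of_pins) open Literature.MathematicalPhysics.QuantumFieldTheory.Balaban1983to89.B6Geom246MultiLevelTorus (geomT)
open Literature.MathematicalPhysics.QuantumFieldTheory.Balaban1983to89.B9Eq3132NuReading (opsYS349NuOfLetters) open Literature.MathematicalPhysics.QuantumFieldTheory.Balaban1983to89.B9GeoNbrCountKLevelV1 (nbrM₀Y nbrCountY hnbr_two_of_le) open Literature.MathematicalPhysics.QuantumFieldTheory.Balaban1983to89.B9CoReadingCoordsH (XHK blkHK HcoK)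
open Literature.MathematicalPhysics.QuantumFieldTheory.Balaban1983to89.B6GlobalChartV1 (blkV1) open Literature.MathematicalPhysics.QuantumFieldTheory.Balaban1983to89.B6Ineq2142KLevelV1 (lvl) open Literature.MathematicalPhysics.QuantumFieldTheory.Balaban1983to89.B9Thm314WholePinGeometry (locDataY_laws) open Literature.MathematicalPhysics.QuantumFieldTheory.Balaban1983to89.B9PinGeometryKLevelV1 (dOmegaY_nonneg) open scoped Matrix.Norms.L2Operator
open Summit.QuantumFields.YangMills.BalabanUVNodes.N06Proj349AtPinsPhysRC (proj349Maj_of_t37_display348_rateR_ge cP349_nonneg) open B9Eq346GradGpDivAtPinsL2Closed (M46 a46 B46 δ46 M46_pos a46_pos B46_pos blockBd_DvGcoSDvs_memberY_at) open B9PerturbationL2Delta2 (D2coK constL2Pi constL2Pi_nonneg) open Literature.MathematicalPhysics.QuantumFieldTheory.Balaban1983to89.B9PerturbationL2Letters (constL2 constL2_nonneg) open Summit.QuantumFields.YangMills.BalabanUVNodes.N06SectDUnitsAtPinsPhys (isUnit_deltaPiAY_of_formSmall_phys isUnit_deltaOneY_of_formSmall_phys posDefEnd_S0coK_of_posDefTr_phys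 posDefTr_deltaOneY_of_formSmall_pins_phys identitiesDef_of_pins_phys isUnit_deltaAY_phys_of_posDefTr) open Literature.MathematicalPhysics.QuantumFieldTheory.Balaban1983to89.B9Thm313WholeLettersCut (Letters313HZc Letters313L2Pc) open Literature.MathematicalPhysics.QuantumFieldTheory.Balaban1983to89.B9Thm313WholeRgdFrom3152 (Ids3152) open Literature.MathematicalPhysics.QuantumFieldTheory.Balaban1983to89.B9Thm312WholeHZ (LettersHZ) open Literature.MathematicalPhysics.QuantumFieldTheory.Balaban1983to89.B9SectDSup (weightNorm) open Literature.MathematicalPhysics.QuantumFieldTheory.Balaban1983to89.B9Thm313WholeLeftZ (Letters313DZ) open Literature.MathematicalPhysics.QuantumFieldTheory.Balaban1983to89.B9Thm313WholeDirZ (Letters313DMZ) open Literature.MathematicalPhysics.QuantumFieldTheory.Balaban1983to89.B9Thm313WholeHolderZ (Letters313HZ) open Literature.MathematicalPhysics.QuantumFieldTheory.Balaban1983to89.B9Thm313WholeDirL2Z (Letters313L2MZ) open Literature.MathematicalPhysics.QuantumFieldTheory.Balaban1983to89.B9LettersHZAtOne (plateau_pos) open Literature.MathematicalPhysics.QuantumFieldTheory.Balaban1983to89.B9Thm313WholeDirInputBC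 (Letters313IMBC Letters313IML letters313IMBC_of_IML) open Literature.MathematicalPhysics.QuantumFieldTheory.Balaban1983to89.B9CoReadingCoordsInputLoc (vanishX_bHK_pins leX_bHK_pins) open Literature.MathematicalPhysics.QuantumFieldTheory.Balaban1983to89.B9Thm312WholeClasses (cNormR) open Literature.MathematicalPhysics.QuantumFieldTheory.Balaban1983to89.B9PerturbationSplitAtLetters (TaLcoK TbLcoKH Ta2LcoK Tb2LcoKH TaRcoK TbRcoKH Ta2RcoK Tb2RcoKH letters3131_of_pins_of_maj letters3131R_of_pins_of_maj) open Literature.MathematicalPhysics.QuantumFieldTheory.Balaban1983to89.B9CoReadingCoordsHolder (PK) open Literature.MathematicalPhysics.QuantumFieldTheory.Balaban1983to89.B9CoReadingCoordsInput (bHK) open Literature.MathematicalPhysics.QuantumFieldTheory.Balaban1983to89.B9CoReadingCoordsInputS (bHS) open Summit.QuantumFields.YangMills.BalabanUVNodes.N06G0LayerFromThm310GUS (g0_layer_of_thm310_coreDir₃US) open Summit.QuantumFields.YangMills.BalabanUVNodes.N06DivLegAtPinsPhysR (hdivDs_of_pinsR) open Summit.QuantumFields.YangMills.BalabanUVNodes.N06HHLegAtPinsPhysRU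 (hLHH_of_pinsRU) open Summit.QuantumFields.YangMills.BalabanUVNodes.N06CutL2LettersAtPinsPhys (letters313L2MZ_mono_const) open Summit.QuantumFields.YangMills.BalabanUVNodes.N06CutL2LettersAtPinsPhysR (vDRDG_vGDRD_of_pinsR) open Literature.MathematicalPhysics.QuantumFieldTheory.Balaban1983to89.B9Thm313WholeLettersCutKept (Letters313L2Pk Letters313L2Pc.of_kept) open Summit.QuantumFields.YangMills.BalabanUVNodes.N06ProbeZeroAtPinsPhys (cX0_nonneg) open Summit.QuantumFields.YangMills.BalabanUVNodes.N06MixedLegAtPinsPhys (hcntM_of_walkCnt) open Summit.QuantumFields.YangMills.BalabanUVNodes.N06Row17FromRow19LettersDir (row17_of_row19_letters₂) open Literature.MathematicalPhysics.QuantumFieldTheory.Balaban1983to89.B9WalkLettersCoordsS (SblkY hWalkY gsqcoS walkCntM₀Y walkCntY nearBlkCntY) open Literature.MathematicalPhysics.QuantumFieldTheory.Balaban1983to89.B6Cover236MultiLevelBlocks (cubes) open Literature.MathematicalPhysics.QuantumFieldTheory.Balaban1983to89.B9Eq346MixedLegAtPinsL2Closed (MMix aMix BMix δMix) open Literature.MathematicalPhysics.QuantumFieldTheory.Balaban1983to89.B9Thm39ReadingCoords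 (coordBound39 basisBound39) open Literature.MathematicalPhysics.QuantumFieldTheory.Balaban1983to89.B9Thm31GpMajFromPinsPairMR (thm31GpMaj_of_t37_pairMR) open Literature.MathematicalPhysics.QuantumFieldTheory.Balaban1983to89.B9PerturbationMajorantLetters (const3131) open Literature.MathematicalPhysics.QuantumFieldTheory.Balaban1983to89.B9RowSum261DefiniteFaces (rowConst261) open Literature.MathematicalPhysics.QuantumFieldTheory.Balaban1983to89.B9Thm312WholeRightStepFrom3131 (Letters3131R) open Literature.MathematicalPhysics.QuantumFieldTheory.Balaban1983to89.B9Thm312WholeStepFrom3131 (Letters3131) open Literature.MathematicalPhysics.QuantumFieldTheory.Balaban1983to89.B9Thm312WholeLeftStepFrom3131 (Letters3131H) open Literature.MathematicalPhysics.QuantumFieldTheory.Balaban1983to89.B9Thm312WholeIdentitiesSplit (Ids3124 identities_of_def_3124) open Literature.MathematicalPhysics.QuantumFieldTheory.Balaban1983to89.Node00.OpsYSectDCoords (S0coK TpicoK T2coK QcoKH QscoKH CcoK C1coK DvcoKH DvscoKH RcoK GcoK_GAY_mul_S0coK cR39_trBasis_pos) open Literature.MathematicalPhysics.QuantumFieldTheory.Balaban1983to89.B9Thm311ReadingCoords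 (isUnit_of_posDefTr)

open Summit.QuantumFields.YangMills.BalabanUVNodes.N06StateLayerAtPinsPU (hStateTuples_of_pinsP_geo9Y) open Literature.MathematicalPhysics.QuantumFieldTheory.Balaban1983to89.B9Eq3132FromStateR (s3132Nu_opsYSectE_of_stepS_R_of_refinesY) open Literature.MathematicalPhysics.QuantumFieldTheory.Balaban1983to89.B9StateAprioriL1 (exists_l1_control_bHK exists_l1_control_bHS) open Literature.MathematicalPhysics.QuantumFieldTheory.Balaban1983to89.B9MultiscaleSmoothPartitionYLip (CLip_nonneg) open Literature.MathematicalPhysics.QuantumFieldTheory.Balaban1983to89.B9Thm312WholeClasses (rwt rwt_nonneg)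

open Literature.MathematicalPhysics.QuantumFieldTheory.Balaban1983to89.B9LeafXCodedKnitU (b9LeafX_carriersYU) open Literature.MathematicalPhysics.QuantumFieldTheory.Balaban1983to89.B9SectBStepUGuardedR (sectBStepU_C37GY_unitary_extraYPb_d261Y) open Literature.MathematicalPhysics.QuantumFieldTheory.Balaban1983to89.B9SectBCodedClassR (regC335 regC336 bg9YC extraYPb classIncl_regC335Pb_regYPb335 classIncl_regC336Pb_regYPb336 classIncl_regYPb335_regC335Pb) open Literature.MathematicalPhysics.QuantumFieldTheory.Balaban1983to89.Node00 (Y9OfRecordUPb carriersYU CfgY BlkY IBondY deltaAY) open Literature.MathematicalPhysics.QuantumFieldTheory.Balaban1983to89.B9Eq360DeltaPrimeAY (AfldY) open Literature.MathematicalPhysics.QuantumFieldTheory.Balaban1983to89.B9RWSumsReadsNbr (nbr) open Literature.MathematicalPhysics.QuantumFieldTheory.Balaban1983to89.B9Eq340TaxiContourLocalityY (rLB) open Literature.MathematicalPhysics.QuantumFieldTheory.Balaban1983to89.B9PinMembersKLevelV1 (mstar_le_M) open Literature.MathematicalPhysics.QuantumFieldTheory.Balaban1983to89.B9LettersZSchemasMono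 (kernel_mono lettersHZ_mono letters313DZ_mono letters313DMZ_mono)

variable {N : ℕ}

section Pointed

variable [NeZero N] {F : T4Family}

set_option maxHeartbeats 2400000 in set_option synthInstance.maxSize 2048 in set_option maxRecDepth 8192 in
/-- **THE STAGE-11 CERTIFICATE AT THE STAR RECORD, EDITION 79 «UF» — EDITION 77 WITH THE (α3) BLOCK'S GUARDED `hunitA` SUPPLIED AND FOUR Z-LETTERS FEWER** (module docstring): the Sect.-B step through dag-n06-c's closed face
`sectBStepU_C37GY_su_extraYPb_closed` (Thm 3.3 via Thm 3.10 for the section-carrying sub-family, dag-n06-j), rows 20∕21 through dag-n06-l's face `…StateSUZ4` (`rgd2` by (3.152), the Q letters from the pin, `gQs2`∕`dgQs` read from `hlettersH12`), the new thresholds absorbed by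
constant-monotonicity; conclusion `B9LeafX (Node00.Y9OfRecordUPb N θ.toStage3Params M⋆ ops f bR ιB C38)`, unchanged.
[cite: Balaban1985BackgroundPropagators, Thm 3.4 p.400, Sect. B pp.400–407, (3.35)–(3.38) p.396, Thm 3.3 p.399, Thm 3.10 (3.105)–(3.106) pp.414–416, Cor. 3.8 (3.87)–(3.94) pp.408–410, Thm 3.7 p.408, (3.39)–(3.47) pp.397–398, Thm 3.11 p.416, Thm 3.15 (3.156)–(3.158) p.428, (3.185)–(3.187) p.432, (3.49) p.399, (3.130)–(3.133) pp.421–422, (3.137)–(3.138) p.423, (3.151)–(3.153) p.426, Thm 3.13 p.426, Thms 3.1–3.15 pp.397–432; Balaban1984PropagatorsII, (2.3) p.224, (2.36)–(2.45) pp.229–231, (2.51)–(2.56) pp.232–233, Lemma 2.1 (2.59)–(2.61) pp.233–234, Props. 2.2–2.6, Prop. 2.7 p.249; Balaban1984PropagatorsI, (1.18) p.20] -/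
theorem b9LeafXUR_opsYNuOfRecordV6E_pairUF
    (θ : Stage11Params F N) (hθ : θ.Admissible) (Mstar : ℕ) (𝔯 : ResY N θ.toStage3Params Mstar) (𝔢₀ : SectEY N θ.toStage3Params Mstar) (𝔴 : RWEY N θ.toStage3Params Mstar) (𝔈 : ExpsY N θ.toStage3Params Mstar) (𝔈₀ : ExpsY N θ.toStage3Params Mstar) {R₁ R₂ : RegFamY θ.d₆ θ.ℓ₆ θ.hd' θ.hL' θ.b₀ θ.b₁ Mstar (Matrix (Fin N) (Fin N) ℂ)} (c : ℝ) (hcB : c35B θ.ℓ₆ ≤ c) (hc : 0 < c) (hGR : MemOfFam (specialUnitaryUnits (Fin N)) R₁) (hRP1 : ∀ (x : MemberY θ.d₆ θ.ℓ₆ θ.hd' θ.hL' θ.b₀ θ.b₁ Mstar) (α₀ : ℝ) (U : (bg9YR (Matrix (Fin N) (Fin N) ℂ) (specialUnitaryUnits (Fin N)) R₁ R₂ x).Cfg), (bg9YR (Matrix (Fin N) (Fin N) ℂ) (specialUnitaryUnits (Fin N)) R₁ R₂ x).Reg335 c α₀ U → 0 ≤ α₀ ∧ (bg9YP (Matrix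 (Fin N) (Fin N) ℂ) (specialUnitaryUnits (Fin N)) x).Reg335 c35Y α₀ U) (hRP2 : ∀ (x : MemberY θ.d₆ θ.ℓ₆ θ.hd' θ.hL' θ.b₀ θ.b₁ Mstar) (α₀ : ℝ) (U : (bg9YR (Matrix (Fin N) (Fin N) ℂ) (specialUnitaryUnits (Fin N)) R₁ R₂ x).Cfg), (bg9YR (Matrix (Fin N) (Fin N) ℂ) (specialUnitaryUnits (Fin N)) R₁ R₂ x).Reg336 c α₀ U → 0 ≤ α₀ ∧ (bg9YP (Matrix (Fin N) (Fin N) ℂ) (specialUnitaryUnits (Fin N)) x).Reg336 c35Y α₀ U) (hP1 : ClassIncl (regYP335 (Matrix (Fin N) (Fin N) ℂ) (specialUnitaryUnits (Fin N))) c35Y R₁ c) (hP2 : ClassIncl (regYP336 (Matrix (Fin N) (Fin N) ℂ) (specialUnitaryUnits (Fin N))) c35Y R₂ c) [∀ x : MemberY θ.d₆ θ.ℓ₆ θ.hd' θ.hL' θ.b₀ θ.b₁ Mstar, Fintype (geo9Y x).Site] [∀ x : MemberY θ.d₆ θ.ℓ₆ θ.hd' θ.hL' θ.b₀ θ.b₁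 Mstar, DecidableEq (geo9Y x).Site] [∀ x : MemberY θ.d₆ θ.ℓ₆ θ.hd' θ.hL' θ.b₀ θ.b₁ Mstar, DecidableRel (RelB x.toKIdx)] (bI : ∀ x : MemberY θ.d₆ θ.ℓ₆ θ.hd' θ.hL' θ.b₀ θ.b₁ Mstar, FBondY x.toKIdx → IBondY x.toKIdx) (hβI : ∀ (x : MemberY θ.d₆ θ.ℓ₆ θ.hd' θ.hL' θ.b₀ θ.b₁ Mstar) (f : FBondY x.toKIdx) (c : IBondY x.toKIdx), blkV1 x.hN x.D f = β x.hN x.D x.hk c → β x.hN x.D x.hk (bI x f) = blkV1 x.hN x.D f) (hlev : ∀ (x : MemberY θ.d₆ θ.ℓ₆ θ.hd' θ.hL' θ.b₀ θ.b₁ Mstar) (f : FBondY x.toKIdx), lvl x.hN x.D x.hk (bI x f) = (blkV1 x.hN x.D f).1.1) (hβ1 : ∀ (x : MemberY θ.d₆ θ.ℓ₆ θ.hd' θ.hL' θ.b₀ θ.b₁ Mstar) (f : FBondY x.toKIdx), (geomT x.D).dist (β x.hN x.D x.hk (bI x f)) (blkV1 x.hN x.D f) ≤ 1) (hbI0 :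 ∀ (x : MemberY θ.d₆ θ.ℓ₆ θ.hd' θ.hL' θ.b₀ θ.b₁ Mstar) (f : FBondY x.toKIdx), bI x f = bI x ⟨f.src, 0⟩) (α' r39 δ39 B39 a39 M39 : ℝ) (hα'0 : 0 < α') (hα'1 : α' < 1) (hr39 : 0 < r39) (hrδ39 : r39 ≤ δ39) (hB39 : 0 < B39) (ha39 : 0 < a39) (hM39 : 0 < M39) (h348 : ∀ x : MemberY θ.d₆ θ.ℓ₆ θ.hd' θ.hL' θ.b₀ θ.b₁ Mstar, M39 ≤ (geo9Y x).M → ∀ α₀ : ℝ, 0 < α₀ → c * (geo9Y x).M * α₀ ≤ a39 → ∀ U : (bg9YR (Matrix (Fin N) (Fin N) ℂ) (specialUnitaryUnits (Fin N)) R₁ R₂ x).Cfg, (bg9YR (Matrix (Fin N) (Fin N) ℂ) (specialUnitaryUnits (Fin N)) R₁ R₂ x).Reg335 c α₀ U → Conv348Blk (oneCubeOps39YF θ.toStage3Params Mstar (lettersYOfRecordV4P N θ.toStage3Params Mstar 𝔯) bI x) B39 δ39 U)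
    {ιA AA : MemberY θ.d₆ θ.ℓ₆ θ.hd' θ.hL' θ.b₀ θ.b₁ Mstar → Type} [∀ x, Fintype (ιA x)] [∀ x, Fintype (AA x)] (p q : PinPrims) (hp : p.OK) (hq : q.OK) (p3 q3 : PairPrims) (hp3 : p3.OK) (hq3 : q3.OK) (pM qM : MixedPrims) (hpM : pM.OK) (hqM : qM.OK) (H : MemberY θ.d₆ θ.ℓ₆ θ.hd' θ.hL' θ.b₀ θ.b₁ Mstar → Prop) (hM₀ : nbrM₀Y θ.d₆ θ.ℓ₆ θ.hd' θ.hL' θ.b₀ θ.b₁ 2 ≤ Mstar) (hM₀' : nbrM₀Y θ.d₆ θ.ℓ₆ θ.hd' θ.hL' θ.b₀ θ.b₁ ((θ.ℓ₆ : ℝ) + 4) ≤ Mstar) (hM₀B : nbrM₀Y θ.d₆ θ.ℓ₆ θ.hd' θ.hL' θ.b₀ θ.b₁ (2 * ((θ.d₆ : ℝ) + 1)) ≤ Mstar) (𝔭 : ∀ x : MemberY θ.d₆ θ.ℓ₆ θ.hd' θ.hL' θ.b₀ θ.b₁ Mstar, HolderProbes (geo9Y x) (bg9YR (Matrix (Fin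 N) (Fin N) ℂ) (specialUnitaryUnits (Fin N)) R₁ R₂ x) (XSK (TrIdx N) x.toKIdx) (XSK (TrIdx N) x.toKIdx) (PK (SiteY x.toKIdx) (Fin (θ.d₆ + 1)) (TrIdx N)) (PK (SiteY x.toKIdx) (Fin (θ.d₆ + 1)) (TrIdx N))) (h𝔭 : ∀ x : MemberY θ.d₆ θ.ℓ₆ θ.hd' θ.hL' θ.b₀ θ.b₁ Mstar, 𝔭 x = holderProbesSA x.toKIdx (trBasis N) (bg9YR (Matrix (Fin N) (Fin N) ℂ) (specialUnitaryUnits (Fin N)) R₁ R₂ x) (fun U => U) (lettersYOfRecordV4P N θ.toStage3Params Mstar 𝔯 x).parS (bI x)) (bHX : ∀ x : MemberY θ.d₆ θ.ℓ₆ θ.hd' θ.hL' θ.b₀ θ.b₁ Mstar, ℝ → BlockNorm (toB6 (geo9Y x) 1 (H x)) ((XSK (TrIdx N) x.toKIdx) → ℝ)) (hbHX : ∀ x : MemberY θ.d₆ θ.ℓ₆ θ.hd' θ.hL' θ.b₀ θ.b₁ Mstar, bHX x = fun ε => letI : Fintype (B9GeoNormsKLevelV1.geo9K x.toKIdx).Site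 := (inferInstance : Fintype (geo9Y x).Site); bHS x.toKIdx (sIK x.toKIdx (bI x)) ε) (SH S3 SI : ∀ x : MemberY θ.d₆ θ.ℓ₆ θ.hd' θ.hL' θ.b₀ θ.b₁ Mstar, ↥(cubes x.toKIdx.D.toDomains) → Finset (geo9Y x).Site) (h36 : ∀ x, p.M₁ ≤ (geo9Y x).M → ∀ α₀ : ℝ, 0 < α₀ → c * (geo9Y x).M * α₀ ≤ p.a₁ → ∀ U : (bg9YR (Matrix (Fin N) (Fin N) ℂ) (specialUnitaryUnits (Fin N)) R₁ R₂ x).Cfg, (bg9YR (Matrix (Fin N) (Fin N) ℂ) (specialUnitaryUnits (Fin N)) R₁ R₂ x).Reg335 c α₀ U → Local342 (opsWalkY x (trBasis N) (bg9YR (Matrix (Fin N) (Fin N) ℂ) (specialUnitaryUnits (Fin N)) R₁ R₂ x) (fun U => U) (parSymY x.toKIdx) (bI x)) 1 (H x) p.B₀ p.δ₀ U) (h36H : ∀ x, p.M₁ ≤ (geo9Y x).M → ∀ α₀ : ℝ, 0 < α₀ → c * (geo9Y x).M * α₀ ≤ p.a₁ → ∀ U : (bg9YR (Matrix (Fin N)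 (Fin N) ℂ) (specialUnitaryUnits (Fin N)) R₁ R₂ x).Cfg, (bg9YR (Matrix (Fin N) (Fin N) ℂ) (specialUnitaryUnits (Fin N)) R₁ R₂ x).Reg335 c α₀ U →
      HolderLegs37 (opsWalkY x (trBasis N) (bg9YR (Matrix (Fin N) (Fin N) ℂ) (specialUnitaryUnits (Fin N)) R₁ R₂ x) (fun U => U) (parSymY x.toKIdx) (bI x)) (𝔭 x) 1 (H x) (SH x) p.Bl p.δ₀ U ∧ HolderV37Dir (opsWalkY x (trBasis N) (bg9YR (Matrix (Fin N) (Fin N) ℂ) (specialUnitaryUnits (Fin N)) R₁ R₂ x) (fun U => U) (parSymY x.toKIdx) (bI x)) (dirOpsWalkY x (trBasis N) (bg9YR (Matrix (Fin N) (Fin N) ℂ) (specialUnitaryUnits (Fin N)) R₁ R₂ x) (fun U => U) (parSymY x.toKIdx) (bI x)) (dirLettersWalkY x (trBasis N) (bg9YR (Matrix (Fin N) (Fin N) ℂ) (specialUnitaryUnits (Fin N)) R₁ R₂ x) (fun U => U) (parSymY x.toKIdx) (bI x)) (𝔭 x) 1 (H x) p.Bt p.δ₀ U ∧ (L2SecondLegs37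 (opsWalkY x (trBasis N) (bg9YR (Matrix (Fin N) (Fin N) ℂ) (specialUnitaryUnits (Fin N)) R₁ R₂ x) (fun U => U) (parSymY x.toKIdx) (bI x)) (dirOpsWalkY x (trBasis N) (bg9YR (Matrix (Fin N) (Fin N) ℂ) (specialUnitaryUnits (Fin N)) R₁ R₂ x) (fun U => U) (parSymY x.toKIdx) (bI x)) 1 (H x) (S3 x) p3.B3 p.δ₀ U ∧ (∀ q' μ, IsTransposePair ((dirLettersWalkY x (trBasis N) (bg9YR (Matrix (Fin N) (Fin N) ℂ) (specialUnitaryUnits (Fin N)) R₁ R₂ x) (fun U => U) (parSymY x.toKIdx) (bI x)).Pt U q' μ) ((dirLettersWalkY x (trBasis N) (bg9YR (Matrix (Fin N) (Fin N) ℂ) (specialUnitaryUnits (Fin N)) R₁ R₂ x) (fun U => U) (parSymY x.toKIdx) (bI x)).P U q' μ)) ∧ (∀ q', IsTransposePair ((opsWalkY x (trBasis N) (bg9YR (Matrix (Fin N) (Fin N) ℂ) (specialUnitaryUnits (Fin N)) R₁ R₂ x) (fun U => U) (parSymY x.toKIdx) (bI x)).Ct U q') ((opsWalkY x (trBasis N)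 (bg9YR (Matrix (Fin N) (Fin N) ℂ) (specialUnitaryUnits (Fin N)) R₁ R₂ x) (fun U => U) (parSymY x.toKIdx) (bI x)).Cop U q'))) ∧ (InputLegsPair37 (opsWalkY x (trBasis N) (bg9YR (Matrix (Fin N) (Fin N) ℂ) (specialUnitaryUnits (Fin N)) R₁ R₂ x) (fun U => U) (parSymY x.toKIdx) (bI x)) (dirOpsWalkY x (trBasis N) (bg9YR (Matrix (Fin N) (Fin N) ℂ) (specialUnitaryUnits (Fin N)) R₁ R₂ x) (fun U => U) (parSymY x.toKIdx) (bI x)) (𝔭 x) 1 (H x) (bHX x) (SI x) p.BI p.BI2 p.δ₀ U ∧ FactorsInputPair37Dir (opsWalkY x (trBasis N) (bg9YR (Matrix (Fin N) (Fin N) ℂ) (specialUnitaryUnits (Fin N)) R₁ R₂ x) (fun U => U) (parSymY x.toKIdx) (bI x)) (dirOpsWalkY x (trBasis N) (bg9YR (Matrix (Fin N) (Fin N) ℂ) (specialUnitaryUnits (Fin N)) R₁ R₂ x) (fun U => U) (parSymY x.toKIdx) (bI x)) (dirLettersWalkY x (trBasis N) (bg9YR (Matrix (Fin N) (Fin N)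 ℂ) (specialUnitaryUnits (Fin N)) R₁ R₂ x) (fun U => U) (parSymY x.toKIdx) (bI x)) 1 (H x) (bHX x) p.θI p.δ₀ U))
    (hM1mix : MMix θ.d₆ θ.ℓ₆ θ.hd' θ.hL' θ.b₀ θ.b₁ Mstar N c hc ≤ p.M₁) (ha1mix : p.a₁ ≤ aMix θ.d₆ θ.ℓ₆ θ.hd' θ.hL' θ.b₀ θ.b₁ Mstar N c hc) (hBMmix : BMix θ.d₆ θ.ℓ₆ θ.hd' θ.hL' θ.b₀ θ.b₁ Mstar N c hc ≤ pM.BM) (hδmix : p.δ₀ ≤ δMix θ.d₆ θ.ℓ₆ θ.hd' θ.hL' θ.b₀ θ.b₁ Mstar N c hc) (hM1fac : MRec θ.d₆ θ.ℓ₆ θ.hd' θ.hL' θ.b₀ θ.b₁ Mstar N c hc ≤ p.M₁) (ha1fac : p.a₁ ≤ aRec θ.d₆ θ.ℓ₆ θ.hd' θ.hL' θ.b₀ θ.b₁ Mstar N c hc) (hδfac : p.δ₀ ≤ δRec θ.d₆ θ.ℓ₆ θ.hd' θ.hL' θ.b₀ θ.b₁ Mstar N c hc) (hθfac : p.θ₀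 * Real.exp ((3 / 4 + p.δ₀) * p.ρ) * BRec θ.d₆ θ.ℓ₆ θ.hd' θ.hL' θ.b₀ θ.b₁ Mstar N c hc ≤ pM.θM) (hcntH : ∀ x (a : (geo9Y x).Site), (∑ c, if a ∈ SH x c then (1 : ℝ) else 0) ≤ p.NH) (hcnt3 : ∀ x (a : (geo9Y x).Site), (∑ c, if a ∈ S3 x c then (1 : ℝ) else 0) ≤ p3.N3) (hcntI : ∀ x (a : (geo9Y x).Site), (∑ c, if a ∈ SI x c then (1 : ℝ) else 0) ≤ p.NI) (hMw : ∀ x : MemberY θ.d₆ θ.ℓ₆ θ.hd' θ.hL' θ.b₀ θ.b₁ Mstar, walkCntM₀Y θ.d₆ θ.ℓ₆ θ.hd' θ.hL' θ.b₀ θ.b₁ Mstar ≤ (geo9Y x).M) (hNMw : walkCntY θ.d₆ θ.ℓ₆ θ.hd' θ.hL' θ.b₀ θ.b₁ Mstar ≤ pM.NM) (hM3 : nbrM₀Y θ.d₆ θ.ℓ₆ θ.hd' θ.hL' θ.b₀ θ.b₁ 3 ≤ Mstar) (hρ3 : 3 ≤ p.ρ) (hNc : walkCntY θ.d₆ θ.ℓ₆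 θ.hd' θ.hL' θ.b₀ θ.b₁ Mstar ≤ p.Nc) (hN' : walkCntY θ.d₆ θ.ℓ₆ θ.hd' θ.hL' θ.b₀ θ.b₁ Mstar ≤ p.N') (hCℓ : (((θ.ℓ₆ + 1 : ℕ) : ℝ)) ^ 2 ≤ p.Cℓ) (hKc : KcWalkY θ.d₆ θ.ℓ₆ θ.hd' θ.hL' θ.b₀ θ.b₁ (trBasis N) ≤ p.Kc) (hθ₀ : thetaWalkY θ.d₆ θ.ℓ₆ θ.hd' θ.hL' θ.b₀ θ.b₁ (trBasis N) p.Cℓ ≤ p.θ₀) (𝔬A : ∀ x : MemberY θ.d₆ θ.ℓ₆ θ.hd' θ.hL' θ.b₀ θ.b₁ Mstar, Ops310 (geo9Y x) (bg9YR (Matrix (Fin N) (Fin N) ℂ) (specialUnitaryUnits (Fin N)) R₁ R₂ x) (XBK (TrIdx N) x.toKIdx) (XBK (TrIdx N) x.toKIdx) (ιA x) (AA x)) (rdA : ∀ x : MemberY θ.d₆ θ.ℓ₆ θ.hd' θ.hL' θ.b₀ θ.b₁ Mstar, WalkReading310 (geo9Y x) (bg9YR (Matrix (Fin N) (Fin N)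 ℂ) (specialUnitaryUnits (Fin N)) R₁ R₂ x) (XBK (TrIdx N) x.toKIdx) (ιA x) (AA x)) (𝔭A : ∀ x : MemberY θ.d₆ θ.ℓ₆ θ.hd' θ.hL' θ.b₀ θ.b₁ Mstar, HolderProbes (geo9Y x) (bg9YR (Matrix (Fin N) (Fin N) ℂ) (specialUnitaryUnits (Fin N)) R₁ R₂ x) (XBK (TrIdx N) x.toKIdx) (XBK (TrIdx N) x.toKIdx) (PK (FBondY x.toKIdx) (Fin (θ.d₆ + 1)) (TrIdx N)) (PK (FBondY x.toKIdx) (Fin (θ.d₆ + 1)) (TrIdx N))) (h𝔭A : ∀ x : MemberY θ.d₆ θ.ℓ₆ θ.hd' θ.hL' θ.b₀ θ.b₁ Mstar, 𝔭A x = holderProbesKA x.toKIdx (trBasis N) (bg9YR (Matrix (Fin N) (Fin N) ℂ) (specialUnitaryUnits (Fin N)) R₁ R₂ x) (fun U => U) (lettersYOfRecordV4P N θ.toStage3Params Mstar 𝔯 x).parB (bI x)) (𝔡A : ∀ x : MemberY θ.d₆ θ.ℓ₆ θ.hd' θ.hL' θ.b₀ θ.b₁ Mstar, DirOps310 (𝔬A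 x) (Fin (θ.d₆ + 1))) (𝔩A : ∀ x : MemberY θ.d₆ θ.ℓ₆ θ.hd' θ.hL' θ.b₀ θ.b₁ Mstar, DirLetters310 (𝔬A x) (Fin (θ.d₆ + 1))) (bHXA : ∀ x : MemberY θ.d₆ θ.ℓ₆ θ.hd' θ.hL' θ.b₀ θ.b₁ Mstar, ℝ → BlockNorm (toB6 (geo9Y x) 1 (H x)) ((XBK (TrIdx N) x.toKIdx) → ℝ)) (κA : MemberY θ.d₆ θ.ℓ₆ θ.hd' θ.hL' θ.b₀ θ.b₁ Mstar → Sizes310) (SHA S3A SIA SMA S2A : ∀ x : MemberY θ.d₆ θ.ℓ₆ θ.hd' θ.hL' θ.b₀ θ.b₁ Mstar, ιA x → Finset (geo9Y x).Site) (hbHXA : ∀ x : MemberY θ.d₆ θ.ℓ₆ θ.hd' θ.hL' θ.b₀ θ.b₁ Mstar, bHXA x = fun ε => letI : Fintype (B9GeoNormsKLevelV1.geo9K x.toKIdx).Site := (inferInstance : Fintype (geo9Y x).Site); bHK x.toKIdx (bI x) ε) (hstA : ∀ x, StaticOK310 (𝔬A x) q.ρ q.Nc q.N' q.NF q.Cℓ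 (κA x)) (hκA : ∀ x, (κA x).Bounded q.Kc) (hrdA : ∀ x, (rdA x).OKRel (𝔬A x).blk (RelB x.toKIdx)) (hlocA : ∀ x, Locality310 (𝔬A x) (rdA x)) (h36A : ∀ x, q.M₁ ≤ (geo9Y x).M → ∀ α₀ : ℝ, 0 < α₀ → c * (geo9Y x).M * α₀ ≤ q.a₁ → ∀ U : (bg9YR (Matrix (Fin N) (Fin N) ℂ) (specialUnitaryUnits (Fin N)) R₁ R₂ x).Cfg, (bg9YR (Matrix (Fin N) (Fin N) ℂ) (specialUnitaryUnits (Fin N)) R₁ R₂ x).Reg335 c α₀ U → Local342G (𝔬A x) 1 (H x) q.B₀ q.δ₀ U ∧ B9Thm310Whole.Factors389 (𝔬A x) 1 (H x) q.θ₀ q.δ₀ U ∧ Identities310₂ (𝔬A x) (𝔡A x) (𝔩A x) 1 (H x) U)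
    (hGsqA : ∀ x, q.M₁ ≤ (geo9Y x).M → ∀ α₀ : ℝ, 0 < α₀ → c * (geo9Y x).M * α₀ ≤ q.a₁ → ∀ U : (bg9YR (Matrix (Fin N) (Fin N) ℂ) (specialUnitaryUnits (Fin N)) R₁ R₂ x).Cfg, (bg9YR (Matrix (Fin N) (Fin N) ℂ) (specialUnitaryUnits (Fin N)) R₁ R₂ x).Reg335 c α₀ U → ∀ i, IsTransposePair ((𝔬A x).Gsq U i) ((𝔬A x).Gsq U i) ∧ ∀ v, 0 ≤ v ⬝ᵥ (𝔬A x).Gsq U i v) (h36HA : ∀ x, q.M₁ ≤ (geo9Y x).M → ∀ α₀ : ℝ, 0 < α₀ → c * (geo9Y x).M * α₀ ≤ q.a₁ → ∀ U : (bg9YR (Matrix (Fin N) (Fin N) ℂ) (specialUnitaryUnits (Fin N)) R₁ R₂ x).Cfg, (bg9YR (Matrix (Fin N) (Fin N) ℂ) (specialUnitaryUnits (Fin N)) R₁ R₂ x).Reg335 c α₀ U → HolderLegs310 (𝔬A x) (𝔭A x) 1 (H x) (SHA x) q.Bl q.δ₀ U ∧ FactorsHolder310 (𝔬A x) (𝔭A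 x) 1 (H x) q.Bt q.δ₀ U ∧ (L2SecondLegs310 (𝔬A x) (𝔡A x) 1 (H x) (S3A x) q3.B3 q.δ₀ U ∧ ∀ a, IsTransposePair ((𝔬A x).Rt U a) ((𝔬A x).Rf U a)) ∧ (InputLegsPair310 (𝔬A x) (𝔡A x) (𝔭A x) 1 (H x) (bHXA x) (SIA x) q.BI q.BI2 q.δ₀ U ∧ FactorsInputPair310 (𝔬A x) (𝔡A x) 1 (H x) (bHXA x) q.θI q.δ₀ U) ∧ (L2MixedLegs310 (𝔬A x) (𝔡A x) 1 (H x) (SMA x) qM.BM q.δ₀ U ∧ FactorsL2Mixed310 (𝔬A x) (𝔡A x) 1 (H x) qM.θM q.δ₀ U)) (h36A2 : ∀ x, q.M₁ ≤ (geo9Y x).M → ∀ α₀ : ℝ, 0 < α₀ → c * (geo9Y x).M * α₀ ≤ q.a₁ → ∀ U : (bg9YR (Matrix (Fin N) (Fin N) ℂ) (specialUnitaryUnits (Fin N)) R₁ R₂ x).Cfg, (bg9YR (Matrix (Fin N) (Fin N) ℂ) (specialUnitaryUnits (Fin N)) R₁ R₂ x).Reg335 c α₀ U → L2TwoLegs310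 (𝔬A x) 1 (H x) (S2A x) q.B2 q.δ₀ U ∧ FactorsL2_310 (𝔬A x) 1 (H x) q.θ2 q.δ₀ U) (hcntHA : ∀ x (a : (geo9Y x).Site), (∑ c, if a ∈ SHA x c then (1 : ℝ) else 0) ≤ q.NH) (hcnt3A : ∀ x (a : (geo9Y x).Site), (∑ c, if a ∈ S3A x c then (1 : ℝ) else 0) ≤ q3.N3) (hcntIA : ∀ x (a : (geo9Y x).Site), (∑ c, if a ∈ SIA x c then (1 : ℝ) else 0) ≤ q.NI) (hcntMA : ∀ x (a : (geo9Y x).Site), (∑ c, if a ∈ SMA x c then (1 : ℝ) else 0) ≤ qM.NM) (hcnt2A : ∀ x (a : (geo9Y x).Site), (∑ c, if a ∈ S2A x c then (1 : ℝ) else 0) ≤ q.N2)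
    (hblkA : ∀ x : MemberY θ.d₆ θ.ℓ₆ θ.hd' θ.hL' θ.b₀ θ.b₁ Mstar, (𝔬A x).blk = blkBK x.toKIdx (bI x)) (hblkYA : ∀ x : MemberY θ.d₆ θ.ℓ₆ θ.hd' θ.hL' θ.b₀ θ.b₁ Mstar, (𝔬A x).blkY = blkBK x.toKIdx (bI x)) (hGcoA : ∀ (x : MemberY θ.d₆ θ.ℓ₆ θ.hd' θ.hL' θ.b₀ θ.b₁ Mstar) (U : (bg9YR (Matrix (Fin N) (Fin N) ℂ) (specialUnitaryUnits (Fin N)) R₁ R₂ x).Cfg), (𝔬A x).G U = GcoK x.toKIdx (trBasis N) (bg9YR (Matrix (Fin N) (Fin N) ℂ) (specialUnitaryUnits (Fin N)) R₁ R₂ x) (fun U => U) (lettersYOfRecordV4P N θ.toStage3Params Mstar 𝔯 x).GA U) (hDcoA : ∀ (x : MemberY θ.d₆ θ.ℓ₆ θ.hd' θ.hL' θ.b₀ θ.b₁ Mstar) (U : (bg9YR (Matrix (Fin N) (Fin N) ℂ) (specialUnitaryUnits (Fin N)) R₁ R₂ x).Cfg), (𝔬A x).D U = DcoK x.toKIdx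 (trBasis N) (bg9YR (Matrix (Fin N) (Fin N) ℂ) (specialUnitaryUnits (Fin N)) R₁ R₂ x) (fun U => U) U) (hDscoA : ∀ (x : MemberY θ.d₆ θ.ℓ₆ θ.hd' θ.hL' θ.b₀ θ.b₁ Mstar) (U : (bg9YR (Matrix (Fin N) (Fin N) ℂ) (specialUnitaryUnits (Fin N)) R₁ R₂ x).Cfg), (𝔬A x).Dstar U = DscoK x.toKIdx (trBasis N) (bg9YR (Matrix (Fin N) (Fin N) ℂ) (specialUnitaryUnits (Fin N)) R₁ R₂ x) (fun U => U) U) (hLcoA : ∀ (x : MemberY θ.d₆ θ.ℓ₆ θ.hd' θ.hL' θ.b₀ θ.b₁ Mstar) (U : (bg9YR (Matrix (Fin N) (Fin N) ℂ) (specialUnitaryUnits (Fin N)) R₁ R₂ x).Cfg), (𝔬A x).Lap U = LcoK x.toKIdx (trBasis N) (bg9YR (Matrix (Fin N) (Fin N) ℂ) (specialUnitaryUnits (Fin N)) R₁ R₂ x) (fun U => U) U) (h𝔡Ad : ∀ (x : MemberY θ.d₆ θ.ℓ₆ θ.hd' θ.hL' θ.b₀ θ.b₁ Mstar) (U : (bg9YR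 (Matrix (Fin N) (Fin N) ℂ) (specialUnitaryUnits (Fin N)) R₁ R₂ x).Cfg), (𝔡A x).Dd U = fun μ => coordOpK (trBasis N) (fun _ : Fin (θ.d₆ + 1) => cdBₗ x.toKIdx U μ)) (h𝔡As : ∀ (x : MemberY θ.d₆ θ.ℓ₆ θ.hd' θ.hL' θ.b₀ θ.b₁ Mstar) (U : (bg9YR (Matrix (Fin N) (Fin N) ℂ) (specialUnitaryUnits (Fin N)) R₁ R₂ x).Cfg), (𝔡A x).Dsd U = fun μ => coordOpK (trBasis N) (fun _ : Fin (θ.d₆ + 1) => cdsBₗ x.toKIdx U μ)) (hGsqAS : ∀ (x : MemberY θ.d₆ θ.ℓ₆ θ.hd' θ.hL' θ.b₀ θ.b₁ Mstar) (U : (bg9YR (Matrix (Fin N) (Fin N) ℂ) (specialUnitaryUnits (Fin N)) R₁ R₂ x).Cfg) (j : ιA x), ∃ (r : ℝ) (G : (FBondY x.toKIdx → Matrix (Fin N) (Fin N) ℂ) →ₗ[ℝ] (FBondY x.toKIdx → Matrix (Fin N) (Fin N) ℂ)), (𝔬A x).Gsq U j = r • coordOpK (trBasis N) (fun _ : Fin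 (θ.d₆ + 1) => G)) (𝔬12 : ∀ x : MemberY θ.d₆ θ.ℓ₆ θ.hd' θ.hL' θ.b₀ θ.b₁ Mstar, B9Thm312Whole.Ops (geo9Y x) (bg9YR (Matrix (Fin N) (Fin N) ℂ) (specialUnitaryUnits (Fin N)) R₁ R₂ x) (XBK (TrIdx N) x.toKIdx) (XBK (TrIdx N) x.toKIdx) (XHK (TrIdx N) x.toKIdx) (XSK (TrIdx N) x.toKIdx))
    -- (t4, edition 79) THE EXPANSIONS OF RECORD: `𝔈` IS node00-def-Y's `expsYOfRecordV2` over the base record `𝔈₀` — ONE definitional equation replaces the seven displayed pins `hEK39 hPD hE37 hE310 hpinE hpinH hpinK` of editions ≤ 78 (`OpsYExpsOfRecordV2.pins_of_eq`, rfl transport)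
    (h𝔈 : 𝔈 = expsYOfRecordV2 N θ.toStage3Params Mstar 𝔯 𝔈₀ R₁ R₂ bI α' r39 B39 p q p3 q3 pM qM H 𝔬A rdA 𝔬12) (bH13 : ∀ x : MemberY θ.d₆ θ.ℓ₆ θ.hd' θ.hL' θ.b₀ θ.b₁ Mstar, (bg9YR (Matrix (Fin N) (Fin N) ℂ) (specialUnitaryUnits (Fin N)) R₁ R₂ x).Cfg → BlockNorm (toB6 (geo9Y x) 1 (H x)) (XSK (TrIdx N) x.toKIdx → ℝ)) (δ12₀ δK12 σ12 ρ12 a12 M12 B12₃ δ12₃ ρ13 α12 : ℝ) (ρf12 : ℝ) (Bq12 : ℝ → ℝ) (hρf12 : 0 < ρf12) (hρf1 : ρf12 + σ12 ≤ (1 - α12) * ρ12) (hρf2 : ρf12 + 2 * σ12 + α12 * ρ12 ≤ ρ12) (hBq12 : ∀ β, 0 ≤ Bq12 β) (hB12₃ : 0 ≤ B12₃) (hσ12 : 0 < σ12) (hρ12 : 0 < ρ12) (hρS12 : ρ12 ≤ δ12₀) (hρδ12 : ρ12 + 2 * σ12 ≤ δK12) (hρ₃12 : ρ12 + σ12 ≤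 δ12₃) (ha12 : 0 < a12) (hM12 : 0 < M12) (hα12 : 0 < α12) (hα12' : α12 ≤ 1 / 2) (hδ₃₀ : δ12₃ ≤ δ12₀) (hδ12₀ : δ12₀ ≤ (1 - 3 * q.αF) * ((1 - 2 * q.α) * q.δ₀)) (t12 δT12 ρS σS : ℝ) (ht12 : 0 ≤ t12) (hσS : 0 < σS) (hρST : ρS ≤ δT12) (hρS₀ : ρS + σS ≤ δ12₀) (hδKS : δK12 + q.αF * ((1 - 2 * q.α) * q.δ₀) ≤ ρS) (hσSK : σS ≤ δK12) (bXH : ∀ x : MemberY θ.d₆ θ.ℓ₆ θ.hd' θ.hL' θ.b₀ θ.b₁ Mstar, (bg9YR (Matrix (Fin N) (Fin N) ℂ) (specialUnitaryUnits (Fin N)) R₁ R₂ x).Cfg → BlockNorm (toB6 (geo9Y x) 1 (H x)) (XBK (TrIdx N) x.toKIdx → ℝ)) (w13 wX : ℝ → ℝ) (hw13₀ : ∀ s, 0 ≤ w13 s) (hw13₁ : ∀ s, w13 s ≤ 1) (hwX₀ : ∀ s, 0 ≤ wX s) (hwX₁ : ∀ s, wX s ≤ 1) (hbH13 : ∀ (x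 : MemberY θ.d₆ θ.ℓ₆ θ.hd' θ.hL' θ.b₀ θ.b₁ Mstar) (U : (bg9YR (Matrix (Fin N) (Fin N) ℂ) (specialUnitaryUnits (Fin N)) R₁ R₂ x).Cfg), bH13 x U = letI : Fintype (B9GeoNormsKLevelV1.geo9K x.toKIdx).Site := (inferInstance : Fintype (geo9Y x).Site); bHZPG (κ := TrIdx N) x.toKIdx (trBasis N) (taxiS x.toKIdx (bg9YR (Matrix (Fin N) (Fin N) ℂ) (specialUnitaryUnits (Fin N)) R₁ R₂ x) (fun U => U) U) (R := (1 : ℝ)) (H := H x) w13 hw13₀ hw13₁) (hbXH : ∀ (x : MemberY θ.d₆ θ.ℓ₆ θ.hd' θ.hL' θ.b₀ θ.b₁ Mstar) (U : (bg9YR (Matrix (Fin N) (Fin N) ℂ) (specialUnitaryUnits (Fin N)) R₁ R₂ x).Cfg), bXH x U = letI : Fintype (B9GeoNormsKLevelV1.geo9K x.toKIdx).Site := (inferInstance : Fintype (geo9Y x).Site); bHZKPG (κ := TrIdx N) x.toKIdx (trBasis N) (taxiB x.toKIdx (bg9YR (Matrix (Fin N) (Fin N) ℂ) (specialUnitaryUnits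 (Fin N)) R₁ R₂ x) (fun U => U) U) (R := (1 : ℝ)) (H := H x) wX hwX₀ hwX₁) (hρ13 : 0 < ρ13) (hρ13ρ : ρ13 + 5 * σ12 ≤ ρ12) (hσρ13 : 3 * σ12 < (1 - α12) * ρ13) (B13₄ : ℝ) (Br13 Bx13 Bd13 : ℝ → ℝ) (Bd2₁₃ : ℝ → ℝ → ℝ) (hB13₄ : 0 ≤ B13₄) (hBr13 : ∀ ε, 0 < ε → 0 ≤ Br13 ε) (hBx13 : ∀ β, 0 ≤ β → β < 1 → 0 ≤ Bx13 β) (hBd13 : ∀ ε, 0 < ε → ε ≤ 1 → 0 ≤ Bd13 ε) (hBd2₁₃ : ∀ ε β, 0 < ε → ε ≤ 1 → 0 ≤ β → β < 1 → 0 ≤ Bd2₁₃ ε β) (tJ δB rT : ℝ) (ha1J : 10 * ((θ.ℓ₆ + 1 : ℕ) : ℝ) ^ 7 * a12 ≤ 1) (htJ : 2 * ((θ.d₆ : ℝ) + 1) * (((θ.ℓ₆ + 1 : ℕ) : ℝ)) ^ 3 * (N : ℝ) * (10 ^ 4 * ((θ.d₆ : ℝ) + 1) * (10 * ((θ.ℓ₆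 + 1 : ℕ) : ℝ) ^ 7)) * Real.exp (3 * δB) ≤ tJ) (hrTP : rT ≤ min ((1 - 2 * p.α) * p.δ₀) δ39 / 8) (hrTB : rT ≤ δB) (hδT12 : 0 ≤ δT12) (hδTr : δT12 + 3 * σS + 3 * (q.αF * ((1 - 2 * q.α) * q.δ₀)) ≤ rT) (ϑF : ℝ) (hϑF : 2 * (10 * (((θ.ℓ₆ + 1 : ℕ) : ℝ)) * a12) * (1 + 10 * (((θ.ℓ₆ + 1 : ℕ) : ℝ)) * a12) * Real.exp (4 * (10 * (((θ.ℓ₆ + 1 : ℕ) : ℝ)) * a12)) * (((θ.ℓ₆ + 1 : ℕ) : ℝ)) ≤ ϑF) (sch : ℝ → ℝ) (hsch0 : ∀ β', 0 ≤ β' → β' < 1 → 0 < sch β') (hsch1 : ∀ β', 0 ≤ β' → β' < 1 → sch β' < 1) (hwsch : ∀ β', 0 ≤ β' → β' < 1 → 0 < w13 (sch β')) (δ45 : ℝ) (hδ45 : δ12₃ < δ45) (BZ : ℝ → ℝ) (hBZ : ∀ β', 0 ≤ β' → β' < 1 → 0 ≤ BZ β') (h45X : ∀ x : MemberY θ.d₆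 θ.ℓ₆ θ.hd' θ.hL' θ.b₀ θ.b₁ Mstar, letI : Fintype (B9GeoNormsKLevelV1.geo9K x.toKIdx).Site := (inferInstance : Fintype (geo9Y x).Site); M12 ≤ (geo9Y x).M → ∀ α₀ : ℝ, 0 < α₀ → (geo9Y x).M * α₀ ≤ a12 → ∀ U : (bg9YR (Matrix (Fin N) (Fin N) ℂ) (specialUnitaryUnits (Fin N)) R₁ R₂ x).Cfg, (bg9YR (Matrix (Fin N) (Fin N) ℂ) (specialUnitaryUnits (Fin N)) R₁ R₂ x).Reg335 c α₀ U →
      (bg9YR (Matrix (Fin N) (Fin N) ℂ) (specialUnitaryUnits (Fin N)) R₁ R₂ x).Reg336 c α₀ U → ∀ (ν μ : Fin (θ.d₆ + 1)) (β' : ℝ) (h0 : 0 ≤ β') (h1 : β' < 1), HasMaj (bHZKP (κ := TrIdx N) x.toKIdx (trBasis N) (taxiB x.toKIdx (bg9YR (Matrix (Fin N) (Fin N) ℂ) (specialUnitaryUnits (Fin N)) R₁ R₂ x) (fun U => U) U) (R := (1 : ℝ)) (H := H x) (hsch0 β' h0 h1).le (hsch1 β' h0 h1).le) (cNormR 1 (H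 x) (𝔭A x).blkPX (fun y => (geo9Y_len_pos x y).le) (β' - 1)) ((𝔭A x).ΦX U β' ∘ₗ ((𝔡A x).Dd U ν ∘ₗ ((𝔬12 x).G0 U ∘ₗ (𝔡A x).Dsd U μ))) (fun a a' => BZ β' * Real.exp (-(δ45 * (geo9Y x).dist a a')))) (hlettersH12 : ∀ x : MemberY θ.d₆ θ.ℓ₆ θ.hd' θ.hL' θ.b₀ θ.b₁ Mstar, M12 ≤ (geo9Y x).M → ∀ α₀ : ℝ, 0 < α₀ → (geo9Y x).M * α₀ ≤ a12 → ∀ U : (bg9YR (Matrix (Fin N) (Fin N) ℂ) (specialUnitaryUnits (Fin N)) R₁ R₂ x).Cfg, (bg9YR (Matrix (Fin N) (Fin N) ℂ) (specialUnitaryUnits (Fin N)) R₁ R₂ x).Reg335 c α₀ U → (bg9YR (Matrix (Fin N) (Fin N) ℂ) (specialUnitaryUnits (Fin N)) R₁ R₂ x).Reg336 c α₀ U → LettersHZ (𝔬12 x) 1 (H x) ⟨geo9Y_dist_triangle x, geo9Y_dist_comm x, geo9K_dist_nonneg x.toKIdx, geo9Y_len_pos x⟩ (weightNorm (BlockNorm.ofBlocks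 (toB6 (geo9Y x) 1 (H x)) (𝔬12 x).blkZ) (fun y => ((((θ.ℓ₆ + 1 : ℕ) : ℝ) ^ (θ.d₆ + 1)) ^ lvl x.hN x.D x.hk y)⁻¹) (fun y => (plateau_pos x.toKIdx y).le)) B12₃ δ12₃ U)
    (hblk12 : ∀ x : MemberY θ.d₆ θ.ℓ₆ θ.hd' θ.hL' θ.b₀ θ.b₁ Mstar, (𝔬12 x).blk = blkBK x.toKIdx (bI x)) (hblkW12 : ∀ x : MemberY θ.d₆ θ.ℓ₆ θ.hd' θ.hL' θ.b₀ θ.b₁ Mstar, (𝔬12 x).blkW = blkSK x.toKIdx (sIK x.toKIdx (bI x))) (hblkY12 : ∀ x : MemberY θ.d₆ θ.ℓ₆ θ.hd' θ.hL' θ.b₀ θ.b₁ Mstar, (𝔬12 x).blkY = blkBK x.toKIdx (bI x)) (hG0co12 : ∀ (x : MemberY θ.d₆ θ.ℓ₆ θ.hd' θ.hL' θ.b₀ θ.b₁ Mstar) (U : (bg9YR (Matrix (Fin N) (Fin N) ℂ) (specialUnitaryUnits (Fin N)) R₁ R₂ x).Cfg), (𝔬12 x).G0 U = GcoK x.toKIdx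 (trBasis N) (bg9YR (Matrix (Fin N) (Fin N) ℂ) (specialUnitaryUnits (Fin N)) R₁ R₂ x) (fun U => U) (lettersYOfRecordV4P N θ.toStage3Params Mstar 𝔯 x).GA U) (hGco12 : ∀ (x : MemberY θ.d₆ θ.ℓ₆ θ.hd' θ.hL' θ.b₀ θ.b₁ Mstar) (U : (bg9YR (Matrix (Fin N) (Fin N) ℂ) (specialUnitaryUnits (Fin N)) R₁ R₂ x).Cfg), (𝔬12 x).G U = GcoK x.toKIdx (trBasis N) (bg9YR (Matrix (Fin N) (Fin N) ℂ) (specialUnitaryUnits (Fin N)) R₁ R₂ x) (fun U => U) (lettersYOfRecordV4P N θ.toStage3Params Mstar 𝔯 x).GD U) (hG1co12 : ∀ (x : MemberY θ.d₆ θ.ℓ₆ θ.hd' θ.hL' θ.b₀ θ.b₁ Mstar) (U : (bg9YR (Matrix (Fin N) (Fin N) ℂ) (specialUnitaryUnits (Fin N)) R₁ R₂ x).Cfg), (𝔬12 x).G1 U = GcoK x.toKIdx (trBasis N) (bg9YR (Matrix (Fin N) (Fin N) ℂ) (specialUnitaryUnits (Fin N)) R₁ R₂ x) (fun U => U) (lettersYOfRecordV4P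 N θ.toStage3Params Mstar 𝔯 x).G₁ U) (hGGco12 : ∀ (x : MemberY θ.d₆ θ.ℓ₆ θ.hd' θ.hL' θ.b₀ θ.b₁ Mstar) (U : (bg9YR (Matrix (Fin N) (Fin N) ℂ) (specialUnitaryUnits (Fin N)) R₁ R₂ x).Cfg), (𝔬12 x).GG U = GcoK x.toKIdx (trBasis N) (bg9YR (Matrix (Fin N) (Fin N) ℂ) (specialUnitaryUnits (Fin N)) R₁ R₂ x) (fun U => U) (lettersYOfRecordV4P N θ.toStage3Params Mstar 𝔯 x).GG U) (hDco12 : ∀ (x : MemberY θ.d₆ θ.ℓ₆ θ.hd' θ.hL' θ.b₀ θ.b₁ Mstar) (U : (bg9YR (Matrix (Fin N) (Fin N) ℂ) (specialUnitaryUnits (Fin N)) R₁ R₂ x).Cfg), (𝔬12 x).D U = DcoK x.toKIdx (trBasis N) (bg9YR (Matrix (Fin N) (Fin N) ℂ) (specialUnitaryUnits (Fin N)) R₁ R₂ x) (fun U => U) U) (hDsco12 : ∀ (x : MemberY θ.d₆ θ.ℓ₆ θ.hd' θ.hL' θ.b₀ θ.b₁ Mstar) (U : (bg9YR (Matrix (Fin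 N) (Fin N) ℂ) (specialUnitaryUnits (Fin N)) R₁ R₂ x).Cfg), (𝔬12 x).Dstar U = DscoK x.toKIdx (trBasis N) (bg9YR (Matrix (Fin N) (Fin N) ℂ) (specialUnitaryUnits (Fin N)) R₁ R₂ x) (fun U => U) U) (hblkZ12 : ∀ x : MemberY θ.d₆ θ.ℓ₆ θ.hd' θ.hL' θ.b₀ θ.b₁ Mstar, (𝔬12 x).blkZ = blkHK x.toKIdx) (hHm12 : ∀ (x : MemberY θ.d₆ θ.ℓ₆ θ.hd' θ.hL' θ.b₀ θ.b₁ Mstar) (U : (bg9YR (Matrix (Fin N) (Fin N) ℂ) (specialUnitaryUnits (Fin N)) R₁ R₂ x).Cfg), (𝔬12 x).Hm U = HcoK x.toKIdx (trBasis N) (bg9YR (Matrix (Fin N) (Fin N) ℂ) (specialUnitaryUnits (Fin N)) R₁ R₂ x) (fun U => U) (lettersYOfRecordV4P N θ.toStage3Params Mstar 𝔯 x).H U) (hH1m12 : ∀ (x : MemberY θ.d₆ θ.ℓ₆ θ.hd' θ.hL' θ.b₀ θ.b₁ Mstar) (U : (bg9YR (Matrix (Fin N) (Fin N) ℂ) (specialUnitaryUnits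 (Fin N)) R₁ R₂ x).Cfg), (𝔬12 x).H1m U = HcoK x.toKIdx (trBasis N) (bg9YR (Matrix (Fin N) (Fin N) ℂ) (specialUnitaryUnits (Fin N)) R₁ R₂ x) (fun U => U) (lettersYOfRecordV4P N θ.toStage3Params Mstar 𝔯 x).H₁ U)
    (hS0co12 : ∀ (x : MemberY θ.d₆ θ.ℓ₆ θ.hd' θ.hL' θ.b₀ θ.b₁ Mstar) (U : (bg9YR (Matrix (Fin N) (Fin N) ℂ) (specialUnitaryUnits (Fin N)) R₁ R₂ x).Cfg), (𝔬12 x).S0 U = S0coK x.toKIdx (trBasis N) (bg9YR (Matrix (Fin N) (Fin N) ℂ) (specialUnitaryUnits (Fin N)) R₁ R₂ x) (fun U => U) (parSymY x.toKIdx) (parBY x.toKIdx) (GpPhysY x.toKIdx (parSymY x.toKIdx)) U) (hTpico12 : ∀ (x : MemberY θ.d₆ θ.ℓ₆ θ.hd' θ.hL' θ.b₀ θ.b₁ Mstar) (U : (bg9YR (Matrix (Fin N) (Fin N) ℂ) (specialUnitaryUnits (Fin N)) R₁ R₂ x).Cfg), (𝔬12 x).Tpi U = TpicoK x.toKIdx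 (trBasis N) (bg9YR (Matrix (Fin N) (Fin N) ℂ) (specialUnitaryUnits (Fin N)) R₁ R₂ x) (fun U => U) (parSymY x.toKIdx) (GpPhysY x.toKIdx (parSymY x.toKIdx)) U) (hT2co12 : ∀ (x : MemberY θ.d₆ θ.ℓ₆ θ.hd' θ.hL' θ.b₀ θ.b₁ Mstar) (U : (bg9YR (Matrix (Fin N) (Fin N) ℂ) (specialUnitaryUnits (Fin N)) R₁ R₂ x).Cfg), (𝔬12 x).T2 U = T2coK x.toKIdx (trBasis N) (bg9YR (Matrix (Fin N) (Fin N) ℂ) (specialUnitaryUnits (Fin N)) R₁ R₂ x) (fun U => U) (parSymY x.toKIdx) (GpPhysY x.toKIdx (parSymY x.toKIdx)) (𝔯 x).Δ2 U) (hQco12 : ∀ (x : MemberY θ.d₆ θ.ℓ₆ θ.hd' θ.hL' θ.b₀ θ.b₁ Mstar) (U : (bg9YR (Matrix (Fin N) (Fin N) ℂ) (specialUnitaryUnits (Fin N)) R₁ R₂ x).Cfg), (𝔬12 x).Q U = QcoKH x.toKIdx (trBasis N) (bg9YR (Matrix (Fin N) (Fin N) ℂ) (specialUnitaryUnits (Fin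 N)) R₁ R₂ x) (fun U => U) (parBY x.toKIdx) U) (hQsco12 : ∀ (x : MemberY θ.d₆ θ.ℓ₆ θ.hd' θ.hL' θ.b₀ θ.b₁ Mstar) (U : (bg9YR (Matrix (Fin N) (Fin N) ℂ) (specialUnitaryUnits (Fin N)) R₁ R₂ x).Cfg), (𝔬12 x).Qstar U = QscoKH x.toKIdx (trBasis N) (bg9YR (Matrix (Fin N) (Fin N) ℂ) (specialUnitaryUnits (Fin N)) R₁ R₂ x) (fun U => U) (parBY x.toKIdx) U) (hCco12 : ∀ (x : MemberY θ.d₆ θ.ℓ₆ θ.hd' θ.hL' θ.b₀ θ.b₁ Mstar) (U : (bg9YR (Matrix (Fin N) (Fin N) ℂ) (specialUnitaryUnits (Fin N)) R₁ R₂ x).Cfg), (𝔬12 x).C U = CcoK x.toKIdx (trBasis N) (bg9YR (Matrix (Fin N) (Fin N) ℂ) (specialUnitaryUnits (Fin N)) R₁ R₂ x) (fun U => U) (parSymY x.toKIdx) (parBY x.toKIdx) (GpPhysY x.toKIdx (parSymY x.toKIdx)) U) (hC1co12 : ∀ (x : MemberY θ.d₆ θ.ℓ₆ θ.hd' θ.hL'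 θ.b₀ θ.b₁ Mstar) (U : (bg9YR (Matrix (Fin N) (Fin N) ℂ) (specialUnitaryUnits (Fin N)) R₁ R₂ x).Cfg), (𝔬12 x).C1 U = C1coK x.toKIdx (trBasis N) (bg9YR (Matrix (Fin N) (Fin N) ℂ) (specialUnitaryUnits (Fin N)) R₁ R₂ x) (fun U => U) (parSymY x.toKIdx) (parBY x.toKIdx) (GpPhysY x.toKIdx (parSymY x.toKIdx)) (𝔯 x).Δ2 U) (hDvco12 : ∀ (x : MemberY θ.d₆ θ.ℓ₆ θ.hd' θ.hL' θ.b₀ θ.b₁ Mstar) (U : (bg9YR (Matrix (Fin N) (Fin N) ℂ) (specialUnitaryUnits (Fin N)) R₁ R₂ x).Cfg), (𝔬12 x).Dv U = DvcoKH x.toKIdx (trBasis N) (bg9YR (Matrix (Fin N) (Fin N) ℂ) (specialUnitaryUnits (Fin N)) R₁ R₂ x) (fun U => U) U) (hDvsco12 : ∀ (x : MemberY θ.d₆ θ.ℓ₆ θ.hd' θ.hL' θ.b₀ θ.b₁ Mstar) (U : (bg9YR (Matrix (Fin N) (Fin N) ℂ) (specialUnitaryUnits (Fin N)) R₁ R₂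 x).Cfg), (𝔬12 x).Dvstar U = DvscoKH x.toKIdx (trBasis N) (bg9YR (Matrix (Fin N) (Fin N) ℂ) (specialUnitaryUnits (Fin N)) R₁ R₂ x) (fun U => U) U) (hRco12 : ∀ (x : MemberY θ.d₆ θ.ℓ₆ θ.hd' θ.hL' θ.b₀ θ.b₁ Mstar) (U : (bg9YR (Matrix (Fin N) (Fin N) ℂ) (specialUnitaryUnits (Fin N)) R₁ R₂ x).Cfg), (𝔬12 x).R U = RcoK x.toKIdx (trBasis N) (bg9YR (Matrix (Fin N) (Fin N) ℂ) (specialUnitaryUnits (Fin N)) R₁ R₂ x) (fun U => U) (parSymY x.toKIdx) (GpPhysY x.toKIdx (parSymY x.toKIdx)) U)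
    (hΔ2 : ∀ (x : MemberY θ.d₆ θ.ℓ₆ θ.hd' θ.hL' θ.b₀ θ.b₁ Mstar) (U : (bg9YR (Matrix (Fin N) (Fin N) ℂ) (specialUnitaryUnits (Fin N)) R₁ R₂ x).Cfg), (∀ μ z, U μ z ∈ specialUnitaryUnits (Fin N)) → IsSymmTr (fun _ => (1 : ℝ)) ((𝔯 x).Δ2 U)) (θ₂ δ₂ : ℝ) (hθ₂ : 0 ≤ θ₂) (hrT4 : rT ≤ δ46 θ.d₆ θ.ℓ₆ θ.hd' θ.hL' θ.b₀ θ.b₁ Mstar N c hc) (hrT2 : rT ≤ δ₂) (hδ₃T : δ12₃ ≤ (1 - 2 * q.αF) * rT - σS) (hD2sup : ∀ x : MemberY θ.d₆ θ.ℓ₆ θ.hd' θ.hL' θ.b₀ θ.b₁ Mstar, M12 ≤ (geo9Y x).M → ∀ α₀ : ℝ, 0 < α₀ → (geo9Y x).M * α₀ ≤ a12 → ∀ U : (bg9YR (Matrix (Fin N) (Fin N) ℂ) (specialUnitaryUnits (Fin N)) R₁ R₂ x).Cfg, (bg9YR (Matrix (Fin N) (Fin N) ℂ) (specialUnitaryUnits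 (Fin N)) R₁ R₂ x).Reg335 c α₀ U → (bg9YR (Matrix (Fin N) (Fin N) ℂ) (specialUnitaryUnits (Fin N)) R₁ R₂ x).Reg336 c α₀ U → B6RandomWalk.HasMajorant (g := toB6 (geo9Y x) 1 (H x)) (𝔬12 x).blk (D2coK x.toKIdx (trBasis N) (bg9YR (Matrix (Fin N) (Fin N) ℂ) (specialUnitaryUnits (Fin N)) R₁ R₂ x) (fun U => U) ((𝔯 x).Δ2) U) (fun (a b : (geo9Y x).Site) => θ₂ * ((geo9Y x).M * α₀) * ((geo9Y x).len a ^ 2)⁻¹ * Real.exp (-(δ₂ * (geo9Y x).dist a b))))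
    (hpXDv : ∀ x : MemberY θ.d₆ θ.ℓ₆ θ.hd' θ.hL' θ.b₀ θ.b₁ Mstar, M12 ≤ (geo9Y x).M → ∀ α₀ : ℝ, 0 < α₀ → (geo9Y x).M * α₀ ≤ a12 → ∀ U : (bg9YR (Matrix (Fin N) (Fin N) ℂ) (specialUnitaryUnits (Fin N)) R₁ R₂ x).Cfg, (bg9YR (Matrix (Fin N) (Fin N) ℂ) (specialUnitaryUnits (Fin N)) R₁ R₂ x).Reg335 c α₀ U → (bg9YR (Matrix (Fin N) (Fin N) ℂ) (specialUnitaryUnits (Fin N)) R₁ R₂ x).Reg336 c α₀ U → ∀ β : ℝ, 0 ≤ β → β < 1 → HasMaj (cNormR 1 (H x) (𝔬12 x).blkW (fun y => (geo9Y_len_pos x y).le) 0) (cNormR 1 (H x) (𝔭A x).blkPX (fun y => (geo9Y_len_pos x y).le) (β - 1)) (((𝔭A x).ΦX U β ∘ₗ (𝔬12 x).G0 U) ∘ₗ (𝔬12 x).Dv U) (fun a b => Bx13 β * Real.exp (-(δ12₃ * (geo9Y x).dist a b)))) (hpXQs : ∀ x : MemberY θ.d₆ θ.ℓ₆ θ.hd'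 θ.hL' θ.b₀ θ.b₁ Mstar, M12 ≤ (geo9Y x).M → ∀ α₀ : ℝ, 0 < α₀ → (geo9Y x).M * α₀ ≤ a12 → ∀ U : (bg9YR (Matrix (Fin N) (Fin N) ℂ) (specialUnitaryUnits (Fin N)) R₁ R₂ x).Cfg, (bg9YR (Matrix (Fin N) (Fin N) ℂ) (specialUnitaryUnits (Fin N)) R₁ R₂ x).Reg335 c α₀ U → (bg9YR (Matrix (Fin N) (Fin N) ℂ) (specialUnitaryUnits (Fin N)) R₁ R₂ x).Reg336 c α₀ U → ∀ β : ℝ, 0 ≤ β → β < 1 → HasMaj (weightNorm (BlockNorm.ofBlocks (toB6 (geo9Y x) 1 (H x)) (𝔬12 x).blkZ) (fun y => (geo9Y x).len y * (fun y => ((((θ.ℓ₆ + 1 : ℕ) : ℝ) ^ (θ.d₆ + 1)) ^ lvl x.hN x.D x.hk y)⁻¹) y) (fun y => (mul_pos (geo9Y_len_pos x y) (plateau_pos x.toKIdx y)).le)) (cNormR 1 (H x) (𝔭A x).blkPX (fun y => (geo9Y_len_pos x y).le) (β - 1)) (((𝔭A x).ΦX U β ∘ₗ (𝔬12 x).G0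 U) ∘ₗ (𝔬12 x).Qstar U) (fun a b => Bx13 β * Real.exp (-(δ12₃ * (geo9Y x).dist a b)))) (δ45Y : ℝ) (hδ45Y : δ12₃ < δ45Y) (BiY : ℝ → ℝ) (hBiY : ∀ β', 0 ≤ β' → β' < 1 → 0 ≤ BiY β')  (αW σW δFW : ℝ) (hαW0 : 0 < αW) (hαW1 : αW < 1) (hσW : 0 < σW) (hδFW : 0 < δFW) (hδFP : δFW ≤ min ((1 - 2 * p.α) * p.δ₀) δ39 / 8) (hbudW : 0 ≤ δFW - αW * δFW - 2 * σW) (hδ3W : δ12₃ ≤ δFW - αW * δFW - 2 * σW) (hwschX : ∀ β', 0 ≤ β' → β' < 1 → 0 < wX (sch β')) (δ45W : ℝ) (hδ45W : δFW - αW * δFW - 2 * σW ≤ δ45W) (B45W : ℝ → ℝ) (hB45W : ∀ β', 0 ≤ β' → β' < 1 → 0 ≤ B45W β') (δhW : ℝ) (hδhW : δFW - αW * δFW - σW ≤ δhW) (BhW : ℝ → ℝ) (hBhW : ∀ β', 0 ≤ β' → β' < 1 → 0 ≤ BhW β') (hp45W : ∀ x : MemberY θ.d₆ θ.ℓ₆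 θ.hd' θ.hL' θ.b₀ θ.b₁ Mstar, letI : Fintype (B9GeoNormsKLevelV1.geo9K x.toKIdx).Site := (inferInstance : Fintype (geo9Y x).Site); M12 ≤ (geo9Y x).M → ∀ α₀ : ℝ, 0 < α₀ → (geo9Y x).M * α₀ ≤ a12 → ∀ U : (bg9YR (Matrix (Fin N) (Fin N) ℂ) (specialUnitaryUnits (Fin N)) R₁ R₂ x).Cfg, (bg9YR (Matrix (Fin N) (Fin N) ℂ) (specialUnitaryUnits (Fin N)) R₁ R₂ x).Reg335 c α₀ U → (bg9YR (Matrix (Fin N) (Fin N) ℂ) (specialUnitaryUnits (Fin N)) R₁ R₂ x).Reg336 c α₀ U → ∀ (β' : ℝ) (h0 : 0 ≤ β') (h1 : β' < 1), HasMaj (bHZKP (κ := TrIdx N) x.toKIdx (trBasis N) (taxiB x.toKIdx (bg9YR (Matrix (Fin N) (Fin N) ℂ) (specialUnitaryUnits (Fin N)) R₁ R₂ x) (fun U => U) U) (R := (1 : ℝ)) (H := H x) (hsch0 β' h0 h1).le (hsch1 β' h0 h1).le) (cNormR 1 (H x) (𝔭A x).blkPX (fun y => (geo9Y_len_pos x y).le)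 (β' - 1)) ((𝔭A x).ΦX U β' ∘ₗ ((𝔬12 x).Dv U ∘ₗ GcoS x.toKIdx (trBasis N) (bg9YR (Matrix (Fin N) (Fin N) ℂ) (specialUnitaryUnits (Fin N)) R₁ R₂ x) (fun U => U) (GpY x.toKIdx (parSymY x.toKIdx)) U ∘ₗ (𝔬12 x).Dvstar U)) (fun a b => B45W β' * Real.exp (-(δ45W * (geo9Y x).dist a b))))
    (hpDGW : ∀ x : MemberY θ.d₆ θ.ℓ₆ θ.hd' θ.hL' θ.b₀ θ.b₁ Mstar, letI : Fintype (B9GeoNormsKLevelV1.geo9K x.toKIdx).Site := (inferInstance : Fintype (geo9Y x).Site); M12 ≤ (geo9Y x).M → ∀ α₀ : ℝ, 0 < α₀ → (geo9Y x).M * α₀ ≤ a12 → ∀ U : (bg9YR (Matrix (Fin N) (Fin N) ℂ) (specialUnitaryUnits (Fin N)) R₁ R₂ x).Cfg, (bg9YR (Matrix (Fin N) (Fin N) ℂ) (specialUnitaryUnits (Fin N)) R₁ R₂ x).Reg335 c α₀ U → (bg9YR (Matrix (Fin N) (Fin N) ℂ) (specialUnitaryUnits (Fin N)) R₁ R₂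 x).Reg336 c α₀ U → ∀ (β' : ℝ), 0 ≤ β' → β' < 1 → HasMaj (cNormR 1 (H x) (𝔬12 x).blkW (fun y => (geo9Y_len_pos x y).le) 0) (cNormR 1 (H x) (𝔭A x).blkPX (fun y => (geo9Y_len_pos x y).le) (β' - 1)) ((𝔭A x).ΦX U β' ∘ₗ (𝔬12 x).Dv U ∘ₗ GcoS x.toKIdx (trBasis N) (bg9YR (Matrix (Fin N) (Fin N) ℂ) (specialUnitaryUnits (Fin N)) R₁ R₂ x) (fun U => U) (GpY x.toKIdx (parSymY x.toKIdx)) U) (fun a b => BhW β' * Real.exp (-(δhW * (geo9Y x).dist a b)))) (CP : ℝ) (hCPge : ((θ.d₆ + 1 : ℕ) : ℝ) * (coordBound39 (trBasis N) * basisBound39 (trBasis N) * nearBlkCntY θ.d₆ θ.ℓ₆ θ.hd' θ.hL' θ.b₀ θ.b₁ Mstar * ((max 1 (N : ℝ) * ((nbrCountY θ.d₆ θ.ℓ₆ θ.hd' θ.hL' θ.b₀ θ.b₁ 2 : ℝ) * p.C (B9RWSums347DefiniteFaces.exp261 (@geo9Y θ.d₆ θ.ℓ₆ θ.hd' θ.hL'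 θ.b₀ θ.b₁ Mstar) p.δ₀ p.α) * Real.exp (2 * ((1 - 2 * p.α) * p.δ₀)))) * (cR39 (basis39 (Matrix (Fin N) (Fin N) ℂ)) * Fintype.card (κ39 (Matrix (Fin N) (Fin N) ℂ)) * B39 * Real.exp (2 * δ39)) * (max 1 (N : ℝ) * ((nbrCountY θ.d₆ θ.ℓ₆ θ.hd' θ.hL' θ.b₀ θ.b₁ 2 : ℝ) * p.C (B9RWSums347DefiniteFaces.exp261 (@geo9Y θ.d₆ θ.ℓ₆ θ.hd' θ.hL' θ.b₀ θ.b₁ Mstar) p.δ₀ p.α) * Real.exp (2 * ((1 - 2 * p.α) * p.δ₀)))) * cg349 θ.d₆ θ.ℓ₆ θ.hd' θ.hL' θ.b₀ θ.b₁ ((1 - 2 * p.α) * p.δ₀) δ39) * Real.exp (2 * (min ((1 - 2 * p.α) * p.δ₀) δ39 / 8))) ≤ CP) (hBxW : ∀ β', 0 ≤ β' → β' < 1 → (cR39 (trBasis N))⁻¹ * ((wX (sch β'))⁻¹ * B45W β' + BhW β' * (CP * (((θ.ℓ₆ + 1 : ℕ) : ℝ))) * ((wX (sch β'))⁻¹ *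 ((((θ.ℓ₆ + 1 : ℕ) : ℝ)) * Real.exp ((δFW - αW * δFW - σW) * (rNear θ.d₆ θ.ℓ₆ + 1)))) * rowConst261 (@geo9Y θ.d₆ θ.ℓ₆ θ.hd' θ.hL' θ.b₀ θ.b₁ Mstar) σW * rowConst261 (@geo9Y θ.d₆ θ.ℓ₆ θ.hd' θ.hL' θ.b₀ θ.b₁ Mstar) σW) ≤ Bx13 β') (h45Y : ∀ x : MemberY θ.d₆ θ.ℓ₆ θ.hd' θ.hL' θ.b₀ θ.b₁ Mstar, letI : Fintype (B9GeoNormsKLevelV1.geo9K x.toKIdx).Site := (inferInstance : Fintype (geo9Y x).Site); M12 ≤ (geo9Y x).M → ∀ α₀ : ℝ, 0 < α₀ → (geo9Y x).M * α₀ ≤ a12 → ∀ U : (bg9YR (Matrix (Fin N) (Fin N) ℂ) (specialUnitaryUnits (Fin N)) R₁ R₂ x).Cfg, (bg9YR (Matrix (Fin N) (Fin N) ℂ) (specialUnitaryUnits (Fin N)) R₁ R₂ x).Reg335 c α₀ U → (bg9YR (Matrix (Fin N) (Fin N) ℂ) (specialUnitaryUnits (Fin N)) R₁ R₂ x).Reg336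 c α₀ U → ∀ (β' : ℝ) (h0 : 0 ≤ β') (h1 : β' < 1) (μ : Fin (θ.d₆ + 1)), HasMaj (bHZKP (κ := TrIdx N) x.toKIdx (trBasis N) (taxiB x.toKIdx (bg9YR (Matrix (Fin N) (Fin N) ℂ) (specialUnitaryUnits (Fin N)) R₁ R₂ x) (fun U => U) U) (R := (1 : ℝ)) (H := H x) (hsch0 β' h0 h1).le (hsch1 β' h0 h1).le) (cNormR 1 (H x) (𝔭A x).blkPY (fun y => (geo9Y_len_pos x y).le) (β' - 1)) ((𝔭A x).ΦY U β' ∘ₗ ((𝔬12 x).D U ∘ₗ ((𝔬12 x).G0 U ∘ₗ (𝔡A x).Dsd U μ))) (fun a a' => BiY β' * Real.exp (-(δ45Y * (geo9Y x).dist a a')))) (hLL2 : ∀ x : MemberY θ.d₆ θ.ℓ₆ θ.hd' θ.hL' θ.b₀ θ.b₁ Mstar, M12 ≤ (geo9Y x).M → ∀ α₀ : ℝ, 0 < α₀ → (geo9Y x).M * α₀ ≤ a12 → ∀ U : (bg9YR (Matrix (Fin N) (Fin N) ℂ) (specialUnitaryUnits (Fin N)) R₁ R₂ x).Cfg, (bg9YR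 (Matrix (Fin N) (Fin N) ℂ) (specialUnitaryUnits (Fin N)) R₁ R₂ x).Reg335 c α₀ U →
      (bg9YR (Matrix (Fin N) (Fin N) ℂ) (specialUnitaryUnits (Fin N)) R₁ R₂ x).Reg336 c α₀ U → Letters313L2Pk (𝔬12 x) (𝔡A x).Dd (𝔡A x).Dsd 1 (H x) B13₄ δ12₃ (fun y => Real.sqrt ((((θ.ℓ₆ + 1 : ℕ) : ℝ) ^ (θ.d₆ + 1)) ^ lvl x.hN x.D x.hk y)⁻¹) (fun y => Real.sqrt_pos.2 (plateau_pos x.toKIdx y)) U ∧ Letters313L2MZ (𝔬12 x) (𝔡A x).Dd (𝔡A x).Dsd 1 (H x) B13₄ δ12₃ (fun y => Real.sqrt ((((θ.ℓ₆ + 1 : ℕ) : ℝ) ^ (θ.d₆ + 1)) ^ lvl x.hN x.D x.hk y)⁻¹) (fun y => Real.sqrt_pos.2 (plateau_pos x.toKIdx y)) U)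
    -- (K2) dag-n06-l P-U8S″: the (3.152)–(3.153) input letters FIELD-WISE — no `Letters313IML` record, hence no right form `tDv` and no θ_V letter
    (hrgdd13 : ∀ x : MemberY θ.d₆ θ.ℓ₆ θ.hd' θ.hL' θ.b₀ θ.b₁ Mstar, M12 ≤ (geo9Y x).M → ∀ α₀ : ℝ, 0 < α₀ → (geo9Y x).M * α₀ ≤ a12 → ∀ U : (bg9YR (Matrix (Fin N) (Fin N) ℂ) (specialUnitaryUnits (Fin N)) R₁ R₂ x).Cfg, (bg9YR (Matrix (Fin N) (Fin N) ℂ) (specialUnitaryUnits (Fin N)) R₁ R₂ x).Reg335 c α₀ U → (bg9YR (Matrix (Fin N) (Fin N) ℂ) (specialUnitaryUnits (Fin N)) R₁ R₂ x).Reg336 c α₀ U → ∀ (μ : Fin (θ.d₆ + 1)) (ε : ℝ), 0 < ε → HasMaj (bHXA x ε) (bHX x ε) ((𝔬12 x).R U ∘ₗ (𝔬12 x).Dvstar U ∘ₗ (𝔬12 x).G1 U ∘ₗ (𝔡A x).Dsd U μ) (fun a b => Br13 ε * Real.exp (-(δ12₃ * (geo9Y x).dist a b)))) (hdgDvd13 :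 ∀ x : MemberY θ.d₆ θ.ℓ₆ θ.hd' θ.hL' θ.b₀ θ.b₁ Mstar, M12 ≤ (geo9Y x).M → ∀ α₀ : ℝ, 0 < α₀ → (geo9Y x).M * α₀ ≤ a12 → ∀ U : (bg9YR (Matrix (Fin N) (Fin N) ℂ) (specialUnitaryUnits (Fin N)) R₁ R₂ x).Cfg, (bg9YR (Matrix (Fin N) (Fin N) ℂ) (specialUnitaryUnits (Fin N)) R₁ R₂ x).Reg335 c α₀ U → (bg9YR (Matrix (Fin N) (Fin N) ℂ) (specialUnitaryUnits (Fin N)) R₁ R₂ x).Reg336 c α₀ U → ∀ (ν : Fin (θ.d₆ + 1)) (ε : ℝ), 0 < ε → ε ≤ 1 → HasMaj (bHX x ε) (BlockNorm.ofBlocks (toB6 (geo9Y x) 1 (H x)) (𝔬12 x).blk) ((𝔡A x).Dd U ν ∘ₗ ((𝔬12 x).G0 U ∘ₗ (𝔬12 x).Dv U)) (fun (a b : (geo9Y x).Site) => Bd13 ε * Real.exp (-(δ12₃ * (geo9Y x).dist a b)))) (hpdgDvd13 : ∀ x : MemberY θ.d₆ θ.ℓ₆ θ.hd' θ.hL' θ.b₀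 θ.b₁ Mstar, M12 ≤ (geo9Y x).M → ∀ α₀ : ℝ, 0 < α₀ → (geo9Y x).M * α₀ ≤ a12 → ∀ U : (bg9YR (Matrix (Fin N) (Fin N) ℂ) (specialUnitaryUnits (Fin N)) R₁ R₂ x).Cfg, (bg9YR (Matrix (Fin N) (Fin N) ℂ) (specialUnitaryUnits (Fin N)) R₁ R₂ x).Reg335 c α₀ U → (bg9YR (Matrix (Fin N) (Fin N) ℂ) (specialUnitaryUnits (Fin N)) R₁ R₂ x).Reg336 c α₀ U → ∀ (ν : Fin (θ.d₆ + 1)) (ε β : ℝ), 0 < ε → ε ≤ 1 → 0 ≤ β → β < 1 → HasMaj (bHX x (β + ε)) (BlockNorm.ofBlocks (toB6 (geo9Y x) 1 (H x)) (𝔭A x).blkPX) (((𝔭A x).ΦX U β ∘ₗ (𝔡A x).Dd U ν) ∘ₗ ((𝔬12 x).G0 U ∘ₗ (𝔬12 x).Dv U)) (fun (a b : (geo9Y x).Site) => Bd2₁₃ ε β * (geo9Y x).len a ^ (-β) * Real.exp (-(δ12₃ * (geo9Y x).dist a b)))) (hZ : ∀ x : MemberY θ.d₆ θ.ℓ₆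 θ.hd' θ.hL' θ.b₀ θ.b₁ Mstar, M12 ≤ (geo9Y x).M → ∀ α₀ : ℝ, 0 < α₀ → (geo9Y x).M * α₀ ≤ a12 → ∀ U : (bg9YR (Matrix (Fin N) (Fin N) ℂ) (specialUnitaryUnits (Fin N)) R₁ R₂ x).Cfg, (bg9YR (Matrix (Fin N) (Fin N) ℂ) (specialUnitaryUnits (Fin N)) R₁ R₂ x).Reg335 c α₀ U → (bg9YR (Matrix (Fin N) (Fin N) ℂ) (specialUnitaryUnits (Fin N)) R₁ R₂ x).Reg336 c α₀ U → QY x.toKIdx (parBY x.toKIdx) U ∘ₗ gradY x.toKIdx U ∘ₗ GpPhysY x.toKIdx (parSymY x.toKIdx) U ∘ₗ RY x.toKIdx (parSymY x.toKIdx) (GpPhysY x.toKIdx (parSymY x.toKIdx)) U = 0)  -- rows 20–21's `Letters313DZ ∕ DMZ` records SPLIT (edition 53): the four non-Hölder fields displayed, the Hölder entries `dgDH ∕ dgDHd` DERIVED (`N06DgLegAtPinsPhysPU`, ed. 61) from the (3.44) members `h44m` below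
    (hdgQsd : ∀ x : MemberY θ.d₆ θ.ℓ₆ θ.hd' θ.hL' θ.b₀ θ.b₁ Mstar, M12 ≤ (geo9Y x).M → ∀ α₀ : ℝ, 0 < α₀ → (geo9Y x).M * α₀ ≤ a12 → ∀ U : (bg9YR (Matrix (Fin N) (Fin N) ℂ) (specialUnitaryUnits (Fin N)) R₁ R₂ x).Cfg, (bg9YR (Matrix (Fin N) (Fin N) ℂ) (specialUnitaryUnits (Fin N)) R₁ R₂ x).Reg335 c α₀ U → (bg9YR (Matrix (Fin N) (Fin N) ℂ) (specialUnitaryUnits (Fin N)) R₁ R₂ x).Reg336 c α₀ U → ∀ ν : Fin (θ.d₆ + 1), HasMaj (weightNorm (BlockNorm.ofBlocks (toB6 (geo9Y x) 1 (H x)) (𝔬12 x).blkZ) (fun y => ((((θ.ℓ₆ + 1 : ℕ) : ℝ) ^ (θ.d₆ + 1)) ^ lvl x.hN x.D x.hk y)⁻¹) (fun y => (plateau_pos x.toKIdx y).le)) (cNorm 1 (H x) (𝔬12 x).blk (fun y => (geo9Y_len_pos x y).le) 1) ((𝔡A x).Dd U ν ∘ₗ (𝔬12 x).G0 U ∘ₗ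 (𝔬12 x).Qstar U) (fun a b => B12₃ * Real.exp (-(δ12₃ * (geo9Y x).dist a b)))) (hpQd : ∀ x : MemberY θ.d₆ θ.ℓ₆ θ.hd' θ.hL' θ.b₀ θ.b₁ Mstar, M12 ≤ (geo9Y x).M → ∀ α₀ : ℝ, 0 < α₀ → (geo9Y x).M * α₀ ≤ a12 → ∀ U : (bg9YR (Matrix (Fin N) (Fin N) ℂ) (specialUnitaryUnits (Fin N)) R₁ R₂ x).Cfg, (bg9YR (Matrix (Fin N) (Fin N) ℂ) (specialUnitaryUnits (Fin N)) R₁ R₂ x).Reg335 c α₀ U → (bg9YR (Matrix (Fin N) (Fin N) ℂ) (specialUnitaryUnits (Fin N)) R₁ R₂ x).Reg336 c α₀ U → ∀ (ν : Fin (θ.d₆ + 1)) (β : ℝ), 0 ≤ β → β < 1 → HasMaj (weightNorm (BlockNorm.ofBlocks (toB6 (geo9Y x) 1 (H x)) (𝔬12 x).blkZ) (fun y => ((((θ.ℓ₆ + 1 : ℕ) : ℝ) ^ (θ.d₆ + 1)) ^ lvl x.hN x.D x.hk y)⁻¹) (fun y => (plateau_pos x.toKIdx y).le)) (cNormR 1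 (H x) (𝔭A x).blkPX (fun y => (geo9Y_len_pos x y).le) (β - 1)) (((𝔭A x).ΦX U β ∘ₗ (𝔡A x).Dd U ν ∘ₗ (𝔬12 x).G0 U) ∘ₗ (𝔬12 x).Qstar U) (fun a b => Bq12 β * Real.exp (-(δ12₃ * (geo9Y x).dist a b)))) (s44 : ℝ) (hs440 : 0 < s44) (hs441 : s44 < 1) (hws44 : 0 < w13 s44) (δ44 : ℝ) (hδ44 : δ12₃ < δ44) (Bi44 : ℝ) (hBi44 : 0 ≤ Bi44) (hB12₃d : ((θ.d₆ : ℝ) + 1) * ((1 + CLip θ.d₆ θ.ℓ₆) * Bi44 * (CJG θ.d₆ θ.ℓ₆ (trBasis N) s44 (thetaL θ.d₆ θ.ℓ₆ ϑF) (w13 s44) (δ12₃ + 1 + 1 / 2 * (δ44 - δ12₃)) * (((θ.ℓ₆ + 1 : ℕ) : ℝ))) * rowConst261 (@geo9Y θ.d₆ θ.ℓ₆ θ.hd' θ.hL' θ.b₀ θ.b₁ Mstar) 1) ≤ B12₃) (hB12₃p : ((θ.d₆ : ℝ) + 1) * (1 * (((θ.d₆ : ℝ) + 1) * ((1 + CLip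 θ.d₆ θ.ℓ₆) * Bi44 * (CJG θ.d₆ θ.ℓ₆ (trBasis N) s44 (thetaL θ.d₆ θ.ℓ₆ ϑF) (w13 s44) (δ12₃ + 1 + 1 / 2 * (δ44 - δ12₃)) * (((θ.ℓ₆ + 1 : ℕ) : ℝ))) * rowConst261 (@geo9Y θ.d₆ θ.ℓ₆ θ.hd' θ.hL' θ.b₀ θ.b₁ Mstar) 1)) * rowConst261 (@geo9Y θ.d₆ θ.ℓ₆ θ.hd' θ.hL' θ.b₀ θ.b₁ Mstar) 1) ≤ B12₃) (h44m : ∀ x : MemberY θ.d₆ θ.ℓ₆ θ.hd' θ.hL' θ.b₀ θ.b₁ Mstar, letI : Fintype (B9GeoNormsKLevelV1.geo9K x.toKIdx).Site := (inferInstance : Fintype (geo9Y x).Site); M12 ≤ (geo9Y x).M → ∀ α₀ : ℝ, 0 < α₀ → (geo9Y x).M * α₀ ≤ a12 → ∀ U : (bg9YR (Matrix (Fin N) (Fin N) ℂ) (specialUnitaryUnits (Fin N)) R₁ R₂ x).Cfg, (bg9YR (Matrix (Fin N) (Fin N) ℂ) (specialUnitaryUnits (Fin N)) R₁ R₂ x).Reg335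 c α₀ U → (bg9YR (Matrix (Fin N) (Fin N) ℂ) (specialUnitaryUnits (Fin N)) R₁ R₂ x).Reg336 c α₀ U → ∀ ν μ : Fin (θ.d₆ + 1), HasMaj (bHZKP (κ := TrIdx N) x.toKIdx (trBasis N) (taxiB x.toKIdx (bg9YR (Matrix (Fin N) (Fin N) ℂ) (specialUnitaryUnits (Fin N)) R₁ R₂ x) (fun U => U) U) (R := (1 : ℝ)) (H := H x) hs440.le hs441.le) (cNorm 1 (H x) (𝔬12 x).blk (fun y => (geo9Y_len_pos x y).le) 1) ((𝔡A x).Dd U ν ∘ₗ ((𝔬12 x).G0 U ∘ₗ (𝔡A x).Dsd U μ)) (fun a a' => Bi44 * Real.exp (-(δ44 * (geo9Y x).dist a a')))) (hZ4 : ∀ x : MemberY θ.d₆ θ.ℓ₆ θ.hd' θ.hL' θ.b₀ θ.b₁ Mstar, letI : Fintype (B9GeoNormsKLevelV1.geo9K x.toKIdx).Site := (inferInstance : Fintype (geo9Y x).Site); M12 ≤ (geo9Y x).M → ∀ α₀ : ℝ, 0 < α₀ → (geo9Y x).M * α₀ ≤ a12 → ∀ U : (bg9YR (Matrix (Fin N)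 (Fin N) ℂ) (specialUnitaryUnits (Fin N)) R₁ R₂ x).Cfg, (bg9YR (Matrix (Fin N) (Fin N) ℂ) (specialUnitaryUnits (Fin N)) R₁ R₂ x).Reg335 c α₀ U → (bg9YR (Matrix (Fin N) (Fin N) ℂ) (specialUnitaryUnits (Fin N)) R₁ R₂ x).Reg336 c α₀ U →
        HasMaj (cNorm 1 (H x) (𝔬12 x).blkW (fun y => (geo9Y_len_pos x y).le) 1) (cNorm 1 (H x) (𝔬12 x).blk (fun y => (geo9Y_len_pos x y).le) 2) ((𝔬12 x).G0 U ∘ₗ (𝔬12 x).Dv U) (fun a b => B12₃ * Real.exp (-(δ12₃ * (geo9Y x).dist a b))) ∧ HasMaj (weightNorm (BlockNorm.ofBlocks (toB6 (geo9Y x) 1 (H x)) (𝔬12 x).blkZ) (fun y => (geo9Y x).len y * (fun y => ((((θ.ℓ₆ + 1 : ℕ) : ℝ) ^ (θ.d₆ + 1)) ^ lvl x.hN x.D x.hk y)⁻¹) y) (fun y => (mul_pos (geo9Y_len_pos x y) (plateau_pos x.toKIdx y)).le)) (cNorm 1 (H x) (𝔬12 x).blk (fun y => (geo9Y_len_pos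 x y).le) 1) ((𝔬12 x).G0 U ∘ₗ (𝔬12 x).Qstar U) (fun a b => B12₃ * Real.exp (-(δ12₃ * (geo9Y x).dist a b))) ∧ HasMaj (cNorm 1 (H x) (𝔬12 x).blkZ (fun y => (geo9Y_len_pos x y).le) 2) (weightNorm (BlockNorm.ofBlocks (toB6 (geo9Y x) 1 (H x)) (𝔬12 x).blkZ) (fun y => ((((θ.ℓ₆ + 1 : ℕ) : ℝ) ^ (θ.d₆ + 1)) ^ lvl x.hN x.D x.hk y)⁻¹) (fun y => (plateau_pos x.toKIdx y).le)) ((𝔬12 x).C1 U) (fun a b => B12₃ * Real.exp (-(δ12₃ * (geo9Y x).dist a b))) ∧ HasMaj (cNorm 1 (H x) (𝔬12 x).blkZ (fun y => (geo9Y_len_pos x y).le) 1) (weightNorm (BlockNorm.ofBlocks (toB6 (geo9Y x) 1 (H x)) (𝔬12 x).blkZ) (fun y => (geo9Y x).len y * (fun y => ((((θ.ℓ₆ + 1 : ℕ) : ℝ) ^ (θ.d₆ + 1)) ^ lvl x.hN x.D x.hk y)⁻¹) y) (fun y => (mul_pos (geo9Y_len_pos x y) (plateau_pos x.toKIdx y)).le))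 ((𝔬12 x).C1 U) (fun a b => B12₃ * Real.exp (-(δ12₃ * (geo9Y x).dist a b)))) (hwX44 : 0 < wX s44) (B44G δ44G : ℝ) (hB44G : 0 ≤ B44G) (hδ44G : δFW - αW * δFW - 2 * σW ≤ δ44G) (h44G : ∀ x : MemberY θ.d₆ θ.ℓ₆ θ.hd' θ.hL' θ.b₀ θ.b₁ Mstar, letI : Fintype (B9GeoNormsKLevelV1.geo9K x.toKIdx).Site := (inferInstance : Fintype (geo9Y x).Site); M12 ≤ (geo9Y x).M → ∀ α₀ : ℝ, 0 < α₀ → (geo9Y x).M * α₀ ≤ a12 → ∀ U : (bg9YR (Matrix (Fin N) (Fin N) ℂ) (specialUnitaryUnits (Fin N)) R₁ R₂ x).Cfg, (bg9YR (Matrix (Fin N) (Fin N) ℂ) (specialUnitaryUnits (Fin N)) R₁ R₂ x).Reg335 c α₀ U → (bg9YR (Matrix (Fin N) (Fin N) ℂ) (specialUnitaryUnits (Fin N)) R₁ R₂ x).Reg336 c α₀ U → HasMaj (bHZKP (κ := TrIdx N) x.toKIdx (trBasis N) (taxiB x.toKIdx (bg9YR (Matrix (Fin N) (Fin N) ℂ)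 (specialUnitaryUnits (Fin N)) R₁ R₂ x) (fun U => U) U) (R := (1 : ℝ)) (H := H x) hs440.le hs441.le) (cNorm 1 (H x) (𝔬12 x).blk (fun y => (geo9Y_len_pos x y).le) 1) ((𝔬12 x).Dv U ∘ₗ GcoS x.toKIdx (trBasis N) (bg9YR (Matrix (Fin N) (Fin N) ℂ) (specialUnitaryUnits (Fin N)) R₁ R₂ x) (fun U => U) (GpY x.toKIdx (parSymY x.toKIdx)) U ∘ₗ (𝔬12 x).Dvstar U) (fun a b => B44G * Real.exp (-(δ44G * (geo9Y x).dist a b)))) (hB₃wG : (cR39 (trBasis N))⁻¹ * ((wX s44)⁻¹ * B44G + (((θ.d₆ + 1 : ℕ) : ℝ) * p.C (B9RWSums347DefiniteFaces.exp261 (@geo9Y θ.d₆ θ.ℓ₆ θ.hd' θ.hL' θ.b₀ θ.b₁ Mstar) p.δ₀ p.α)) * (CP * (((θ.ℓ₆ + 1 : ℕ) : ℝ))) * ((wX s44)⁻¹ * ((((θ.ℓ₆ + 1 : ℕ) : ℝ)) * Real.exp ((δFW - αW * δFW - σW) * (rNear θ.d₆ θ.ℓ₆ + 1)))) * rowConst261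 (@geo9Y θ.d₆ θ.ℓ₆ θ.hd' θ.hL' θ.b₀ θ.b₁ Mstar) σW * rowConst261 (@geo9Y θ.d₆ θ.ℓ₆ θ.hd' θ.hL' θ.b₀ θ.b₁ Mstar) σW) ≤ B12₃) (θK B₀G δ₀G BHG : ℝ) (BhG θHG : ℝ → ℝ) (hθHG : ∀ s, 0 < s → s < 1 → 0 ≤ θHG s) (hB₀G : 0 ≤ B₀G) (hBhG : ∀ s, 0 < s → s < 1 → 0 ≤ BhG s) (hBHG : 0 ≤ BHG) (hqG : θK * rowConst261 (@geo9Y θ.d₆ θ.ℓ₆ θ.hd' θ.hL' θ.b₀ θ.b₁ Mstar) σW < 1) (hwBG : ∀ s, 0 < s → s < 1 → wX s * (BhG s + θHG s * (B₀G * (1 - θK * rowConst261 (@geo9Y θ.d₆ θ.ℓ₆ θ.hd' θ.hL' θ.b₀ θ.b₁ Mstar) σW)⁻¹) * rowConst261 (@geo9Y θ.d₆ θ.ℓ₆ θ.hd' θ.hL' θ.b₀ θ.b₁ Mstar) σW) ≤ BHG)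
    (hG0P : ∀ x : MemberY θ.d₆ θ.ℓ₆ θ.hd' θ.hL' θ.b₀ θ.b₁ Mstar, letI : Fintype (B9GeoNormsKLevelV1.geo9K x.toKIdx).Site := (inferInstance : Fintype (geo9Y x).Site); M12 ≤ (geo9Y x).M → ∀ α₀ : ℝ, 0 < α₀ → (geo9Y x).M * α₀ ≤ a12 → ∀ U : (bg9YR (Matrix (Fin N) (Fin N) ℂ) (specialUnitaryUnits (Fin N)) R₁ R₂ x).Cfg, (bg9YR (Matrix (Fin N) (Fin N) ℂ) (specialUnitaryUnits (Fin N)) R₁ R₂ x).Reg335 c α₀ U → (bg9YR (Matrix (Fin N) (Fin N) ℂ) (specialUnitaryUnits (Fin N)) R₁ R₂ x).Reg336 c α₀ U → HasMajorantHom (g := toB6 (geo9Y x) 1 (H x)) (𝔬12 x).blkY (𝔬12 x).blk ((𝔬12 x).G0 U ∘ₗ (𝔬12 x).Dstar U) (fun a b => B₀G * (geo9Y x).len a * Real.exp (-(δ₀G * (geo9Y x).dist a b))) ∧ (∀ s' : ℝ, 0 < s' → s' < 1 → HasMajorantHom (g := toB6 (geo9Y x) 1 (H x)) (𝔬12 x).blkY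 (𝔭A x).blkPX ((𝔭A x).ΦX U s' ∘ₗ ((𝔬12 x).G0 U ∘ₗ (𝔬12 x).Dstar U)) (fun (a b : (geo9Y x).Site) => BhG s' * (geo9Y x).len a ^ (1 - s') * Real.exp (-(δ₀G * (geo9Y x).dist a b))))) (B43 δ43 : ℝ) (hB43 : 0 ≤ B43) (h43Gp : ∀ x : MemberY θ.d₆ θ.ℓ₆ θ.hd' θ.hL' θ.b₀ θ.b₁ Mstar, letI : Fintype (B9GeoNormsKLevelV1.geo9K x.toKIdx).Site := (inferInstance : Fintype (geo9Y x).Site); M12 ≤ (geo9Y x).M → ∀ α₀ : ℝ, 0 < α₀ → (geo9Y x).M * α₀ ≤ a12 → ∀ U : (bg9YR (Matrix (Fin N) (Fin N) ℂ) (specialUnitaryUnits (Fin N)) R₁ R₂ x).Cfg, (bg9YR (Matrix (Fin N) (Fin N) ℂ) (specialUnitaryUnits (Fin N)) R₁ R₂ x).Reg335 c α₀ U → (bg9YR (Matrix (Fin N) (Fin N) ℂ) (specialUnitaryUnits (Fin N)) R₁ R₂ x).Reg336 c α₀ U → HasMaj (cNorm 1 (H x) (𝔬12 x).blk (fun y =>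 (geo9Y_len_pos x y).le) 0) (bH13 x U) (GcoS x.toKIdx (trBasis N) (bg9YR (Matrix (Fin N) (Fin N) ℂ) (specialUnitaryUnits (Fin N)) R₁ R₂ x) (fun U => U) (GpY x.toKIdx (parSymY x.toKIdx)) U ∘ₗ DvscoKH x.toKIdx (trBasis N) (bg9YR (Matrix (Fin N) (Fin N) ℂ) (specialUnitaryUnits (Fin N)) R₁ R₂ x) (fun U => U) U) (fun a b => B43 * Real.exp (-(δ43 * (geo9Y x).dist a b)))) (ρrg : ℝ) (hρrg0 : 0 ≤ ρrg) (hbudrg : ρrg + σW + αW * δFW ≤ δFW) (hbud43 : ρrg + σW ≤ δ43) (hδ₃rg : δ12₃ ≤ ρrg)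
    (hB₃rg : B43 * (cR39 (trBasis N))⁻¹ * rowConst261 (@geo9Y θ.d₆ θ.ℓ₆ θ.hd' θ.hL' θ.b₀ θ.b₁ Mstar) σW + CTel θ.d₆ θ.ℓ₆ (trBasis N) ρrg (CP * (((θ.ℓ₆ + 1 : ℕ) : ℝ)) * ((((θ.d₆ + 1 : ℕ) : ℝ) * p.C (B9RWSums347DefiniteFaces.exp261 (@geo9Y θ.d₆ θ.ℓ₆ θ.hd' θ.hL' θ.b₀ θ.b₁ Mstar) p.δ₀ p.α)) * (cR39 (trBasis N))⁻¹ * rowConst261 (@geo9Y θ.d₆ θ.ℓ₆ θ.hd' θ.hL' θ.b₀ θ.b₁ Mstar) σW) * rowConst261 (@geo9Y θ.d₆ θ.ℓ₆ θ.hd' θ.hL' θ.b₀ θ.b₁ Mstar) σW) (CP * (((θ.ℓ₆ + 1 : ℕ) : ℝ)) * ((((θ.d₆ + 1 : ℕ) : ℝ) * p.C (B9RWSums347DefiniteFaces.exp261 (@geo9Y θ.d₆ θ.ℓ₆ θ.hd' θ.hL' θ.b₀ θ.b₁ Mstar) p.δ₀ p.α)) * (cR39 (trBasis N))⁻¹ *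 rowConst261 (@geo9Y θ.d₆ θ.ℓ₆ θ.hd' θ.hL' θ.b₀ θ.b₁ Mstar) σW) * rowConst261 (@geo9Y θ.d₆ θ.ℓ₆ θ.hd' θ.hL' θ.b₀ θ.b₁ Mstar) σW) ≤ B12₃) {E14₁ E14₂ : ∀ x : MemberY θ.d₆ θ.ℓ₆ θ.hd' θ.hL' θ.b₀ θ.b₁ Mstar, B9.RWExpansion (geo9Y x) (bg9YR (Matrix (Fin N) (Fin N) ℂ) (specialUnitaryUnits (Fin N)) R₁ R₂ x)} (T14₁ : ∀ x : MemberY θ.d₆ θ.ℓ₆ θ.hd' θ.hL' θ.b₀ θ.b₁ Mstar, (E14₁ x).Walk → BondOpY (Matrix (Fin N) (Fin N) ℂ) x.toKIdx) (T14₂ : ∀ x : MemberY θ.d₆ θ.ℓ₆ θ.hd' θ.hL' θ.b₀ θ.b₁ Mstar, (E14₂ x).Walk → BondOpY (Matrix (Fin N) (Fin N) ℂ) x.toKIdx) (X14₁ : ∀ x : MemberY θ.d₆ θ.ℓ₆ θ.hd' θ.hL' θ.b₀ θ.b₁ Mstar, (E14₁ x).Walk → ℕ → (geo9Y x).Site →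 Prop) (M14₁ : ∀ x : MemberY θ.d₆ θ.ℓ₆ θ.hd' θ.hL' θ.b₀ θ.b₁ Mstar, (E14₁ x).Walk → ℕ → Prop) (X14₂ : ∀ x : MemberY θ.d₆ θ.ℓ₆ θ.hd' θ.hL' θ.b₀ θ.b₁ Mstar, (E14₂ x).Walk → ℕ → (geo9Y x).Site → Prop) (M14₂ : ∀ x : MemberY θ.d₆ θ.ℓ₆ θ.hd' θ.hL' θ.b₀ θ.b₁ Mstar, (E14₂ x).Walk → ℕ → Prop) (diam14 : MemberY θ.d₆ θ.ℓ₆ θ.hd' θ.hL' θ.b₀ θ.b₁ Mstar → ℝ) (r14 : ℝ) (hr14 : ∀ x, diam14 x ≤ r14) (near14₁ : ∀ (x : MemberY θ.d₆ θ.ℓ₆ θ.hd' θ.hL' θ.b₀ θ.b₁ Mstar) ω m p, M14₁ x ω m → X14₁ x ω m p → ∃ q, q ∈ OmegaC x.D x.D' ∧ tdistK (ℓ := θ.ℓ₆) (Mh := x.Mh) (k := x.k) (P := x.P') (kLab x p) q ≤ diam14 x) (first14₁ : ∀ (x : MemberY θ.d₆ θ.ℓ₆ θ.hd' θ.hL'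 θ.b₀ θ.b₁ Mstar) ω y, (E14₁ x).first ω y → X14₁ x ω 0 y)
    (chain14₁ : ∀ (x : MemberY θ.d₆ θ.ℓ₆ θ.hd' θ.hL' θ.b₀ θ.b₁ Mstar) ω y y', (E14₁ x).first ω y → (E14₁ x).last ω y' → ∃ l : List (geo9Y x).Site, l.length = (E14₁ x).wlen ω ∧ (∀ (m : ℕ) (hm : m < l.length), X14₁ x ω (m + 1) (l[m])) ∧ B9Thm314.chainSum (geo9Y x).dist y l y' ≤ (E14₁ x).wdist ω y y') (near14₂ : ∀ (x : MemberY θ.d₆ θ.ℓ₆ θ.hd' θ.hL' θ.b₀ θ.b₁ Mstar) ω m p, M14₂ x ω m → X14₂ x ω m p → ∃ q, q ∈ OmegaC x.D x.D' ∧ tdistK (ℓ := θ.ℓ₆) (Mh := x.Mh) (k := x.k) (P := x.P') (kLab x p) q ≤ diam14 x) (first14₂ : ∀ (x : MemberY θ.d₆ θ.ℓ₆ θ.hd' θ.hL' θ.b₀ θ.b₁ Mstar) ω y, (E14₂ x).first ω y → X14₂ x ω 0 y) (chain14₂ : ∀ (x : MemberY θ.d₆ θ.ℓ₆ θ.hd'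 θ.hL' θ.b₀ θ.b₁ Mstar) ω y y', (E14₂ x).first ω y → (E14₂ x).last ω y' → ∃ l : List (geo9Y x).Site, l.length = (E14₂ x).wlen ω ∧ (∀ (m : ℕ) (hm : m < l.length), X14₂ x ω (m + 1) (l[m])) ∧ B9Thm314.chainSum (geo9Y x).dist y l y' ≤ (E14₂ x).wdist ω y y') (h14₁ : Thm310AllNormsPrinted c geo9Y (bg9YR (Matrix (Fin N) (Fin N) ℂ) (specialUnitaryUnits (Fin N)) R₁ R₂) E14₁ (fun x ω => kernelFamilyB x.toKIdx (bg9YR (Matrix (Fin N) (Fin N) ℂ) (specialUnitaryUnits (Fin N)) R₁ R₂ x) (fun U => U) (T14₁ x ω) (lettersYOfRecordV4P N θ.toStage3Params Mstar 𝔯 x).parB)) (h14₂ : Thm310AllNormsPrinted c geo9Y (bg9YR (Matrix (Fin N) (Fin N) ℂ) (specialUnitaryUnits (Fin N)) R₁ R₂) E14₂ (fun x ω => kernelFamilyB x.toKIdx (bg9YR (Matrix (Fin N) (Fin N) ℂ) (specialUnitaryUnits (Fin N)) R₁ R₂ x) (fun U => U) (T14₂ x ω) (lettersYOfRecordV4P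 N θ.toStage3Params Mstar 𝔯 x).parB)) (W14₁ : ∀ x : MemberY θ.d₆ θ.ℓ₆ θ.hd' θ.hL' θ.b₀ θ.b₁ Mstar, ℕ → (geo9Y x).Site → (geo9Y x).Site → Finset (E14₁ x).Walk) (W14₂ : ∀ x : MemberY θ.d₆ θ.ℓ₆ θ.hd' θ.hL' θ.b₀ θ.b₁ Mstar, ℕ → (geo9Y x).Site → (geo9Y x).Site → Finset (E14₂ x).Walk) (hW14₁ : ∀ x, WalkSetsSpec (E14₁ x) (W14₁ x)) (hW14₂ : ∀ x, WalkSetsSpec (E14₂ x) (W14₂ x)) (hcnt14₁ : WalkWeightsSummable geo9Y (bg9YR (Matrix (Fin N) (Fin N) ℂ) (specialUnitaryUnits (Fin N)) R₁ R₂) E14₁ W14₁) (hcnt14₂ : WalkWeightsSummable geo9Y (bg9YR (Matrix (Fin N) (Fin N) ℂ) (specialUnitaryUnits (Fin N)) R₁ R₂) E14₂ W14₂) (hexp14 : ∀ (x : MemberY θ.d₆ θ.ℓ₆ θ.hd' θ.hL' θ.b₀ θ.b₁ Mstar) (U : (bg9YR (Matrix (Fin N) (Fin N) ℂ) (specialUnitaryUnits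 (Fin N)) R₁ R₂ x).Cfg), (E14₁ x).Converges U ∧ (E14₂ x).Converges U → ExpansionReads x.toKIdx (B := bg9YR (Matrix (Fin N) (Fin N) ℂ) (specialUnitaryUnits (Fin N)) R₁ R₂ x) (fun U => U) (lettersYOfRecordV4P N θ.toStage3Params Mstar 𝔯 x).Kdiff (pairOp (locDataY x (E14₁ x) (X14₁ x) (M14₁ x) (diam14 x)).Touches (locData₂ (locDataY x (E14₁ x) (X14₁ x) (M14₁ x) (diam14 x)) (X14₂ x) (M14₂ x)).Touches (T14₁ x) (T14₂ x)) (pairWalkSets (W14₁ x) (W14₂ x) (locDataY x (E14₁ x) (X14₁ x) (M14₁ x) (diam14 x)).Touches (locData₂ (locDataY x (E14₁ x) (X14₁ x) (M14₁ x) (diam14 x)) (X14₂ x) (M14₂ x)).Touches) U) {a₀E δ₁E B₁E : ℝ} (ha₀E : 0 < a₀E) (hδ₁E : 0 < δ₁E) (hB₁E : 0 < B₁E) (hE : ∀ (x : MemberY θ.d₆ θ.ℓ₆ θ.hd' θ.hL' θ.b₀ θ.b₁ Mstar), (Mstar : ℝ) ≤ (geo9Y x).M → ∀ (α₀ : ℝ),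 0 < α₀ → (geo9Y x).M * α₀ ≤ a₀E → ∀ U : (bg9YR (Matrix (Fin N) (Fin N) ℂ) (specialUnitaryUnits (Fin N)) R₁ R₂ x).Cfg, (bg9YR (Matrix (Fin N) (Fin N) ℂ) (specialUnitaryUnits (Fin N)) R₁ R₂ x).Reg335 c α₀ U → (bg9YR (Matrix (Fin N) (Fin N) ℂ) (specialUnitaryUnits (Fin N)) R₁ R₂ x).Reg336 c α₀ U → givenBy3185stY x (lettersYOfRecordV4P N θ.toStage3Params Mstar 𝔯 x) (sectEStYOfRecordV7 N θ.toStage3Params Mstar 𝔢₀ x) U ∧ hasRWExpCY (𝔴 x) U δ₁E ∧ DecayMidOnStY x (lettersYOfRecordV4P N θ.toStage3Params Mstar 𝔯 x) (sectEStYOfRecordV7 N θ.toStage3Params Mstar 𝔢₀ x) B₁E U δ₁E)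
    -- U8 (№272 (5), №289): the state layer's weight loss τS, producer∕reading rate δP, the sup bound Bx13₀, the S-leaves' budget ρ12 + 2σ12 ≤ δP, and the U8 rate budget hU8a–l
    (τS δP Bx13₀ : ℝ) (hτS : 0 < τS) (hBx13₀ : 0 ≤ Bx13₀) (hwBx13 : ∀ s, 0 < s → s < 1 → wX s * Bx13 s ≤ Bx13₀) (hρP12 : ρ12 + 2 * σ12 ≤ δP) (hU8a : δK12 + 3 * σS + 4 * τS ≤ (1 - 2 * p.α) * p.δ₀) (hU8b : δK12 + 3 * σS + 4 * τS ≤ min ((1 - 2 * p.α) * p.δ₀) δ39 / 8) (hU8c : δK12 + 3 * σS + 4 * τS ≤ δ₂) (hU8d : δK12 + 3 * σS + 5 * τS ≤ δ44G) (hU8e : δK12 + 3 * σS + 4 * τS ≤ δB) (hU8f : δK12 + 2 * σS + τS ≤ δ43) (hU8g : δK12 + τS + σS ≤ δT12) (hU8h : δK12 + τS + σS ≤ δ12₃) (hU8i : δK12 + τS + σS ≤ δP) (hU8j : δP + 2 * τS ≤ δ12₀) (hU8k : δP + σS + 2 * τS ≤ δ12₃) (hU8l : δP + τS ≤ δ₀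G)
    -- (α3) SOCKET road (α) (director-ym №282 (B) ∕ №290 (1)(c)): the Sect.-B step is DERIVED over the coded carrier from dag-n06-c's CLOSED face
    -- `B9SectBStepUClosedSUOfSections.sectBStepU_C37GY_su_extraYPb_closed` (edition 79: its GUARDED Thm-3.11 input `hunitA` is dag-n06-j's THEOREM `hunitA_of_sections`, its basis∕neighbour bookkeeping is standard); displayed = the sub-family, the sections, the real basis
    {J : Type} (f : J → MemberY θ.d₆ θ.ℓ₆ θ.hd' θ.hL' θ.b₀ θ.b₁ Mstar) {ιR : Type} [Fintype ιR] [DecidableEq ιR] (bR : Module.Basis ιR ℝ (Matrix (Fin N) (Fin N) ℂ)) (ιB : ∀ j : J, BlkY (f j).toKIdx → IBondY (f j).toKIdx) (C38 : ∀ j : J, ℝ → CfgY (Matrix (Fin N) (Fin N) ℂ) (f j).toKIdx → AfldY (Matrix (Fin N) (Fin N) ℂ) (f j).toKIdx → Prop) (hι : ∀ (j : J) (s : BlkY (f j).toKIdx), β (f j).toKIdx.hN (f j).toKIdx.D (f j).toKIdx.hk (ιB j s) = s) [instNE : ∀ x : MemberY θ.d₆ θ.ℓ₆ θ.hd' θ.hL'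 θ.b₀ θ.b₁ Mstar, Nonempty (geo9Y x).Site]
    : B9LeafX (Y9OfRecordUPb N θ.toStage3Params Mstar (opsYNuStOfRecordV4PE N θ.toStage3Params Mstar 𝔯 (sectEStYOfRecordV7 N θ.toStage3Params Mstar 𝔢₀) 𝔴 𝔈) f bR ιB C38) := by
  let 𝔅 := fun (x : MemberY θ.d₆ θ.ℓ₆ θ.hd' θ.hL' θ.b₀ θ.b₁ Mstar) => bg9YR (Matrix (Fin N) (Fin N) ℂ) (specialUnitaryUnits (Fin N)) R₁ R₂ x; let rd : ∀ x : MemberY θ.d₆ θ.ℓ₆ θ.hd' θ.hL' θ.b₀ θ.b₁ Mstar, WalkReading (geo9Y x) (𝔅 x) (XSK (TrIdx N) x.toKIdx) ↥(cubes x.toKIdx.D.toDomains) := fun x => rdWalkY x (𝔅 x) (fun U => U) (parSymY x.toKIdx)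
  obtain ⟨hEK39, hPD, hE37, hE310, hpinE, hpinH, hpinK⟩ := OpsYExpsOfRecordV2.pins_of_eq (𝔢 := sectEStYOfRecordV7 N θ.toStage3Params Mstar 𝔢₀) (𝔴 := 𝔴) h𝔈
  let κ13 : ℝ := 1 + CLip θ.d₆ θ.ℓ₆
  have hκ13 : ∀ (x : MemberY θ.d₆ θ.ℓ₆ θ.hd' θ.hL' θ.b₀ θ.b₁ Mstar) (U : (𝔅 x).Cfg), (bH13 x U).κ ≤ κ13 := hκ13_of_pinsP H w13 hw13₀ hw13₁ bH13 hbH13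
  have hκX : ∀ (x : MemberY θ.d₆ θ.ℓ₆ θ.hd' θ.hL' θ.b₀ θ.b₁ Mstar) (U : (𝔅 x).Cfg), (bXH x U).κ ≤ κ13 := hκX_of_pinsP H wX hwX₀ hwX₁ bXH hbXH
  have hϑF₀ : 0 ≤ ϑF := budget_nonneg ha12.le hϑF
  have hF := plaqV_binder_of_regYR_budget_SU (N := N) hGR c hRP1 (M₀ := M12) (a₀ := a12) hϑF
  have hδ12₃0X : 0 ≤ δ12₃ := le_of_lt (lt_of_lt_of_le (add_pos hρ12 hσ12) hρ₃12)
  obtain ⟨MXd, BdX, hBdX, hXd⟩ := hXd_of_pinsP_geo9Y (N := N) H bI hβ1 hbI0 hGR c hϑF₀ hF w13 hw13₀ hw13₁ sch hsch0 hsch1 hwsch bH13 hbH13 𝔬A 𝔬12 hDvco12 𝔡A h𝔡As 𝔭A hδ12₃0X hδ45 hBZ h45X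
  obtain ⟨MDg, hDg⟩ := dgDH_dgDHd_of_pinsP_geo9Y (N := N) H bI hβ1 hbI0 hGR c hϑF₀ hF w13 hw13₀ hw13₁ hs440 hs441 hws44 bH13 hbH13 𝔬A 𝔬12 hDvco12 𝔡A h𝔡As h𝔡Ad hblk12 hblkY12 hDco12 hδ12₃0X hδ44 hBi44 hB12₃d hB12₃p h44m
  obtain ⟨MYd, BhD13, hBhD13, hYd⟩ := pYDH_of_pinsP_geo9Y (N := N) H bI hβ1 hbI0 hGR c hϑF₀ hF w13 hw13₀ hw13₁ sch hsch0 hsch1 hwsch bH13 hbH13 𝔬A 𝔬12 hDvco12 𝔡A h𝔡As 𝔭A hδ12₃0X hδ45Y hBiY h45Y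
  let 𝔬 : ∀ x : MemberY θ.d₆ θ.ℓ₆ θ.hd' θ.hL' θ.b₀ θ.b₁ Mstar, Ops (geo9Y x) (𝔅 x) (XSK (TrIdx N) x.toKIdx) (XSK (TrIdx N) x.toKIdx) ↥(cubes x.toKIdx.D.toDomains) := fun x => opsWalkY x (trBasis N) (𝔅 x) (fun U => U) (parSymY x.toKIdx) (bI x)
  let 𝔡 : ∀ x : MemberY θ.d₆ θ.ℓ₆ θ.hd' θ.hL' θ.b₀ θ.b₁ Mstar, DirOps37 (𝔬 x) (Fin (θ.d₆ + 1)) := fun x => dirOpsWalkY x (trBasis N) (𝔅 x) (fun U => U) (parSymY x.toKIdx) (bI x)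
  let 𝔩 : ∀ x : MemberY θ.d₆ θ.ℓ₆ θ.hd' θ.hL' θ.b₀ θ.b₁ Mstar, DirLetters37 (𝔬 x) (Fin (θ.d₆ + 1)) := fun x => dirLettersWalkY x (trBasis N) (𝔅 x) (fun U => U) (parSymY x.toKIdx) (bI x)
  let κ : MemberY θ.d₆ θ.ℓ₆ θ.hd' θ.hL' θ.b₀ θ.b₁ Mstar → Sizes := fun x => kappaWalkY x (trBasis N)
  have hblkS : ∀ x : MemberY θ.d₆ θ.ℓ₆ θ.hd' θ.hL' θ.b₀ θ.b₁ Mstar, (𝔬 x).blk = blkSK x.toKIdx (sIK x.toKIdx (bI x)) := fun _ => rfl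
  have hblkYS : ∀ x : MemberY θ.d₆ θ.ℓ₆ θ.hd' θ.hL' θ.b₀ θ.b₁ Mstar, (𝔬 x).blkY = blkSK x.toKIdx (sIK x.toKIdx (bI x)) := fun _ => rfl
  have hhS : ∀ (x : MemberY θ.d₆ θ.ℓ₆ θ.hd' θ.hL' θ.b₀ θ.b₁ Mstar) (c : ↥(cubes x.toKIdx.D.toDomains)), (𝔬 x).h c = hWalkY x c := fun _ _ => rfl
  have hGsqF : ∀ (x : MemberY θ.d₆ θ.ℓ₆ θ.hd' θ.hL' θ.b₀ θ.b₁ Mstar) (U : (𝔅 x).Cfg) (c : ↥(cubes x.toKIdx.D.toDomains)), (𝔬 x).Gsq U c = gsqcoS x (trBasis N) (𝔅 x) (fun U => U) (parSymY x.toKIdx) c U := fun _ _ _ => rfl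
  have hGpS : ∀ (x : MemberY θ.d₆ θ.ℓ₆ θ.hd' θ.hL' θ.b₀ θ.b₁ Mstar) U, (𝔬 x).Gp U = GcoS x.toKIdx (trBasis N) (𝔅 x) (fun U => U) (lettersYOfRecordV4P N θ.toStage3Params Mstar 𝔯 x).Gp U := fun _ _ => rfl
  have hDS : ∀ (x : MemberY θ.d₆ θ.ℓ₆ θ.hd' θ.hL' θ.b₀ θ.b₁ Mstar) U, (𝔬 x).D U = DcoS x.toKIdx (trBasis N) (𝔅 x) (fun U => U) U := fun _ _ => rfl
  have hDsS : ∀ (x : MemberY θ.d₆ θ.ℓ₆ θ.hd' θ.hL' θ.b₀ θ.b₁ Mstar) U, (𝔬 x).Dstar U = DscoS x.toKIdx (trBasis N) (𝔅 x) (fun U => U) U := fun _ _ => rfl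
  have hLapS : ∀ (x : MemberY θ.d₆ θ.ℓ₆ θ.hd' θ.hL' θ.b₀ θ.b₁ Mstar) U, (𝔬 x).Lap U = LcoS x.toKIdx (trBasis N) (𝔅 x) (fun U => U) U := fun _ _ => rfl
  have h𝔡d : ∀ (x : MemberY θ.d₆ θ.ℓ₆ θ.hd' θ.hL' θ.b₀ θ.b₁ Mstar) (U : (𝔅 x).Cfg), (𝔡 x).Dd U = fun μ => (etaS x.toKIdx)⁻¹ • coordOpK (trBasis N) (fun _ : Fin (θ.d₆ + 1) => (cdSL x.toKIdx U μ).restrictScalars ℝ) := fun _ _ => rfl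
  have h𝔡s : ∀ (x : MemberY θ.d₆ θ.ℓ₆ θ.hd' θ.hL' θ.b₀ θ.b₁ Mstar) (U : (𝔅 x).Cfg), (𝔡 x).Dsd U = fun μ => (etaS x.toKIdx)⁻¹ • coordOpK (trBasis N) (fun _ : Fin (θ.d₆ + 1) => (cdsSL x.toKIdx U μ).restrictScalars ℝ) := fun _ _ => rfl
  have hst : ∀ x, StaticOK (𝔬 x) p.ρ p.Nc p.N' p.Cℓ (κ x) := fun x => staticOK_opsWalkY x (trBasis N) (𝔅 x) (fun U => U) (parSymY x.toKIdx) (bI x) (hβ1 x) (hlev x) (hMw x) hM3 hρ3 hNc hN' hCℓ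
  have hκ : ∀ x, (κ x).Bounded p.Kc p.θ₀ p.Cℓ (geo9Y x).M := fun x => bounded_kappaWalkY x (trBasis N) (le_trans (by positivity) hCℓ) hKc hθ₀
  have hloc : ∀ x, LocalityDir (𝔬 x) (𝔡 x) (𝔩 x) (rd x) := fun x => localityDir_opsWalkY_of_agree x (trBasis N) (𝔅 x) (fun U => U) (parSymY x.toKIdx) (bI x) (rd x) rfl
  have hrd : ∀ x : MemberY θ.d₆ θ.ℓ₆ θ.hd' θ.hL' θ.b₀ θ.b₁ Mstar, (rd x).OKRel (𝔬 x).blk (RelB x.toKIdx) := fun x => ⟨(off_bound_evSK (κ := TrIdx N) x.toKIdx (sIK_faithful x.toKIdx (hβI x))).1, (off_bound_evSK (κ := TrIdx N) x.toKIdx (sIK_faithful x.toKIdx (hβI x))).2, fun lam => geo9K_supNorm_nonneg x.toKIdx lam⟩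
  have h36 : ∀ x, p.M₁ ≤ (geo9Y x).M → ∀ α₀ : ℝ, 0 < α₀ → c * (geo9Y x).M * α₀ ≤ p.a₁ → ∀ U : (𝔅 x).Cfg, (𝔅 x).Reg335 c α₀ U → Local342 (𝔬 x) 1 (H x) p.B₀ p.δ₀ U ∧ Identities₂ (𝔬 x) (𝔡 x) (𝔩 x) 1 (H x) U := fun x hM α₀ hα ha U hU => ⟨h36 x hM α₀ hα ha U hU, identities₂_opsWalkY_of_reg335R x (bI x) hGR 1 (H x) (hβ1 x) (hlev x) hU⟩
  have hY335 : ∀ (x : MemberY θ.d₆ θ.ℓ₆ θ.hd' θ.hL' θ.b₀ θ.b₁ Mstar) (α₀ : ℝ) (U : (𝔅 x).Cfg), (𝔅 x).Reg335 c α₀ U → (bg9Y (Matrix (Fin N) (Fin N) ℂ) (specialUnitaryUnits (Fin N)) x).Reg335 c α₀ U := fun x α₀ U hU => regY335_of_regYP335 x c35Y_le_ten (hRP1 x α₀ U hU).1 (hRP1 x α₀ U hU).2 ((ten_L3_le_c35B θ.ℓ₆).trans hcB)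
  have hL3c : 10 * ((θ.ℓ₆ + 1 : ℕ) : ℝ) ^ 3 ≤ c := (ten_L3_le_c35B θ.ℓ₆).trans hcB; have hL4c : 10 * ((θ.ℓ₆ + 1 : ℕ) : ℝ) ^ 4 ≤ c := (ten_L4_le_c35B θ.ℓ₆).trans hcB; have hL1 : (1 : ℝ) ≤ ((θ.ℓ₆ + 1 : ℕ) : ℝ) := (by exact_mod_cast Nat.succ_le_succ (Nat.zero_le _))
  have hαFδ : 0 ≤ q.αF * ((1 - 2 * q.α) * q.δ₀) := mul_nonneg hq.αF_pos.le (mul_nonneg (by linarith only [hq.α_lt]) hq.δ₀_pos.le); have hρS : 0 ≤ ρS := (by linarith only [hσS.le, hσSK, hδKS, hαFδ]); have hδB : 0 ≤ δB := (by linarith only [hrTB, hδTr, hδT12, hσS.le, hαFδ]); have htJ0 : 0 ≤ tJ := le_trans (by positivity) htJ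
  have hBJ := fun (x : MemberY θ.d₆ θ.ℓ₆ θ.hd' θ.hL' θ.b₀ θ.b₁ Mstar) (hM : M12 ≤ (geo9Y x).M) (α₀ : ℝ) (hα : 0 < α₀) (ha : (geo9Y x).M * α₀ ≤ a12) (U : (𝔅 x).Cfg) (hU : (𝔅 x).Reg335 c α₀ U) (hU' : (𝔅 x).Reg336 c α₀ U) => hBJ_of_pins_P (N := N) H c35Y c35Y_le_ten (fun x => ops312RY (𝔬12 x)) bI hbI0 hβ1 hblk12 hblkW12 tJ δB M12 a12 ha1J hδB htJ x hM α₀ hα ha U (hRP1 x α₀ U hU).2 (hRP2 x α₀ U hU').2; have hN0 : 0 < N := Nat.pos_of_ne_zero (NeZero.ne N); have hac : 0 < q.a₁ / c := div_pos hq.a₁_pos hc; have hca : ∀ {M α₀ : ℝ}, M * α₀ ≤ q.a₁ / c → c * M * α₀ ≤ q.a₁ := fun {M α₀} h => (by have h' := (le_div_iff₀ hc).1 h; linarith only [h', show c * M * α₀ = M * α₀ * c by ring]); obtain ⟨MR, hM1R, hΔAc⟩ := row17_of_row19_letters₂ (N := N) hN0 specialUnitaryUnits_le_unitaryUnits (fun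 x => bg9YR (Matrix (Fin N) (Fin N) ℂ) (specialUnitaryUnits (Fin N)) R₁ R₂ x) (fun x U => U) (fun x c α₀ U hU => (mem_of_reg335R hGR x hU)) 𝔬A 𝔡A 𝔩A hq.θ₀_nn hq.δ₀_pos hstA (fun x hM α₀ hα ha U hU => (h36A x hM α₀ hα ha U hU).2.2) (fun x hM α₀ hα ha U hU => (h36A x hM α₀ hα ha U hU).2.1) hGcoA hGsqA; have hMR : 0 < MR := hq.M₁_pos.trans_le hM1R
  have hΔA : ∀ x : MemberY θ.d₆ θ.ℓ₆ θ.hd' θ.hL' θ.b₀ θ.b₁ Mstar, MR ≤ (geo9Y x).M → ∀ α₀ : ℝ, 0 < α₀ → (geo9Y x).M * α₀ ≤ q.a₁ / c → ∀ U : (𝔅 x).Cfg, (𝔅 x).Reg335 c α₀ U → PosDefTr (fun _ => (1 : ℝ)) (deltaAY x.toKIdx (parSymY x.toKIdx) (parBY x.toKIdx) (GpY x.toKIdx (parSymY x.toKIdx)) U) := fun x hM α₀ hα ha U hU => hΔAc x hM α₀ hα (hca ha) U hU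
  have t311 := t311_of_pins_opsYOfLettersR θ.toStage3Params Mstar (lettersYOfRecordV4P N θ.toStage3Params Mstar 𝔯) 𝔈 R₁ R₂ (fun x => B9Thm311PosAtRecordV4.proofLettersGA (lettersYOfRecordV4P N θ.toStage3Params Mstar 𝔯 x)) c 0 (q.a₁ / c) MR hac hMR (fun _ => rfl) (fun _ => rfl)
    (fun x hM α₀ hα₀ hMa U hU => B9Thm311SymmAtRecordV4.inputs311Y_of_five specialUnitaryUnits_le_unitaryUnits x (lettersYOfRecordV4P N θ.toStage3Params Mstar 𝔯 x) _ rfl rfl rfl rfl (mem_of_reg335R hGR x hU) (B9Thm311PosAtRecordV4.inputs311Y₅_of_four specialUnitaryUnits_le_unitaryUnits x (lettersYOfRecordV4P N θ.toStage3Params Mstar 𝔯 x) _ rfl (mem_of_reg335R hGR x hU)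
      (B9Thm311PosAtRecordV4.inputs311Y₄_of_posDefTr_deltaAY x (lettersYOfRecordV4P N θ.toStage3Params Mstar 𝔯 x) rfl le_rfl (hMR.le.trans hM) (hΔA x hM α₀ hα₀ hMa U hU)))) hPD
  have t315 := t315_opsYNuStOfRecordV4PE_sectEStYOfRecordV7_of_3185_onR N θ.toStage3Params Mstar 𝔯 𝔢₀ 𝔴 𝔈 hGR ha₀E hδ₁E hB₁E (fun x α₀ hα ha U hU hU' => hE x (mstar_le_M x) α₀ hα ha U hU hU')
  obtain ⟨t314, t314loc⟩ : B9.Thm314Printed c geo9Y (bg9YR (Matrix (Fin N) (Fin N) ℂ) (specialUnitaryUnits (Fin N)) R₁ R₂) (fun x => kernelFamilyR R₁ R₂ ((opsYNuStOfRecordV4PE N θ.toStage3Params Mstar 𝔯 (sectEStYOfRecordV7 N θ.toStage3Params Mstar 𝔢₀) 𝔴 𝔈) x).Kdiff) dOmegaY ∧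
      B9Thm314.Thm314LocalPrinted c geo9Y (bg9YR (Matrix (Fin N) (Fin N) ℂ) (specialUnitaryUnits (Fin N)) R₁ R₂) (fun x => kernelFamilyR R₁ R₂ ((opsYNuStOfRecordV4PE N θ.toStage3Params Mstar 𝔯 (sectEStYOfRecordV7 N θ.toStage3Params Mstar 𝔢₀) 𝔴 𝔈) x).Kdiff) OmKY dOmegaY :=
    thm314_pair_layerOfLettersR R₁ R₂ (lettersYOfRecordV4P N θ.toStage3Params Mstar 𝔯) 𝔈 T14₁ T14₂ (fun x => locDataY x (E14₁ x) (X14₁ x) (M14₁ x) (diam14 x)) X14₂ M14₂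
      (fun x => locDataY_laws x (E14₁ x) (near14₁ x) (first14₁ x) (chain14₁ x)) (fun x => locDataY_laws x (E14₂ x) (near14₂ x) (first14₂ x) (chain14₂ x)) r14 hr14
      (fun x => modelSignsOn_geo9K x.toKIdx) (fun x y y' => dOmegaY_nonneg x y y') h14₁ h14₂ W14₁ W14₂ hW14₁ hW14₂ hcnt14₁ hcnt14₂ hexp14
  have hGp := hGp_opsYOfLetters_holds N θ.toStage3Params Mstar (lettersYOfRecordV4P N θ.toStage3Params Mstar 𝔯) 𝔈; have hGA := hGA_opsYOfLetters N θ.toStage3Params Mstar (lettersYOfRecordV4P N θ.toStage3Params Mstar 𝔯) 𝔈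
  obtain ⟨t39, hksum⟩ := t39_hksum_oneCube_opsYOfLetters_FRC θ.toStage3Params Mstar (lettersYOfRecordV4P N θ.toStage3Params Mstar 𝔯) 𝔈 R₁ R₂ bI c α' r39 B39 δ39 a39 M39 hc hα'0 hα'1 hr39 hrδ39 hB39 ha39 hM39 h348 (fun _ => rfl) hβI hEK39
  have hsat : ∀ (x : MemberY θ.d₆ θ.ℓ₆ θ.hd' θ.hL' θ.b₀ θ.b₁ Mstar) (n : Fin 4) (B' δ' : ℝ), (∀ a a' b, RelB x.toKIdx a a' → maj342 (geo9Y x) n B' δ' a b = maj342 (geo9Y x) n B' δ' a' b) ∧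
      (∀ a b b', RelB x.toKIdx b b' → maj342 (geo9Y x) n B' δ' a b = maj342 (geo9Y x) n B' δ' a b') := fun x n B' δ' => ⟨fun a a' b h => maj342_relB_left x.toKIdx n B' δ' a a' b h, fun a b b' h => maj342_relB_right x.toKIdx n B' δ' a b b' h⟩
  have hmult : ∀ (x : MemberY θ.d₆ θ.ℓ₆ θ.hd' θ.hL' θ.b₀ θ.b₁ Mstar) (y' : (geo9Y x).Site), (Finset.univ.filter (fun y'' : (geo9Y x).Site => RelB x.toKIdx y'' y')).card ≤ 2 * (θ.d₆ + 1) := fun x y' => by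
    refine le_trans (Finset.card_le_card fun c hc => ?_) (card_sameCarrier_le_kIdx x.toKIdx y'); exact Finset.mem_filter.2 ⟨@Finset.mem_univ _ (_) c, (Finset.mem_filter.1 hc).2⟩
  have hRdist : ∀ (x : MemberY θ.d₆ θ.ℓ₆ θ.hd' θ.hL' θ.b₀ θ.b₁ Mstar) (a a' b : (geo9Y x).Site), RelB x.toKIdx a a' → (geo9Y x).dist a b = (geo9Y x).dist a' b := fun x a a' b h => dist_eq_of_relB x.toKIdx h (relB_refl x.toKIdx b)
  have hRlen : ∀ (x : MemberY θ.d₆ θ.ℓ₆ θ.hd' θ.hL' θ.b₀ θ.b₁ Mstar) (a a' : (geo9Y x).Site), RelB x.toKIdx a a' → (geo9Y x).len a = (geo9Y x).len a' := fun x a a' h => len_eq_of_relB x.toKIdx h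
  have hS := fun (x : MemberY θ.d₆ θ.ℓ₆ θ.hd' θ.hL' θ.b₀ θ.b₁ Mstar) (U : (𝔅 x).Cfg) => site_coReadings4_of_pins x.toKIdx (trBasis N) (𝔅 x) (fun U => U) (lettersYOfRecordV4P N θ.toStage3Params Mstar 𝔯 x).Gp (lettersYOfRecordV4P N θ.toStage3Params Mstar 𝔯 x).parS U (hβI x) (hlev x) (hblkS x) (hblkYS x) (hGpS x U) (hDS x U) (hDsS x U) (hLapS x U)
  have hco0 := fun x U => (hS x U).1; have hco1 := fun x U => (hS x U).2.1; have hco2 := fun x U => (hS x U).2.2.1; have hco3 := fun x U => (hS x U).2.2.2.1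
  have hgl0 := fun x U => (hS x U).2.2.2.2.1; have hgl1 := fun x U => (hS x U).2.2.2.2.2.1; have hgl2 := fun x U => (hS x U).2.2.2.2.2.2.1; have hgl3 := fun x U => (hS x U).2.2.2.2.2.2.2
  have hA := fun (x : MemberY θ.d₆ θ.ℓ₆ θ.hd' θ.hL' θ.b₀ θ.b₁ Mstar) (U : (𝔅 x).Cfg) => bond_coReadings3_of_pins x.toKIdx (trBasis N) (𝔅 x) (fun U => U) (lettersYOfRecordV4P N θ.toStage3Params Mstar 𝔯 x).GA (lettersYOfRecordV4P N θ.toStage3Params Mstar 𝔯 x).parB U (hβI x) (hlev x) (hblkA x) (hblkYA x) (hGcoA x U) (hDcoA x U) (hDscoA x U)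
  have hAL := fun (x : MemberY θ.d₆ θ.ℓ₆ θ.hd' θ.hL' θ.b₀ θ.b₁ Mstar) (U : (𝔅 x).Cfg) => bond_coReadingsLap_of_pins x.toKIdx (trBasis N) (𝔅 x) (fun U => U) (lettersYOfRecordV4P N θ.toStage3Params Mstar 𝔯 x).GA (lettersYOfRecordV4P N θ.toStage3Params Mstar 𝔯 x).parB U (hβI x) (hlev x) (hblkA x) (hGcoA x U) (hLcoA x U)
  have hcoA0 := fun x U => (hA x U).1; have hcoA1 := fun x U => (hA x U).2.1; have hcoA2 := fun x U => (hA x U).2.2.1; have hcoA3 := fun x U => (hAL x U).1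
  have hglA0 := fun x U => (hA x U).2.2.2.2.2.2.1; have hglA1 := fun x U => (hA x U).2.2.2.2.2.2.2.1; have hglA2 := fun x U => (hA x U).2.2.2.2.2.2.2.2; have hglA3 := fun x U => (hAL x U).2.2
  letI hF : ∀ x : MemberY θ.d₆ θ.ℓ₆ θ.hd' θ.hL' θ.b₀ θ.b₁ Mstar, Fintype (B9GeoNormsKLevelV1.geo9K x.toKIdx).Site := fun x => (inferInstance : Fintype (geo9Y x).Site)
  have hsymD : ∀ (x : MemberY θ.d₆ θ.ℓ₆ θ.hd' θ.hL' θ.b₀ θ.b₁ Mstar) (U : (𝔅 x).Cfg), (∀ μ z, U μ z ∈ specialUnitaryUnits (Fin N)) → IsSymmTr (fun _ => (1 : ℝ)) ((lettersYOfRecordV4P N θ.toStage3Params Mstar 𝔯 x).GD U) ∧ IsSymmTr (fun _ => (1 : ℝ)) ((lettersYOfRecordV4P N θ.toStage3Params Mstar 𝔯 x).G₁ U) ∧ IsSymmTr (fun _ => (1 : ℝ)) ((lettersYOfRecordV4P N θ.toStage3Params Mstar 𝔯 x).GG U) := lettersYOfRecordV4P_symmDG₁GG N θ.toStage3Params Mstar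 𝔯 hΔ2
  have hIR : ∀ x U, InputReadsFam (kernelFamilyR R₁ R₂ ((opsYNuStOfRecordV4PE N θ.toStage3Params Mstar 𝔯 (sectEStYOfRecordV7 N θ.toStage3Params Mstar 𝔢₀) 𝔴 𝔈) x).Gp) U (bHX x) 2 ((𝔬 x).blk ∘ Prod.fst) ((𝔭 x).blkPX ∘ Prod.fst) (fun β => sliceProbe ((𝔭 x).ΦX U β)) (evSK x.toKIdx) (familyOp fun r : Fin (θ.d₆ + 1) × Fin (θ.d₆ + 1) => (𝔡 x).Dd U r.1 ∘ₗ ((𝔬 x).Gp U ∘ₗ (𝔡 x).Dsd U r.2)) := fun x U =>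
    site_inputReadsFam_of_pinsSA x.toKIdx (trBasis N) (𝔅 x) (fun U => U) (lettersYOfRecordV4P N θ.toStage3Params Mstar 𝔯 x).Gp (lettersYOfRecordV4P N θ.toStage3Params Mstar 𝔯 x).parS U (hβI x) (hβ1 x) (h𝔭 x) (hbHX x) (hblkS x) (hGpS x U) (h𝔡d x U) (h𝔡s x U)
  have hH1 : ∀ x U, H1ReadsNbr (kernelFamilyR R₁ R₂ ((opsYNuStOfRecordV4PE N θ.toStage3Params Mstar 𝔯 (sectEStYOfRecordV7 N θ.toStage3Params Mstar 𝔢₀) 𝔴 𝔈) x).Gp) U (𝔭 x) (RelB x.toKIdx) 2 (𝔬 x).blk (𝔬 x).blkY (evSK x.toKIdx) (evSK x.toKIdx) ((𝔬 x).D U ∘ₗ (𝔬 x).Gp U) ((𝔬 x).Gp U ∘ₗ (𝔬 x).Dstar U) := fun x U => by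
    rw [h𝔭 x]; exact site_h1ReadsNbr_of_pinsSA x.toKIdx (trBasis N) (𝔅 x) (fun U => U) (lettersYOfRecordV4P N θ.toStage3Params Mstar 𝔯 x).Gp (lettersYOfRecordV4P N θ.toStage3Params Mstar 𝔯 x).parS U (hβI x) (hβ1 x) (hblkS x) (hblkYS x) (hGpS x U) (hDS x U) (hDsS x U)
  have hH1A : ∀ x U, H1ReadsNbr (kernelFamilyR R₁ R₂ ((opsYNuStOfRecordV4PE N θ.toStage3Params Mstar 𝔯 (sectEStYOfRecordV7 N θ.toStage3Params Mstar 𝔢₀) 𝔴 𝔈) x).GA) U (𝔭A x) (RelB x.toKIdx) 2 (𝔬A x).blk (𝔬A x).blkY (evBK x.toKIdx) (evBK x.toKIdx) ((𝔬A x).D U ∘ₗ (𝔬A x).G U) ((𝔬A x).G U ∘ₗ (𝔬A x).Dstar U) := fun x U => by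
    rw [h𝔭A x]; exact bond_h1ReadsNbr_of_pinsA x.toKIdx (trBasis N) (𝔅 x) (fun U => U) (lettersYOfRecordV4P N θ.toStage3Params Mstar 𝔯 x).GA (lettersYOfRecordV4P N θ.toStage3Params Mstar 𝔯 x).parB U (hβI x) (hβ1 x) (hblkA x) (hblkYA x) (hGcoA x U) (hDcoA x U) (hDscoA x U)
  have hHCN : ∀ (x : MemberY θ.d₆ θ.ℓ₆ θ.hd' θ.hL' θ.b₀ θ.b₁ Mstar) (U : (𝔅 x).Cfg), CoReadsHHolderNbr (hKernelR R₁ R₂ ((opsYNuStOfRecordV4PE N θ.toStage3Params Mstar 𝔯 (sectEStYOfRecordV7 N θ.toStage3Params Mstar 𝔢₀) 𝔴 𝔈) x).H) U (θ.d₆ + 1) (𝔭A x) 2 (𝔬12 x).blkZ ((𝔬12 x).D U ∘ₗ (𝔬12 x).Hm U) ∧ CoReadsHHolderNbr (hKernelR R₁ R₂ ((opsYNuStOfRecordV4PE N θ.toStage3Params Mstar 𝔯 (sectEStYOfRecordV7 N θ.toStage3Params Mstar 𝔢₀) 𝔴 𝔈) x).H₁) U (θ.d₆ + 1) (𝔭A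 x) 2 (𝔬12 x).blkZ ((𝔬12 x).D U ∘ₗ (𝔬12 x).H1m U) := fun x U =>
    ⟨bond_coReadsHHolderNbr_of_pinsA x.toKIdx (trBasis N) (𝔅 x) (fun U => U) (lettersYOfRecordV4P N θ.toStage3Params Mstar 𝔯 x).H (lettersYOfRecordV4P N θ.toStage3Params Mstar 𝔯 x).parB U (hβ1 x) (h𝔭A x) (hblkZ12 x) (hHm12 x U) (hDco12 x U),
      bond_coReadsHHolderNbr_of_pinsA x.toKIdx (trBasis N) (𝔅 x) (fun U => U) (lettersYOfRecordV4P N θ.toStage3Params Mstar 𝔯 x).H₁ (lettersYOfRecordV4P N θ.toStage3Params Mstar 𝔯 x).parB U (hβ1 x) (h𝔭A x) (hblkZ12 x) (hH1m12 x U) (hDco12 x U)⟩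
  have hIRA : ∀ x U, InputReadsFam (kernelFamilyR R₁ R₂ ((opsYNuStOfRecordV4PE N θ.toStage3Params Mstar 𝔯 (sectEStYOfRecordV7 N θ.toStage3Params Mstar 𝔢₀) 𝔴 𝔈) x).GA) U (bHXA x) 2 ((𝔬A x).blk ∘ Prod.fst) ((𝔭A x).blkPX ∘ Prod.fst) (fun β => sliceProbe ((𝔭A x).ΦX U β)) (evBK x.toKIdx) (familyOp fun r : Fin (θ.d₆ + 1) × Fin (θ.d₆ + 1) => (𝔡A x).Dd U r.1 ∘ₗ ((𝔬A x).G U ∘ₗ (𝔡A x).Dsd U r.2)) := fun x U =>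
    bond_inputReadsFam_of_pinsA x.toKIdx (trBasis N) (𝔅 x) (fun U => U) (lettersYOfRecordV4P N θ.toStage3Params Mstar 𝔯 x).GA (lettersYOfRecordV4P N θ.toStage3Params Mstar 𝔯 x).parB U (hβI x) (hβ1 x) (h𝔭A x) (hbHXA x) (hblkA x) (hGcoA x U) (h𝔡Ad x U) (h𝔡As x U)
  have hIF : ∀ (x : MemberY θ.d₆ θ.ℓ₆ θ.hd' θ.hL' θ.b₀ θ.b₁ Mstar) (U : (𝔅 x).Cfg), InputReadsFam (kernelFamilyR R₁ R₂ ((opsYNuStOfRecordV4PE N θ.toStage3Params Mstar 𝔯 (sectEStYOfRecordV7 N θ.toStage3Params Mstar 𝔢₀) 𝔴 𝔈) x).GD) U (bHXA x) 2 ((𝔬12 x).blk ∘ Prod.fst) ((𝔭A x).blkPX ∘ Prod.fst) (fun β => sliceProbe ((𝔭A x).ΦX U β)) (evBK x.toKIdx) (familyOp fun q : Fin (θ.d₆ + 1) × Fin (θ.d₆ + 1) => (𝔡A x).Dd U q.1 ∘ₗ ((𝔬12 x).G U ∘ₗ (𝔡A x).Dsd U q.2)) ∧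
      InputReadsFam (kernelFamilyR R₁ R₂ ((opsYNuStOfRecordV4PE N θ.toStage3Params Mstar 𝔯 (sectEStYOfRecordV7 N θ.toStage3Params Mstar 𝔢₀) 𝔴 𝔈) x).G₁) U (bHXA x) 2 ((𝔬12 x).blk ∘ Prod.fst) ((𝔭A x).blkPX ∘ Prod.fst) (fun β => sliceProbe ((𝔭A x).ΦX U β)) (evBK x.toKIdx) (familyOp fun q : Fin (θ.d₆ + 1) × Fin (θ.d₆ + 1) => (𝔡A x).Dd U q.1 ∘ₗ ((𝔬12 x).G1 U ∘ₗ (𝔡A x).Dsd U q.2)) ∧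
      InputReadsFam (kernelFamilyR R₁ R₂ ((opsYNuStOfRecordV4PE N θ.toStage3Params Mstar 𝔯 (sectEStYOfRecordV7 N θ.toStage3Params Mstar 𝔢₀) 𝔴 𝔈) x).GG) U (bHXA x) 2 ((𝔬12 x).blk ∘ Prod.fst) ((𝔭A x).blkPX ∘ Prod.fst) (fun β => sliceProbe ((𝔭A x).ΦX U β)) (evBK x.toKIdx) (familyOp fun q : Fin (θ.d₆ + 1) × Fin (θ.d₆ + 1) => (𝔡A x).Dd U q.1 ∘ₗ ((𝔬12 x).GG U ∘ₗ (𝔡A x).Dsd U q.2)) := fun x U =>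
    ⟨bond_inputReadsFam_of_pinsA x.toKIdx (trBasis N) (𝔅 x) (fun U => U) (lettersYOfRecordV4P N θ.toStage3Params Mstar 𝔯 x).GD (lettersYOfRecordV4P N θ.toStage3Params Mstar 𝔯 x).parB U (hβI x) (hβ1 x) (h𝔭A x) (hbHXA x) (hblk12 x) (hGco12 x U) (h𝔡Ad x U) (h𝔡As x U),
      bond_inputReadsFam_of_pinsA x.toKIdx (trBasis N) (𝔅 x) (fun U => U) (lettersYOfRecordV4P N θ.toStage3Params Mstar 𝔯 x).G₁ (lettersYOfRecordV4P N θ.toStage3Params Mstar 𝔯 x).parB U (hβI x) (hβ1 x) (h𝔭A x) (hbHXA x) (hblk12 x) (hG1co12 x U) (h𝔡Ad x U) (h𝔡As x U),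
      bond_inputReadsFam_of_pinsA x.toKIdx (trBasis N) (𝔅 x) (fun U => U) (lettersYOfRecordV4P N θ.toStage3Params Mstar 𝔯 x).GG (lettersYOfRecordV4P N θ.toStage3Params Mstar 𝔯 x).parB U (hβI x) (hβ1 x) (h𝔭A x) (hbHXA x) (hblk12 x) (hGGco12 x U) (h𝔡Ad x U) (h𝔡As x U)⟩
  have hH1N : ∀ (x : MemberY θ.d₆ θ.ℓ₆ θ.hd' θ.hL' θ.b₀ θ.b₁ Mstar) (U : (𝔅 x).Cfg), H1ReadsNbr (kernelFamilyR R₁ R₂ ((opsYNuStOfRecordV4PE N θ.toStage3Params Mstar 𝔯 (sectEStYOfRecordV7 N θ.toStage3Params Mstar 𝔢₀) 𝔴 𝔈) x).GD) U (𝔭A x) (RelB x.toKIdx) 2 (𝔬12 x).blk (𝔬12 x).blkY (evBK x.toKIdx) (evBK x.toKIdx) ((𝔬12 x).D U ∘ₗ (𝔬12 x).G U) ((𝔬12 x).G U ∘ₗ (𝔬12 x).Dstar U) ∧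
      H1ReadsNbr (kernelFamilyR R₁ R₂ ((opsYNuStOfRecordV4PE N θ.toStage3Params Mstar 𝔯 (sectEStYOfRecordV7 N θ.toStage3Params Mstar 𝔢₀) 𝔴 𝔈) x).G₁) U (𝔭A x) (RelB x.toKIdx) 2 (𝔬12 x).blk (𝔬12 x).blkY (evBK x.toKIdx) (evBK x.toKIdx) ((𝔬12 x).D U ∘ₗ (𝔬12 x).G1 U) ((𝔬12 x).G1 U ∘ₗ (𝔬12 x).Dstar U) ∧
      H1ReadsNbr (kernelFamilyR R₁ R₂ ((opsYNuStOfRecordV4PE N θ.toStage3Params Mstar 𝔯 (sectEStYOfRecordV7 N θ.toStage3Params Mstar 𝔢₀) 𝔴 𝔈) x).GG) U (𝔭A x) (RelB x.toKIdx) 2 (𝔬12 x).blk (𝔬12 x).blkY (evBK x.toKIdx) (evBK x.toKIdx) ((𝔬12 x).D U ∘ₗ (𝔬12 x).GG U) ((𝔬12 x).GG U ∘ₗ (𝔬12 x).Dstar U) := fun x U => by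
    rw [h𝔭A x]; exact ⟨bond_h1ReadsNbr_of_pinsA x.toKIdx (trBasis N) (𝔅 x) (fun U => U) (lettersYOfRecordV4P N θ.toStage3Params Mstar 𝔯 x).GD (lettersYOfRecordV4P N θ.toStage3Params Mstar 𝔯 x).parB U (hβI x) (hβ1 x) (hblk12 x) (hblkY12 x) (hGco12 x U) (hDco12 x U) (hDsco12 x U),
      bond_h1ReadsNbr_of_pinsA x.toKIdx (trBasis N) (𝔅 x) (fun U => U) (lettersYOfRecordV4P N θ.toStage3Params Mstar 𝔯 x).G₁ (lettersYOfRecordV4P N θ.toStage3Params Mstar 𝔯 x).parB U (hβI x) (hβ1 x) (hblk12 x) (hblkY12 x) (hG1co12 x U) (hDco12 x U) (hDsco12 x U),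
      bond_h1ReadsNbr_of_pinsA x.toKIdx (trBasis N) (𝔅 x) (fun U => U) (lettersYOfRecordV4P N θ.toStage3Params Mstar 𝔯 x).GG (lettersYOfRecordV4P N θ.toStage3Params Mstar 𝔯 x).parB U (hβI x) (hβ1 x) (hblk12 x) (hblkY12 x) (hGGco12 x U) (hDco12 x U) (hDsco12 x U)⟩
  have hLA := fun (x : MemberY θ.d₆ θ.ℓ₆ θ.hd' θ.hL' θ.b₀ θ.b₁ Mstar) (U : (𝔅 x).Cfg) => bond_l2ReadsNbr3_of_pins x.toKIdx (trBasis N) (𝔅 x) (fun U => U) (lettersYOfRecordV4P N θ.toStage3Params Mstar 𝔯 x).GA (lettersYOfRecordV4P N θ.toStage3Params Mstar 𝔯 x).parB U (R := (1 : ℝ)) (H := H x) (hβI x) (hβ1 x) (hblkA x) (hblkYA x) (hGcoA x U) (hDcoA x U) (hDscoA x U); have hlA0 := fun x U => (hLA x U).1; have hlA1 := fun x U => (hLA x U).2.1; have hlA2 := fun x U => (hLA x U).2.2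
  have hLA3 := fun (x : MemberY θ.d₆ θ.ℓ₆ θ.hd' θ.hL' θ.b₀ θ.b₁ Mstar) (U : (𝔅 x).Cfg) => bond_l2ReadsNbr345_of_pins x.toKIdx (trBasis N) (𝔅 x) (fun U => U) (lettersYOfRecordV4P N θ.toStage3Params Mstar 𝔯 x).GA (lettersYOfRecordV4P N θ.toStage3Params Mstar 𝔯 x).parB U (R := (1 : ℝ)) (H := H x) (hβI x) (hβ1 x) (hblkA x) (hGcoA x U) (h𝔡Ad x U) (h𝔡As x U); have hlA3 := fun x U => (hLA3 x U).1; have hlA4 := fun x U => (hLA3 x U).2.1; have hlA5 := fun x U => (hLA3 x U).2.2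
  have hLS := fun (x : MemberY θ.d₆ θ.ℓ₆ θ.hd' θ.hL' θ.b₀ θ.b₁ Mstar) (U : (𝔅 x).Cfg) => site_l2ReadsNbr012_of_pins x.toKIdx (trBasis N) (𝔅 x) (fun U => U) (lettersYOfRecordV4P N θ.toStage3Params Mstar 𝔯 x).Gp (lettersYOfRecordV4P N θ.toStage3Params Mstar 𝔯 x).parS U (R := (1 : ℝ)) (H := H x) (sIK_faithful x.toKIdx (hβI x)) (sIK_dist_le_one x.toKIdx (hβ1 x)) (hblkS x) (hblkYS x) (hGpS x U) (hDS x U) (hDsS x U); have hl0 := fun x U => (hLS x U).1; have hl1 := fun x U => (hLS x U).2.1; have hl2 := fun x U => (hLS x U).2.2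
  have hLS3 := fun (x : MemberY θ.d₆ θ.ℓ₆ θ.hd' θ.hL' θ.b₀ θ.b₁ Mstar) (U : (𝔅 x).Cfg) => site_l2ReadsNbr345_of_pins x.toKIdx (trBasis N) (𝔅 x) (fun U => U) (lettersYOfRecordV4P N θ.toStage3Params Mstar 𝔯 x).Gp (lettersYOfRecordV4P N θ.toStage3Params Mstar 𝔯 x).parS U (R := (1 : ℝ)) (H := H x) (sIK_faithful x.toKIdx (hβI x)) (sIK_dist_le_one x.toKIdx (hβ1 x)) (hblkS x) (hGpS x U) (h𝔡d x U) (h𝔡s x U); have hl3 := fun x U => (hLS3 x U).1; have hl4 := fun x U => (hLS3 x U).2.1; have hl5 := fun x U => (hLS3 x U).2.2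
  have hRd₂ : ∀ (x : MemberY θ.d₆ θ.ℓ₆ θ.hd' θ.hL' θ.b₀ θ.b₁ Mstar) (a b b' : (geo9Y x).Site), RelB x.toKIdx b b' → (geo9Y x).dist a b = (geo9Y x).dist a b' := fun x a b b' h => dist_eq_of_relB x.toKIdx (relB_refl x.toKIdx a) h
  have hsym : ∀ x : MemberY θ.d₆ θ.ℓ₆ θ.hd' θ.hL' θ.b₀ θ.b₁ Mstar, p.M₁ ≤ (geo9Y x).M → ∀ α₀ : ℝ, 0 < α₀ → c * (geo9Y x).M * α₀ ≤ p.a₁ → ∀ U : (𝔅 x).Cfg, (𝔅 x).Reg335 c α₀ U → IsTransposePair ((𝔬 x).Gp U) ((𝔬 x).Gp U) := fun x _ α₀ _ _ U hU => by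
    rw [hGpS x U]; exact isTransposePair_GcoS_trBasis x.toKIdx (𝔅 x) (fun U => U) (lettersYOfRecordV4P N θ.toStage3Params Mstar 𝔯 x).Gp U (GpY_isSymmTr x.toKIdx (parSymY x.toKIdx) U (symm0_parSymY x.toKIdx specialUnitaryUnits_le_unitaryUnits (mem_of_reg335R hGR x hU)))
  have htr : ∀ x : MemberY θ.d₆ θ.ℓ₆ θ.hd' θ.hL' θ.b₀ θ.b₁ Mstar, p.M₁ ≤ (geo9Y x).M → ∀ α₀ : ℝ, 0 < α₀ → c * (geo9Y x).M * α₀ ≤ p.a₁ → ∀ U : (𝔅 x).Cfg, (𝔅 x).Reg335 c α₀ U → IsTransposePair ((𝔬 x).D U ∘ₗ (𝔬 x).Gp U) ((𝔬 x).Gp U ∘ₗ (𝔬 x).Dstar U) := fun x _ α₀ _ _ U hU => by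
    rw [hDS x U, hGpS x U, hDsS x U]; exact isTransposePair_DcoS_GcoS_trBasis x.toKIdx (𝔅 x) (fun U => U) (lettersYOfRecordV4P N θ.toStage3Params Mstar 𝔯 x).Gp U (GpY_isSymmTr x.toKIdx (parSymY x.toKIdx) U (symm0_parSymY x.toKIdx specialUnitaryUnits_le_unitaryUnits (mem_of_reg335R hGR x hU))) (fun μ z => specialUnitaryUnits_le_unitaryUnits ((mem_of_reg335R hGR x hU) μ z))
  have hsymA : ∀ x : MemberY θ.d₆ θ.ℓ₆ θ.hd' θ.hL' θ.b₀ θ.b₁ Mstar, q.M₁ ≤ (geo9Y x).M → ∀ α₀ : ℝ, 0 < α₀ → c * (geo9Y x).M * α₀ ≤ q.a₁ → ∀ U : (𝔅 x).Cfg, (𝔅 x).Reg335 c α₀ U → IsTransposePair ((𝔬A x).G U) ((𝔬A x).G U) := fun x _ α₀ _ _ U hU => by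
    rw [hGcoA x U]; exact isTransposePair_GcoK_trBasis x.toKIdx (𝔅 x) (fun U => U) (lettersYOfRecordV4P N θ.toStage3Params Mstar 𝔯 x).GA U (symmG_parSymY x.toKIdx specialUnitaryUnits_le_unitaryUnits (mem_of_reg335R hGR x hU))
  have htrA : ∀ x : MemberY θ.d₆ θ.ℓ₆ θ.hd' θ.hL' θ.b₀ θ.b₁ Mstar, q.M₁ ≤ (geo9Y x).M → ∀ α₀ : ℝ, 0 < α₀ → c * (geo9Y x).M * α₀ ≤ q.a₁ → ∀ U : (𝔅 x).Cfg, (𝔅 x).Reg335 c α₀ U → IsTransposePair ((𝔬A x).D U ∘ₗ (𝔬A x).G U) ((𝔬A x).G U ∘ₗ (𝔬A x).Dstar U) := fun x _ α₀ _ _ U hU => by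
    rw [hDcoA x U, hGcoA x U, hDscoA x U]; exact isTransposePair_DcoK_GcoK_trBasis x.toKIdx (𝔅 x) (fun U => U) (lettersYOfRecordV4P N θ.toStage3Params Mstar 𝔯 x).GA U (symmG_parSymY x.toKIdx specialUnitaryUnits_le_unitaryUnits (mem_of_reg335R hGR x hU)) (fun μ z => specialUnitaryUnits_le_unitaryUnits ((mem_of_reg335R hGR x hU) μ z))
  have hgeoOK : ∀ x : MemberY θ.d₆ θ.ℓ₆ θ.hd' θ.hL' θ.b₀ θ.b₁ Mstar, GeoOK (geo9Y x) := fun x => ⟨geo9Y_dist_triangle x, geo9Y_dist_comm x, geo9K_dist_nonneg x.toKIdx, geo9Y_len_pos x⟩; have hN : 0 < N := Nat.pos_of_ne_zero (NeZero.ne N); have hcR : cR39 (trBasis N) ≠ 0 := (cR39_trBasis_pos hN).ne'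
  have hpos12 : ∀ x : MemberY θ.d₆ θ.ℓ₆ θ.hd' θ.hL' θ.b₀ θ.b₁ Mstar, max M12 MR ≤ (geo9Y x).M → ∀ α₀ : ℝ, 0 < α₀ → (geo9Y x).M * α₀ ≤ min a12 (q.a₁ / c) → ∀ U : (𝔅 x).Cfg, (𝔅 x).Reg335 c α₀ U →
      (𝔅 x).Reg336 c α₀ U → PosDefEnd ((𝔬12 x).S0 U) := fun x hM α₀ hα ha U hU _ => by
    rw [hS0co12 x U]; exact posDefEnd_S0coK_of_posDefTr_phys x.toKIdx (𝔅 x) (fun U => U) U hN (by rw [deltaAY_GpPhysY]; exact hΔA x ((le_max_right _ _).trans hM) α₀ hα (ha.trans (min_le_right _ _)) U hU)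
  have hinv12 : ∀ x : MemberY θ.d₆ θ.ℓ₆ θ.hd' θ.hL' θ.b₀ θ.b₁ Mstar, max M12 MR ≤ (geo9Y x).M → ∀ α₀ : ℝ, 0 < α₀ → (geo9Y x).M * α₀ ≤ min a12 (q.a₁ / c) → ∀ U : (𝔅 x).Cfg, (𝔅 x).Reg335 c α₀ U →
      (𝔅 x).Reg336 c α₀ U → (𝔬12 x).G0 U * (𝔬12 x).S0 U = 1 := fun x hM α₀ hα ha U hU _ => by
    rw [hG0co12 x U, hS0co12 x U, lettersYOfRecordV4P_GA_phys]; exact GcoK_GAY_mul_S0coK hcR (isUnit_deltaAY_phys_of_posDefTr _ (hΔA x ((le_max_right _ _).trans hM) α₀ hα (ha.trans (min_le_right _ _)) U hU))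
  have hIdOfForm : ∀ x : MemberY θ.d₆ θ.ℓ₆ θ.hd' θ.hL' θ.b₀ θ.b₁ Mstar, max M12 MR ≤ (geo9Y x).M → ∀ α₀ : ℝ, 0 < α₀ → (geo9Y x).M * α₀ ≤ min a12 (q.a₁ / c) → ∀ U : (𝔅 x).Cfg, (𝔅 x).Reg335 c α₀ U →
      (𝔅 x).Reg336 c α₀ U → ∀ r : ℝ, r < 1 → FormSmall (𝔬12 x) r U → B9Thm312Whole.Identities (𝔬12 x) U := fun x hM α₀ hα ha U hU hU' r hr hF =>
    identities_of_def_3124 (identitiesDef_of_pins_phys x.toKIdx (𝔅 x) (fun U => U) (𝔯 x).Δ2 (𝔬12 x) U hN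
      specialUnitaryUnits_le_unitaryUnits (mem_of_reg335R hGR x hU) (isUnit_of_posDefTr (hΔA x ((le_max_right _ _).trans hM) α₀ hα (ha.trans (min_le_right _ _)) U hU))
      (isUnit_deltaPiAY_of_formSmall_phys x.toKIdx (𝔅 x) (fun U => U) (𝔬12 x) U hN hF hr (hS0co12 x U) (hTpico12 x U))
      (isUnit_deltaOneY_of_formSmall_phys x.toKIdx (𝔅 x) (fun U => U) (𝔯 x).Δ2 (𝔬12 x) U hN hF hr (hS0co12 x U) (hTpico12 x U) (hT2co12 x U))
      (isUnit_QGQOfY_G1Y_recordP_of_posDefTr x.toKIdx specialUnitaryUnits_le_unitaryUnits (mem_of_reg335R hGR x hU) (𝔯 x).Δ2 (posDefTr_deltaOneY_of_formSmall_pins_phys x.toKIdx (𝔅 x) (fun U => U) (𝔯 x).Δ2 (𝔬12 x) U hN hF hr (hS0co12 x U) (hTpico12 x U) (hT2co12 x U)))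
      (hG0co12 x U) (hS0co12 x U) (hTpico12 x U) (hT2co12 x U) (hGco12 x U) (hG1co12 x U) (hGGco12 x U) (hQco12 x U) (hQsco12 x U) (hCco12 x U) (hC1co12 x U)
      (hHm12 x U) (hH1m12 x U) (hDvco12 x U) (hDvsco12 x U) (hRco12 x U)) (ids3124_ids3152_of_hZ_pins x.toKIdx (𝔅 x) (fun U => U) (𝔯 x).Δ2 (𝔬12 x) U hN specialUnitaryUnits_le_unitaryUnits (mem_of_reg335R hGR x hU) (cf_mul_etaS_of_hcfk x.toKIdx x.hcfk) (isUnit_deltaOneY_of_formSmall_phys x.toKIdx (𝔅 x) (fun U => U) (𝔯 x).Δ2 (𝔬12 x) U hN hF hr (hS0co12 x U) (hTpico12 x U) (hT2co12 x U)) (hG1co12 x U) (hQco12 x U) (hQsco12 x U) (hDvco12 x U) (hDvsco12 x U) (hRco12 x U) (hZ x ((le_max_left _ _).trans hM) α₀ hα (ha.trans (min_le_left _ _)) U hU hU')).1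
  have hNQ : ∀ x : MemberY θ.d₆ θ.ℓ₆ θ.hd' θ.hL' θ.b₀ θ.b₁ Mstar, (Fintype.card (Fin (θ.d₆ + 1)) : ℝ) ≤ ((θ.d₆ + 1 : ℕ) : ℝ) := (fun _ => by rw [Fintype.card_fin]); have hfac := (h36H_with_factor_of_pinsR θ Mstar c hc hY335 H bI hlev hβ1 𝔬 𝔡 𝔩 hblkS hhS hGsqF h𝔡d h𝔡s p hp pM κ hst hκ h36 h36H hM1fac ha1fac hδfac hθfac); have hmix := (l2MixedLegs37_of_pinsR θ Mstar c hc hY335 H bI hlev hβ1 𝔬 𝔡 hblkS hhS hGsqF h𝔡d h𝔡s p pM hM1mix ha1mix hBMmix hδmix); have h36H' := h36H_of_dir_pins₃R (R := (1 : ℝ)) (H := H) hGR 𝔬 𝔡 𝔭 (fun x => (lettersYOfRecordV4P N θ.toStage3Params Mstar 𝔯 x).Gp) (fun x => (lettersYOfRecordV4P N θ.toStage3Params Mstar 𝔯 x).parS) h𝔭 hblkS hblkYS hGpS hDS hDsS h𝔡d h𝔡s hGsqF hY335 (fun x hM α₀ hα ha U hU => by obtain ⟨h₁, h₂, h₃₄,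 h₅₆, h₈⟩ := hfac x hM α₀ hα ha U hU; exact ⟨h₁, h₂, h₃₄, h₅₆, hmix x hM α₀ hα ha U hU, h₈⟩); have h36HA' := h36HA_of_dir_pinsR (R := (1 : ℝ)) (H := H) 𝔬A 𝔡A 𝔭A (fun x => (lettersYOfRecordV4P N θ.toStage3Params Mstar 𝔯 x).GA) (fun x => (lettersYOfRecordV4P N θ.toStage3Params Mstar 𝔯 x).parB) h𝔭A hblkA hblkYA hGcoA hDcoA hDscoA h𝔡Ad h𝔡As hY335 h36HA; have h36A4 := h36A_of_dirSq_pinsR (R := (1 : ℝ)) (H := H) 𝔬A 𝔡A hblkA hblkYA hDcoA hDscoA h𝔡Ad h𝔡As hGsqAS h36A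
  obtain ⟨t37', c38', t310', hsum'⟩ := rows131819_definite_geo9Y_pairM_dir₄ (bg := (bg9YR (Matrix (Fin N) (Fin N) ℂ) (specialUnitaryUnits (Fin N)) R₁ R₂)) p q hp hq p3 q3 hp3 hq3 pM qM hpM hqM ((θ.d₆ + 1 : ℕ) : ℝ) (Nat.cast_nonneg _) hc H
    (fun x => RelB x.toKIdx) (2 * (θ.d₆ + 1)) (nbrCountY θ.d₆ θ.ℓ₆ θ.hd' θ.hL' θ.b₀ θ.b₁ 2) (Real.sqrt ((θ.d₆ + 1) * Fintype.card (TrIdx N))) (Real.sqrt_nonneg _) hRlen hRdist hRd₂ hmult (hnbr_two_of_le hM₀) 𝔬 rd 𝔭 𝔡 𝔩 bHX (fun x => kernelFamilyR R₁ R₂ ((opsYNuStOfRecordV4PE N θ.toStage3Params Mstar 𝔯 (sectEStYOfRecordV7 N θ.toStage3Params Mstar 𝔢₀) 𝔴 𝔈) x).Gp) (fun x => evSK x.toKIdx) (fun x => evSK x.toKIdx) κ SH S3 SI (fun x => SblkY x (bI x)) hst hκ hrd hloc (h36_of_dirSq_pinsR (R := (1 : ℝ)) (H := H) 𝔬 𝔡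 hblkS hblkYS hDS hDsS h𝔡d h𝔡s (fun x U j => ⟨_, _, hGsqF x U j⟩) h36) h36H'
    hco0 hco1 hco2 hco3 hgl0 hgl1 hgl2 hgl3 hl0 hl1 hl2 hl3 hl4 hl5 hH1 hIR hsym htr hcntH hcnt3 hNQ hcntI (hcntM_of_walkCnt bI hβ1 (fun x => SblkY x (bI x)) (fun _ => rfl) hMw hNMw) 𝔬A rdA 𝔭A 𝔡A 𝔩A bHXA (fun x => kernelFamilyR R₁ R₂ ((opsYNuStOfRecordV4PE N θ.toStage3Params Mstar 𝔯 (sectEStYOfRecordV7 N θ.toStage3Params Mstar 𝔢₀) 𝔴 𝔈) x).GA) (fun x => evBK x.toKIdx) (fun x => evBK x.toKIdx)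
    κA SHA S3A SIA SMA hstA hκA hrdA hlocA h36A4 h36HA' hcoA0 hcoA1 hcoA2 hcoA3 hglA0 hglA1 hglA2 hglA3 hlA0 hlA1 hlA2 hlA3 hlA4 hlA5 hH1A hIRA hsymA htrA hcntHA hcnt3A hNQ hcntIA hcntMA
  obtain ⟨M31, a31, hM31, ha31, h31⟩ := thm31GpMaj_of_t37_pairMR (trBasis N) (lettersYOfRecordV4P N θ.toStage3Params Mstar 𝔯) 𝔬 rd H hp t37' hbI0 hblkS hblkYS hGpS hDS hDsS
  have hδ39 : 0 < δ39 := hr39.trans_le hrδ39; have hθ49 : 0 < min ((1 - 2 * p.α) * p.δ₀) δ39 / 8 := (by have := lt_min (PinPrims.rate_pos hp) hδ39; positivity); have hrT0 : rT ≤ (1 - 2 * p.α) * p.δ₀ := hrTP.trans (by have h1 := min_le_left ((1 - 2 * p.α) * p.δ₀) δ39; linarith only [h1, hθ49])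
  obtain ⟨M49, a49, hM49, ha49, h49⟩ := proj349Maj_of_t37_display348_rateR_ge θ.toStage3Params Mstar hGR (lettersYOfRecordV4P N θ.toStage3Params Mstar 𝔯) (fun _ => rfl) (fun _ => rfl) (trBasis N) (cR39_trBasis_pos hN) hc hbI0 hlev hβ1 (hnbr_two_of_le hM₀) 𝔬 rd H hp t37' hblkS hblkYS hGpS hDS hB39.le hδ39 ha39 h348 (min ((1 - 2 * p.α) * p.δ₀) δ39 / 8) (cg349 θ.d₆ θ.ℓ₆ θ.hd' θ.hL' θ.b₀ θ.b₁ ((1 - 2 * p.α) * p.δ₀) δ39) (thrM349 θ.d₆ θ.ℓ₆ θ.hd' θ.hL' θ.b₀ θ.b₁ ((1 - 2 * p.α) * p.δ₀) δ39) hθ49.le (cg349_pos _ _).le (fun i hM parS Gp U B₀ B₁' hB₀ hB₁' => fineEntryS_le_named (PinPrims.rate_pos hp) hδ39 i hM parS Gp U hB₀ hB₁') CP hCPge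
  have hCP : 0 ≤ CP := (cP349_nonneg θ.toStage3Params Mstar (trBasis N) (nbrCountY θ.d₆ θ.ℓ₆ θ.hd' θ.hL' θ.b₀ θ.b₁ 2) hp hB39.le δ39 (min ((1 - 2 * p.α) * p.δ₀) δ39 / 8) (cg349_pos _ _).le).trans hCPge
  have hδTr2 : δT12 + 2 * σS + 3 * (q.αF * ((1 - 2 * q.α) * q.δ₀)) ≤ rT := (by linarith only [hδTr, hσS]); set M46c : ℝ := M46 θ.d₆ θ.ℓ₆ θ.hd' θ.hL' θ.b₀ θ.b₁ Mstar N c hc with hM46cdef; set a46c : ℝ := a46 θ.d₆ θ.ℓ₆ θ.hd' θ.hL' θ.b₀ θ.b₁ Mstar N c hc with ha46cdef; set B₄ : ℝ := B46 θ.d₆ θ.ℓ₆ θ.hd' θ.hL' θ.b₀ θ.b₁ Mstar N c hc with hB₄def; set δ₄ : ℝ := δ46 θ.d₆ θ.ℓ₆ θ.hd' θ.hL' θ.b₀ θ.b₁ Mstar N c hc with hδ₄def; have hM46c : 0 < M46c := M46_pos θ.d₆ θ.ℓ₆ θ.hd' θ.hL' θ.b₀ θ.b₁ Mstar N c hc;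 have ha46c : 0 < a46c := a46_pos θ.d₆ θ.ℓ₆ θ.hd' θ.hL' θ.b₀ θ.b₁ Mstar N c hc; have hB₄ : 0 ≤ B₄ := (B46_pos θ.d₆ θ.ℓ₆ θ.hd' θ.hL' θ.b₀ θ.b₁ Mstar N c hc).le; have h46 : ∀ x : MemberY θ.d₆ θ.ℓ₆ θ.hd' θ.hL' θ.b₀ θ.b₁ Mstar, max M12 M46c ≤ (geo9Y x).M → ∀ α₀ : ℝ, 0 < α₀ → (geo9Y x).M * α₀ ≤ min a12 a46c → ∀ U : (𝔅 x).Cfg, (𝔅 x).Reg335 c α₀ U → B9SectDL2Decay.BlockBd (g := toB6 (geo9Y x) 1 (H x)) (𝔬12 x).blk (𝔬12 x).blk (DvcoKH x.toKIdx (trBasis N) (𝔅 x) (fun U => U) U ∘ₗ GcoS x.toKIdx (trBasis N) (𝔅 x) (fun U => U) (GpY x.toKIdx (parSymY x.toKIdx)) U ∘ₗ DvscoKH x.toKIdx (trBasis N) (𝔅 x) (fun U => U) U) (fun (y y' : (geo9Y x).Site) => B₄ * Real.exp (-(δ₄ * (geo9Y x).dist y y'))) := fun x hM α₀ hα ha U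 hU => by rw [hblk12 x]; exact blockBd_DvGcoSDvs_memberY_at θ.d₆ θ.ℓ₆ θ.hd' θ.hL' θ.b₀ θ.b₁ Mstar N c hc B7Prop2SpecialUnitary.specialUnitaryUnits_le_unitaryUnits x ((le_max_right _ _).trans hM) α₀ hα (ha.trans (min_le_right _ _)) U (hY335 x α₀ U hU) (hlev x) (hβ1 x) 1 (H x)
  set tT : ℝ := max t12 (2 * const3131 (cR39 (trBasis N))⁻¹ (((θ.d₆ + 1 : ℕ) : ℝ) * p.C (B9RWSums347DefiniteFaces.exp261 (@geo9Y θ.d₆ θ.ℓ₆ θ.hd' θ.hL' θ.b₀ θ.b₁ Mstar) p.δ₀ p.α)) CP (rowConst261 (@geo9Y θ.d₆ θ.ℓ₆ θ.hd' θ.hL' θ.b₀ θ.b₁ Mstar) σS) ((θ.ℓ₆ + 1 : ℕ) : ℝ) * tJ) with htTdef; have ht12c : 2 * const3131 (cR39 (trBasis N))⁻¹ (((θ.d₆ + 1 : ℕ) : ℝ) * p.C (B9RWSums347DefiniteFaces.exp261 (@geo9Y θ.d₆ θ.ℓ₆ θ.hd' θ.hL' θ.b₀ θ.b₁ Mstar)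 p.δ₀ p.α)) CP (rowConst261 (@geo9Y θ.d₆ θ.ℓ₆ θ.hd' θ.hL' θ.b₀ θ.b₁ Mstar) σS) ((θ.ℓ₆ + 1 : ℕ) : ℝ) * tJ ≤ tT := le_max_right _ _; have ht12T : 0 ≤ tT := ht12.trans (le_max_left _ _)
  have h31m := fun (x : MemberY θ.d₆ θ.ℓ₆ θ.hd' θ.hL' θ.b₀ θ.b₁ Mstar) (hM : max M12 (max M31 M49) ≤ (geo9Y x).M) (α₀ : ℝ) (hα : 0 < α₀) (ha : (geo9Y x).M * α₀ ≤ min a12 (min a31 a49)) (U : (𝔅 x).Cfg) (hU : (𝔅 x).Reg335 c α₀ U) => h31 x (((le_max_left _ _).trans (le_max_right _ _)).trans hM) α₀ hα (ha.trans ((min_le_right _ _).trans (min_le_left _ _))) U hU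
  have h49m := fun (x : MemberY θ.d₆ θ.ℓ₆ θ.hd' θ.hL' θ.b₀ θ.b₁ Mstar) (hM : max M12 (max M31 M49) ≤ (geo9Y x).M) (α₀ : ℝ) (hα : 0 < α₀) (ha : (geo9Y x).M * α₀ ≤ min a12 (min a31 a49)) (U : (𝔅 x).Cfg) (hU : (𝔅 x).Reg335 c α₀ U) => h49 x (((le_max_right _ _).trans (le_max_right _ _)).trans hM) α₀ hα (ha.trans ((min_le_right _ _).trans (min_le_right _ _))) U hU
  have h43m := fun (x : MemberY θ.d₆ θ.ℓ₆ θ.hd' θ.hL' θ.b₀ θ.b₁ Mstar) (hM : max M12 (max M31 M49) ≤ (geo9Y x).M) (α₀ : ℝ) (hα : 0 < α₀) (ha : (geo9Y x).M * α₀ ≤ min a12 (min a31 a49)) (U : (𝔅 x).Cfg) (hU : (𝔅 x).Reg335 c α₀ U) (hU' : (𝔅 x).Reg336 c α₀ U) => h43Gp x ((le_max_left _ _).trans hM) α₀ hα (ha.trans (min_le_left _ _)) U hU hU'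
  obtain ⟨MLT, hT4⟩ := split_majorants_of_letter_schemasR (N := N) c q hq H 𝔬12 (((θ.d₆ + 1 : ℕ) : ℝ) * p.C (B9RWSums347DefiniteFaces.exp261 (@geo9Y θ.d₆ θ.ℓ₆ θ.hd' θ.hL' θ.b₀ θ.b₁ Mstar) p.δ₀ p.α)) ((1 - 2 * p.α) * p.δ₀) CP (min ((1 - 2 * p.α) * p.δ₀) δ39 / 8) tJ δB rT δT12 σS tT (max (max (max M12 M46c) M31) M49) (min (min (min a12 a46c) a31) a49)
    (mul_nonneg (Nat.cast_nonneg _) (PinPrims.C_nonneg hp _)) hCP htJ0 hσS (lt_max_of_lt_left (lt_max_of_lt_left (lt_max_of_lt_left hM12))) hrT0 hrTP hrTB hδT12 hδTr2 ht12c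
    (fun x hM α₀ hα ha U hU _ => by rw [hblkW12 x, hblk12 x]; exact h31 x ((le_max_right _ _).trans ((le_max_left _ _).trans hM)) α₀ hα (ha.trans ((min_le_left _ _).trans (min_le_right _ _))) U hU)
    (fun x hM α₀ hα ha U hU _ => by rw [hblkW12 x, hblk12 x]; exact h49 x ((le_max_right _ _).trans hM) α₀ hα (ha.trans (min_le_right _ _)) U hU) (fun x hM α₀ hα ha U hU hU' => hBJ x ((le_max_left _ _).trans ((le_max_left _ _).trans ((le_max_left _ _).trans hM))) α₀ hα (ha.trans (((min_le_left _ _).trans (min_le_left _ _)).trans (min_le_left _ _))) U hU hU')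
  obtain ⟨ML2, hS2⟩ := stepL2_of_letter_schemas_residualR (N := N) q hq H R₁ R₂ hGR c (fun x => ops312RY (𝔬12 x)) (fun x => (𝔯 x).Δ2) (((θ.d₆ + 1 : ℕ) : ℝ) * p.C (B9RWSums347DefiniteFaces.exp261 (@geo9Y θ.d₆ θ.ℓ₆ θ.hd' θ.hL' θ.b₀ θ.b₁ Mstar) p.δ₀ p.α)) ((1 - 2 * p.α) * p.δ₀) CP (min ((1 - 2 * p.α) * p.δ₀) δ39 / 8) tJ δB B₄ δ₄ rT δT12 σS (constL2 (cR39 (trBasis N))⁻¹ (((θ.d₆ + 1 : ℕ) : ℝ) * p.C (B9RWSums347DefiniteFaces.exp261 (@geo9Y θ.d₆ θ.ℓ₆ θ.hd' θ.hL' θ.b₀ θ.b₁ Mstar) p.δ₀ p.α)) CP B₄ (rowConst261 (@geo9Y θ.d₆ θ.ℓ₆ θ.hd' θ.hL' θ.b₀ θ.b₁ Mstar) σS) ((θ.ℓ₆ + 1 : ℕ) : ℝ) * tJ) θ₂ δ₂ (θ₂ * constL2Pi (cR39 (trBasis N))⁻¹ (((θ.d₆ + 1 : ℕ) : ℝ)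 * p.C (B9RWSums347DefiniteFaces.exp261 (@geo9Y θ.d₆ θ.ℓ₆ θ.hd' θ.hL' θ.b₀ θ.b₁ Mstar) p.δ₀ p.α)) CP B₄ (rowConst261 (@geo9Y θ.d₆ θ.ℓ₆ θ.hd' θ.hL' θ.b₀ θ.b₁ Mstar) σS) ((θ.ℓ₆ + 1 : ℕ) : ℝ)) (max (max (max M12 M46c) M31) M49) (min (min (min a12 a46c) a31) a49) (mul_nonneg (Nat.cast_nonneg _) (PinPrims.C_nonneg hp _)) hCP htJ0 hB₄ hθ₂ hσS (lt_max_of_lt_left (lt_max_of_lt_left (lt_max_of_lt_left hM12))) hrT0 hrTP hrTB hrT4 hrT2 hδT12 hδTr le_rfl le_rfl hTpico12 hT2co12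
    (fun x hM α₀ hα ha U hU _ => by rw [show (ops312RY (𝔬12 x)).blkW = _ from hblkW12 x, show (ops312RY (𝔬12 x)).blk = _ from hblk12 x]; exact h31 x ((le_max_right _ _).trans ((le_max_left _ _).trans hM)) α₀ hα (ha.trans ((min_le_left _ _).trans (min_le_right _ _))) U hU) (fun x hM α₀ hα ha U hU _ => h46 x ((le_max_left _ _).trans ((le_max_left _ _).trans hM)) α₀ hα (ha.trans ((min_le_left _ _).trans (min_le_left _ _))) U hU)
    (fun x hM α₀ hα ha U hU _ => by rw [show (ops312RY (𝔬12 x)).blkW = _ from hblkW12 x, show (ops312RY (𝔬12 x)).blk = _ from hblk12 x]; exact h49 x ((le_max_right _ _).trans hM) α₀ hα (ha.trans (min_le_right _ _)) U hU) (fun x hM α₀ hα ha U hU hU' => hBJ x ((le_max_left _ _).trans ((le_max_left _ _).trans ((le_max_left _ _).trans hM))) α₀ hα (ha.trans (((min_le_left _ _).trans (min_le_left _ _)).trans (min_le_left _ _))) U hU hU') (fun x hM α₀ hα ha U hU hU' => B9PerturbationL2Delta2.blockBd_d2coK_of_sup_symm x.toKIdx _ _ _ (hgeoOK x) (mul_nonneg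 hθ₂ (mul_nonneg (B9GeoLemma21KLevelV1.geo9K_M_nonneg x.toKIdx) hα.le)) (hD2sup x ((le_max_left _ _).trans ((le_max_left _ _).trans ((le_max_left _ _).trans hM))) α₀ hα (ha.trans (((min_le_left _ _).trans (min_le_left _ _)).trans (min_le_left _ _))) U hU hU') (hΔ2 x U (mem_of_reg335R hGR x hU)))
  set θ2S : ℝ := constL2 (cR39 (trBasis N))⁻¹ (((θ.d₆ + 1 : ℕ) : ℝ) * p.C (B9RWSums347DefiniteFaces.exp261 (@geo9Y θ.d₆ θ.ℓ₆ θ.hd' θ.hL' θ.b₀ θ.b₁ Mstar) p.δ₀ p.α)) CP B₄ (rowConst261 (@geo9Y θ.d₆ θ.ℓ₆ θ.hd' θ.hL' θ.b₀ θ.b₁ Mstar) σS) ((θ.ℓ₆ + 1 : ℕ) : ℝ) * tJ + θ₂ * constL2Pi (cR39 (trBasis N))⁻¹ (((θ.d₆ + 1 : ℕ) : ℝ) * p.C (B9RWSums347DefiniteFaces.exp261 (@geo9Y θ.d₆ θ.ℓ₆ θ.hd' θ.hL' θ.b₀ θ.b₁ Mstar) p.δ₀ p.α)) CP B₄ (rowConst261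 (@geo9Y θ.d₆ θ.ℓ₆ θ.hd' θ.hL' θ.b₀ θ.b₁ Mstar) σS) ((θ.ℓ₆ + 1 : ℕ) : ℝ) with hθ2Sdef; have hθ2S : 0 ≤ θ2S := add_nonneg (mul_nonneg (constL2_nonneg (inv_nonneg.2 (cR39_trBasis_pos hN).le) (mul_nonneg (Nat.cast_nonneg _) (PinPrims.C_nonneg hp _)) hCP hB₄ (B9RowSum261DefiniteFaces.rowConst261_nonneg _ _) (Nat.cast_nonneg _)) htJ0) (mul_nonneg hθ₂ (constL2Pi_nonneg _ _ _ _ _ _))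
  obtain ⟨MW, hW⟩ := hWE_of_pinsP_geo9Y_budget (N := N) H bI hlev hβ1 hbI0 c (M₀ := max M12 M49) (a₀ := min a12 a49) hαW0 hαW1 hσW hδFW wX hwX₀ hwX₁ sch hsch0 hsch1 hwschX bXH hbXH 𝔬12 hblk12 hblkW12 hDvco12 hDvsco12 hRco12 𝔭A hCP hδFP (fun _ => rfl) (fun _ => rfl) (fun x hM α₀ hα ha U hU => h49 x ((le_max_right _ _).trans hM) α₀ hα (ha.trans (min_le_right _ _)) U hU) (δ45 := δ45W) (δh := δhW) (δ₃ := δ12₃) hB45W hBhW hbudW hδ45W hδhW hδ3W hBxW (fun x hM α₀ hα ha U hU hU' => hp45W x ((le_max_left _ _).trans hM) α₀ hα (ha.trans (min_le_left _ _)) U hU hU') (fun x hM α₀ hα ha U hU hU' => hpDGW x ((le_max_left _ _).trans hM) α₀ hα (ha.trans (min_le_left _ _)) U hU hU')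
  have hδFWr : δFW ≤ (1 - 2 * p.α) * p.δ₀ := hδFP.trans (by have h1 := min_le_left ((1 - 2 * p.α) * p.δ₀) δ39; linarith only [h1, hθ49])
  obtain ⟨M13, h13⟩ := hwGp_of_pinsP_geo9Y (N := N) H bI hlev hβ1 hbI0 c (M₀ := max M12 (max M31 M49)) (a₀ := min a12 (min a31 a49)) hαW0 hαW1 hσW hδFW wX hwX₀ hwX₁ hs440 hs441 hwX44 bXH hbXH 𝔬12 hblk12 hblkW12 hDvco12 hDvsco12 hRco12 (B₃ := B12₃) (δ₃ := δ12₃) (mul_nonneg (Nat.cast_nonneg _) (p.C_nonneg hp _)) hCP hB44G hδFWr hδFP hbudW hδ44G hB₃wG hδ3W (fun _ => rfl) (fun _ => rfl)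
    h31m
    h49m
    (fun x hM α₀ hα ha U hU hU' => h44G x ((le_max_left _ _).trans hM) α₀ hα (ha.trans (min_le_left _ _)) U hU hU')
  obtain ⟨Mrg, hrg⟩ := hrgdH_of_pinsP43_geo9Y (N := N) H bI hlev hβ1 hGR c (M₀ := max M12 (max M31 M49)) (a₀ := min a12 (min a31 a49)) hαW0 hαW1 hσW hδFW w13 hw13₀ hw13₁ bH13 hbH13 𝔬12 hblk12 hblkW12 hDvsco12 hRco12
    (mul_nonneg (Nat.cast_nonneg _) (p.C_nonneg hp _)) hCP hB43 hδFWr hδFP hρrg0 hbudrg hbud43 hB₃rg hδ₃rg (fun _ => rfl) (fun _ => rfl)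
    h31m
    h49m
    h43m
  obtain ⟨CA3, hCA3, hCA30⟩ : ∃ CA3 : ℝ, B9PerturbationMajorantAlgebra.constA (cR39 (trBasis N))⁻¹ (((θ.d₆ + 1 : ℕ) : ℝ) * p.C (B9RWSums347DefiniteFaces.exp261 (@geo9Y θ.d₆ θ.ℓ₆ θ.hd' θ.hL' θ.b₀ θ.b₁ Mstar) p.δ₀ p.α)) CP (rowConst261 (@geo9Y θ.d₆ θ.ℓ₆ θ.hd' θ.hL' θ.b₀ θ.b₁ Mstar) σW) (((θ.ℓ₆ + 1 : ℕ) : ℝ)) ≤ CA3 ∧ 0 ≤ CA3 := ⟨max (B9PerturbationMajorantAlgebra.constA (cR39 (trBasis N))⁻¹ (((θ.d₆ + 1 : ℕ) : ℝ) * p.C (B9RWSums347DefiniteFaces.exp261 (@geo9Y θ.d₆ θ.ℓ₆ θ.hd' θ.hL' θ.b₀ θ.b₁ Mstar) p.δ₀ p.α)) CP (rowConst261 (@geo9Y θ.d₆ θ.ℓ₆ θ.hd' θ.hL' θ.b₀ θ.b₁ Mstar) σW) (((θ.ℓ₆ + 1 : ℕ) : ℝ))) 0, le_max_left _ _, le_max_right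 _ _⟩
  obtain ⟨Mr2, hr2⟩ := hrgd2_of_pinsP_geo9Y (N := N) H bI c (M₀ := max M12 (max M31 M49)) (a₀ := min a12 (min a31 a49)) hαW0 hαW1 hσW hδFW 𝔬12 hblk12 hblkW12 hDvco12 hDvsco12 hRco12 (B₃ := CA3) (δ₃ := δ12₃) (mul_nonneg (Nat.cast_nonneg _) (p.C_nonneg hp _)) hCP hδFWr hδFP hbudW hCA3 hδ3W (fun _ => rfl) (fun _ => rfl)
    h31m
    h49m
  set M12T : ℝ := max (max (max (max (max (max (max (max (max (max (max (max (max M12 M46c) M31) M49) ML2) MLT) MR) MXd) MDg) MYd) MW) M13) Mrg) M12 with hM12Tdef; set a12T : ℝ := min (min (min (min a12 a46c) a31) a49) (q.a₁ / c) with ha12Tdef; have hM12T : M12 ≤ M12T := ((((((le_max_left M12 M46c).trans (le_max_left _ M31)).trans (le_max_left _ M49)).trans (le_max_left _ ML2)).trans (le_max_left _ MLT)).trans (le_max_left _ MR)).trans ((le_max_left _ MXd).trans ((le_max_left _ MDg).trans ((le_max_left _ MYd).trans ((le_max_left _ MW).trans ((le_max_left _ M13).trans ((le_max_left _ Mrg).trans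 (le_max_left _ M12))))))); have hMXT : MXd ≤ M12T := (le_max_right _ MXd).trans ((le_max_left _ MDg).trans ((le_max_left _ MYd).trans ((le_max_left _ MW).trans ((le_max_left _ M13).trans ((le_max_left _ Mrg).trans (le_max_left _ M12)))))); have hMDgT : MDg ≤ M12T := (le_max_right _ MDg).trans ((le_max_left _ MYd).trans ((le_max_left _ MW).trans ((le_max_left _ M13).trans ((le_max_left _ Mrg).trans (le_max_left _ M12))))); have hMYT : MYd ≤ M12T := (le_max_right _ MYd).trans ((le_max_left _ MW).trans ((le_max_left _ M13).trans ((le_max_left _ Mrg).trans (le_max_left _ M12)))); have hMWT : MW ≤ M12T := (le_max_right _ MW).trans ((le_max_left _ M13).trans ((le_max_left _ Mrg).trans (le_max_left _ M12))); have hM13T : M13 ≤ M12T := (le_max_right _ M13).trans ((le_max_left _ Mrg).trans (le_max_left _ M12)); have hMrgT : Mrg ≤ M12T := (le_max_right _ Mrg).trans (le_max_left _ M12); have ha12T : a12T ≤ a12 := (((min_le_left _ _).trans (min_le_left _ _)).trans (min_le_left _ _)).trans (min_le_left _ _); have hM12RT : max M12 MR ≤ M12T := max_le hM12T (((((le_max_right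 _ MR).trans (le_max_left _ MXd)).trans (le_max_left _ MDg)).trans (le_max_left _ MYd)).trans ((le_max_left _ MW).trans ((le_max_left _ M13).trans ((le_max_left _ Mrg).trans (le_max_left _ M12))))); have hM12T0 : max (max (max (max (max M12 M46c) M31) M49) ML2) MLT ≤ M12T := ((((le_max_left _ MR).trans (le_max_left _ MXd)).trans (le_max_left _ MDg)).trans (le_max_left _ MYd)).trans ((le_max_left _ MW).trans ((le_max_left _ M13).trans ((le_max_left _ Mrg).trans (le_max_left _ M12)))); have ha12T0 : a12T ≤ min (min (min a12 a46c) a31) a49 := min_le_left _ _; have ha12RT : a12T ≤ min a12 (q.a₁ / c) := le_min ha12T (min_le_right _ _); have hM12Tpos : 0 < M12T := lt_of_lt_of_le hM12 hM12T; have ha12Tpos : 0 < a12T := lt_min (lt_min (lt_min (lt_min ha12 ha46c) ha31) ha49) hac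
  have hWE : ∀ x : MemberY θ.d₆ θ.ℓ₆ θ.hd' θ.hL' θ.b₀ θ.b₁ Mstar, M12T ≤ (geo9Y x).M → ∀ α₀ : ℝ, 0 < α₀ → (geo9Y x).M * α₀ ≤ min a12 a49 → ∀ U : (𝔅 x).Cfg, (𝔅 x).Reg335 c α₀ U → (𝔅 x).Reg336 c α₀ U → ∀ β : ℝ, 0 ≤ β → β < 1 → HasMaj (bXH x U) (cNormR 1 (H x) (𝔭A x).blkPX (fun y => (geo9Y_len_pos x y).le) (β - 1)) ((𝔭A x).ΦX U β ∘ₗ ((𝔬12 x).Dv U ∘ₗ GcoS x.toKIdx (trBasis N) (𝔅 x) (fun U => U) (GpY x.toKIdx (parSymY x.toKIdx)) U ∘ₗ (𝔬12 x).R U ∘ₗ (𝔬12 x).Dvstar U)) (fun a b => Bx13 β * Real.exp (-(δ12₃ * (geo9Y x).dist a b))) := fun x hM α₀ hα ha U hU hU' β h0 h1 => hW x (hMWT.trans hM) α₀ hα ha U hU hU' β h0 h1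
  have hLH3 : ∀ x : MemberY θ.d₆ θ.ℓ₆ θ.hd' θ.hL' θ.b₀ θ.b₁ Mstar, M12T ≤ (geo9Y x).M → ∀ α₀ : ℝ, 0 < α₀ → (geo9Y x).M * α₀ ≤ a12 → ∀ U : (𝔅 x).Cfg, (𝔅 x).Reg335 c α₀ U → (𝔅 x).Reg336 c α₀ U → Letters313HZ (𝔬12 x) (𝔭A x) 1 (H x) ⟨geo9Y_dist_triangle x, geo9Y_dist_comm x, geo9K_dist_nonneg x.toKIdx, geo9Y_len_pos x⟩ (fun y => ((((θ.ℓ₆ + 1 : ℕ) : ℝ) ^ (θ.d₆ + 1)) ^ lvl x.hN x.D x.hk y)⁻¹) (fun y => plateau_pos x.toKIdx y) (bH13 x U) BhD13 Bx13 δ12₃ U := fun x hM α₀ hα ha U hU hU' => ⟨fun β h0 h1 => hYd x (hMYT.trans hM) α₀ hα ha U hU hU' β h0 h1, hpXDv x (hM12T.trans hM) α₀ hα ha U hU hU', hpXQs x (hM12T.trans hM) α₀ hα ha U hU hU'⟩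
  have hDMZ : ∀ x : MemberY θ.d₆ θ.ℓ₆ θ.hd' θ.hL' θ.b₀ θ.b₁ Mstar, M12T ≤ (geo9Y x).M → ∀ α₀ : ℝ, 0 < α₀ → (geo9Y x).M * α₀ ≤ a12 → ∀ U : (𝔅 x).Cfg, (𝔅 x).Reg335 c α₀ U → (𝔅 x).Reg336 c α₀ U → Letters313DMZ (𝔬12 x) (𝔭A x) (𝔡A x).Dd 1 (H x) ⟨geo9Y_dist_triangle x, geo9Y_dist_comm x, geo9K_dist_nonneg x.toKIdx, geo9Y_len_pos x⟩ (fun y => ((((θ.ℓ₆ + 1 : ℕ) : ℝ) ^ (θ.d₆ + 1)) ^ lvl x.hN x.D x.hk y)⁻¹) (fun y => plateau_pos x.toKIdx y) B12₃ Bq12 δ12₃ (bH13 x U) U := fun x hM α₀ hα ha U hU hU' => ⟨hdgQsd x (hM12T.trans hM) α₀ hα ha U hU hU', (hDg x (hMDgT.trans hM) α₀ hα ha U hU hU').1, hpQd x (hM12T.trans hM) α₀ hα ha U hU hU'⟩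
  have hM31T : M31 ≤ M12T := (le_max_right _ _).trans ((le_max_left _ _).trans ((le_max_left _ _).trans ((le_max_left _ _).trans hM12T0))); have hM49T : M49 ≤ M12T := (le_max_right _ _).trans ((le_max_left _ _).trans ((le_max_left _ _).trans hM12T0)); have hM46T : M46c ≤ M12T := (le_max_right _ _).trans ((le_max_left _ _).trans ((le_max_left _ _).trans ((le_max_left _ _).trans ((le_max_left _ _).trans hM12T0)))); have ha46T : a12T ≤ a46c := (min_le_left _ _).trans ((min_le_left _ _).trans ((min_le_left _ _).trans (min_le_right _ _))); have ha31T : a12T ≤ a31 := (min_le_left _ _).trans ((min_le_left _ _).trans (min_le_right _ _)); have ha49T : a12T ≤ a49 := (min_le_left _ _).trans (min_le_right _ _); have hαFδq : 0 ≤ q.αF * ((1 - 2 * q.α) * q.δ₀) := mul_nonneg hq.αF_pos.le (mul_nonneg (by linarith only [hq.α_lt]) hq.δ₀_pos.le)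
  have hta := fun (x : MemberY θ.d₆ θ.ℓ₆ θ.hd' θ.hL' θ.b₀ θ.b₁ Mstar) (hM : M12T ≤ (geo9Y x).M) (α₀ : ℝ) (hα : 0 < α₀) (ha : (geo9Y x).M * α₀ ≤ a12T) (U : (𝔅 x).Cfg) (hU : (𝔅 x).Reg335 c α₀ U) (hU' : (𝔅 x).Reg336 c α₀ U) => (hT4 x ((le_max_right (max (max (max (max M12 M46c) M31) M49) ML2) MLT).trans (hM12T0.trans hM)) ((le_max_left (max (max (max M12 M46c) M31) M49) ML2).trans ((le_max_left (max (max (max (max M12 M46c) M31) M49) ML2) MLT).trans (hM12T0.trans hM))) α₀ hα (ha.trans ha12T0) U hU hU').1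
  have hKT : δK12 ≤ δT12 := (by have hτ : 0 ≤ q.αF * ((1 - 2 * q.α) * q.δ₀) := mul_nonneg hq.αF_pos.le (mul_nonneg (by linarith only [hq.α_lt]) hq.δ₀_pos.le); linarith only [hδKS, hρST, hτ]); have hstepL2 : ∀ x : MemberY θ.d₆ θ.ℓ₆ θ.hd' θ.hL' θ.b₀ θ.b₁ Mstar, M12T ≤ (geo9Y x).M → ∀ α₀ : ℝ, 0 < α₀ → (geo9Y x).M * α₀ ≤ a12T → ∀ U : (𝔅 x).Cfg, (𝔅 x).Reg335 c α₀ U → (𝔅 x).Reg336 c α₀ U → StepL2 (𝔬12 x) 1 (H x) (θ2S * ((geo9Y x).M * α₀)) δK12 U := fun x hM α₀ hα ha U hU hU' =>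
    (fun (h : StepL2 (ops312RY (𝔬12 x)) 1 (H x) (θ2S * ((geo9Y x).M * α₀)) δT12 U) (hk : ∀ y y' : (geo9Y x).Site, θ2S * ((geo9Y x).M * α₀) * ((geo9Y x).len y)⁻¹ * ((geo9Y x).len y')⁻¹ * Real.exp (-(δT12 * (geo9Y x).dist y y')) ≤ θ2S * ((geo9Y x).M * α₀) * ((geo9Y x).len y)⁻¹ * ((geo9Y x).len y')⁻¹ * Real.exp (-(δK12 * (geo9Y x).dist y y'))) => (⟨h.t.mono hk, h.t1.mono hk⟩ : StepL2 (𝔬12 x) 1 (H x) (θ2S * ((geo9Y x).M * α₀)) δK12 U)) (hS2 x ((le_max_right (max (max (max M12 M46c) M31) M49) ML2).trans ((le_max_left (max (max (max (max M12 M46c) M31) M49) ML2) MLT).trans (hM12T0.trans hM))) ((le_max_left (max (max (max M12 M46c) M31) M49) ML2).trans ((le_max_left (max (max (max (max M12 M46c) M31) M49) ML2) MLT).trans (hM12T0.trans hM))) α₀ hα (ha.trans ha12T0) U hU hU') (fun y y' => mul_le_mul_of_nonneg_left (Real.exp_le_exp.2 (neg_le_neg (mul_le_mul_of_nonneg_right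 hKT (geo9K_dist_nonneg x.toKIdx y y')))) (mul_nonneg (mul_nonneg (mul_nonneg hθ2S (mul_nonneg (hM12Tpos.le.trans hM) hα.le)) (inv_nonneg.2 (geo9Y_len_pos x y).le)) (inv_nonneg.2 (geo9Y_len_pos x y').le)))
  obtain ⟨B12₀, Bh12, Bi12, Bi2₁₂, B12₂, r12, M₀, a₀, hB12₀, hBh12, hBi12, hBi2₁₂, hB12₂, hr12, hM₀g, ha₀g, hMM, haa, hmodel12, he1G, hG0C⟩ := g0_layer_of_thm310_coreDir₃US (bg := (bg9YR (Matrix (Fin N) (Fin N) ℂ) (specialUnitaryUnits (Fin N)) R₁ R₂)) hc q hq q3 hq3 qM hqM H 𝔬A 𝔭A 𝔡A 𝔩A bHXA κA SHA S3A SIA SMA S2A hstA hκA h36A4 h36HA' h36A2 hcntHA hcnt3A hcntIA hcntMA hcnt2A hsymA htrA 𝔬12 (fun x => (hblk12 x).trans (hblkA x).symm) (fun x => (hblkY12 x).trans (hblkYA x).symm) (fun x U => (hG0co12 x U).trans (hGcoA x U).symm) (fun x U => (hDco12 x U).trans (hDcoA x U).symm) (fun x U => (hDsco12 x U).trans (hDscoA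 x U).symm) θ2S δ12₀ δK12 a12T M12T ρS σS ha12Tpos hM12Tpos hθ2S hδ12₀ hσS hρS hρS₀ hσSK (fun x hM α₀ hα ha U hU hU' => hpos12 x (hM12RT.trans hM) α₀ hα (ha.trans ha12RT) U hU hU') (fun x hM α₀ hα ha U hU hU' => hinv12 x (hM12RT.trans hM) α₀ hα (ha.trans ha12RT) U hU hU') (fun x hM α₀ hα ha U hU hU' => hIdOfForm x (hM12RT.trans hM) α₀ hα (ha.trans ha12RT) U hU hU') hstepL2
  set aZ : ℝ := min a₀ (1 / (2 * r12 + 2)) with haZdef; have haZ0 : aZ ≤ a₀ := min_le_left _ _; have haZg : 0 < aZ := lt_min ha₀g (by positivity); have haaZ : aZ ≤ a12T := haZ0.trans haa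
  have hids : ∀ x : MemberY θ.d₆ θ.ℓ₆ θ.hd' θ.hL' θ.b₀ θ.b₁ Mstar, M₀ ≤ (geo9Y x).M → ∀ α₀ : ℝ, 0 < α₀ → (geo9Y x).M * α₀ ≤ aZ → ∀ U : (𝔅 x).Cfg, (𝔅 x).Reg335 c α₀ U → (𝔅 x).Reg336 c α₀ U → Ids3124 (𝔬12 x) U ∧ Ids3152 (𝔬12 x) (fun U => GcoS x.toKIdx (trBasis N) (𝔅 x) (fun U => U) (GpY x.toKIdx (parSymY x.toKIdx)) U) U := fun x hM α₀ hα ha U hU hU' => by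
    have hr1 : r12 * ((geo9Y x).M * α₀) < 1 := by
      have h2 : 0 < 2 * r12 + 2 := by positivity
      calc r12 * ((geo9Y x).M * α₀) ≤ r12 * (1 / (2 * r12 + 2)) := mul_le_mul_of_nonneg_left (ha.trans (min_le_right _ _)) hr12
        _ < 1 := by rw [mul_one_div, div_lt_one h2]; linarith
    exact ids3124_ids3152_of_hZ_pins x.toKIdx (𝔅 x) (fun U => U) (𝔯 x).Δ2 (𝔬12 x) U hN specialUnitaryUnits_le_unitaryUnits (mem_of_reg335R hGR x hU) (cf_mul_etaS_of_hcfk x.toKIdx x.hcfk) (isUnit_deltaOneY_of_formSmall_phys x.toKIdx (𝔅 x) (fun U => U) (𝔯 x).Δ2 (𝔬12 x) U hN (hmodel12 x hM α₀ hα (ha.trans haZ0) U hU hU').2.1 hr1 (hS0co12 x U) (hTpico12 x U) (hT2co12 x U)) (hG1co12 x U) (hQco12 x U) (hQsco12 x U) (hDvco12 x U) (hDvsco12 x U) (hRco12 x U) (hZ x (hM12T.trans (hMM.trans hM)) α₀ hα ((ha.trans haaZ).trans ha12T) U hU hU')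
  obtain ⟨Mc, B4c, -, hB4c, hcut⟩ := vDRDG_vGDRD_of_pinsR (N := N) hGR H bI 𝔬12 hblk12 hblkW12 hDvco12 hDvsco12 hRco12 q hq hc B13₄ (mul_nonneg (Nat.cast_nonneg _) (p.C_nonneg hp _)) hCP hσS (by linarith only [hδTr, hδT12, hαFδq, hσS]) hrT0 hrTP hrT4 hδ₃T (fun x hM α₀ hα ha U hU => h31 x (hM31T.trans (hMM.trans hM)) α₀ hα ((ha.trans haaZ).trans ha31T) U hU) (fun x hM α₀ hα ha U hU => h49 x (hM49T.trans (hMM.trans hM)) α₀ hα ((ha.trans haaZ).trans ha49T) U hU) (fun x hM α₀ hα ha U hU => h46 x (max_le (hM12T.trans (hMM.trans hM)) (hM46T.trans (hMM.trans hM))) α₀ hα (le_min ((ha.trans haaZ).trans ha12T) ((ha.trans haaZ).trans ha46T)) U hU) (fun x hM α₀ hα ha U hU hU' => (hids x hM α₀ hα ha U hU hU').2)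
  have hδ12₀0 : 0 ≤ δ12₀ := (by linarith only [hρS, hσS, hρS₀])
  obtain ⟨MD, BiD, hBiD, hdivDs⟩ := hdivDs_of_pinsR (N := N) H bI hβ1 𝔭A (fun x => (𝔡A x).Dd) (fun x => (𝔡A x).Dsd) h𝔡Ad bHXA hbHXA 𝔬12 hblk12 hblkW12 hDvsco12 hBi12 hδ12₀0 hY335 (fun x hM α₀ hα ha U hU hU' => (hG0C x hM α₀ hα ha U hU hU').1)
  have hδ12₃0 : 0 ≤ δ12₃ := (by linarith only [hρ₃12, hρ12, hσ12]); obtain ⟨MQ, BQ, hBQ, hLHHQ, hDMQ⟩ := hLHH_of_pinsRU (N := N) H bI hβ1 𝔭A (fun x => (𝔡A x).Dd) (fun x => (𝔡A x).Dsd) bHXA 𝔬12 hblk12 hblkZ12 hQsco12 bH13 Bq12 hBq12 hB12₃ hBh12 hδ12₃0 hδ₃₀ hY335 (fun x hM α₀ hα ha U hU hU' => (hG0C x hM α₀ hα ha U hU hU').1)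
  have htJ0 : 0 ≤ tJ := le_trans (by positivity) htJ; have hM12g : M12 ≤ M₀ := hM12T.trans hMM; have haa12 : aZ ≤ a12 := haaZ.trans ha12T; have hwBhG : ∀ s, 0 < s → s < 1 → wX s * BhG s ≤ BHG := fun s hs0 hs1 => (mul_le_mul_of_nonneg_left (le_add_of_nonneg_right (mul_nonneg (mul_nonneg (hθHG s hs0 hs1) (mul_nonneg hB₀G (inv_nonneg.2 (by linarith only [hqG])))) (B9RowSum261DefiniteFaces.rowConst261_nonneg _ _))) (hwX₀ s)).trans (hwBG s hs0 hs1)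
  obtain ⟨MTS, θS, θD12, A₀S, AWS, AQS, ADS, AQ1S, CRS, θH12, AIS, AVS, hθS, hθD12, hθH12, hA₀S, hAWS, hAQS, hADS, hAQ1S, hCRS, hAIS, hAVS, hST⟩ :=
    hStateTuples_of_pinsP_geo9Y (N := N) (H := H) (bI := bI) (hlev := hlev) (hβ1 := hβ1) (hbI0 := hbI0) (hGR := hGR) (c := c) (M₀ := M₀) (a₀ := aZ) (hM₀ := hM₀g.le) (hσ := hσS) (hτ := hτS)
      (w13 := w13) (hw13₀ := hw13₀) (hw13₁ := hw13₁) (wX := wX) (hwX₀ := hwX₀) (hwX₁ := hwX₁) (hs440 := hs440) (hs441 := hs441) (hw1344 := hws44) (hwX44 := hwX44) (bH13 := bH13) (hbH13 := hbH13) (hκ13 := hκ13) (bXH := bXH) (hbXH := hbXH) (bHXA := bHXA) (hbHXA := hbHXA) (bHX := bHX) (hbHX := hbHX) (𝔬12 := 𝔬12) (hblk12 := hblk12) (hblkW12 := hblkW12) (Δ2 := fun x => (𝔯 x).Δ2) (hTpico12 := hTpico12) (hT2co12 := hT2co12) (hDvco12 := hDvco12) (hDvsco12 := hDvsco12) (𝔭A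 := 𝔭A) (hparB := fun _ => rfl) (h𝔭A := h𝔭A) (Dd := fun x => (𝔡A x).Dd) (Dsd := fun x => (𝔡A x).Dsd) (hDd := h𝔡Ad) (Gp := fun x => GpY x.toKIdx (parSymY x.toKIdx)) (hGp := fun _ => rfl) (parS := fun x => parSymY x.toKIdx) (hparS := fun _ => rfl)
      (hB₀ := mul_nonneg (Nat.cast_nonneg _) (p.C_nonneg hp _)) (hCP := hCP) (htJ := htJ0) (hB43 := hB43) (htA := ht12T) (hθ₂ := hθ₂) (hB44 := hB44G) (hB12₃ := hB12₃) (hBx13 := hBx13) (hBx13₀ := hBx13₀) (hwBx13 := hwBx13) (hB12₀ := hB12₀) (hBh12 := hBh12) (hBi := hBi12) (hB₀G := hB₀G) (hBhG := hBhG) (hBHG := hBHG) (hwBhG := hwBhG) (hBd := hBd13) (hB₃ := hB12₃) (hBhD := hBhD13) (hBdX := hBdX) (hδK := by linarith) (hr0 := hU8a) (hr49 := hU8b) (hr2 := hU8c) (hr44 := hU8d) (hrB := hU8e) (hr43 := hU8f) (hrT := hU8g) (hK3d := hU8h) (hKP := hU8i) (hP0 := hU8j) (hP3 := hU8k) (hPG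 := hU8l) (h31 := fun x hM α₀ hα ha U hU => h31 x (hM31T.trans (hMM.trans hM)) α₀ hα ((ha.trans haaZ).trans ha31T) U hU)
      (h49 := fun x hM α₀ hα ha U hU => h49 x (hM49T.trans (hMM.trans hM)) α₀ hα ((ha.trans haaZ).trans ha49T) U hU) (h43 := (fun x hM α₀ hα ha => h43Gp x (hM12g.trans hM) α₀ hα (ha.trans haa12))) (h44G := (fun x hM α₀ hα ha => h44G x (hM12g.trans hM) α₀ hα (ha.trans haa12))) (hD2 := (fun x hM α₀ hα ha => hD2sup x (hM12g.trans hM) α₀ hα (ha.trans haa12))) (hta := (fun x hM α₀ hα ha => hta x (hMM.trans hM) α₀ hα (ha.trans haaZ))) (hBJ := (fun x hM α₀ hα ha => hBJ x (hM12g.trans hM) α₀ hα (ha.trans haa12))) (hZ81 := fun x hM α₀ hα ha U hU hU' => (hZ4 x (hM12g.trans hM) α₀ hα (ha.trans haa12) U hU hU').1) (hpXDv := (fun x hM α₀ hα ha => hpXDv x (hM12g.trans hM) α₀ hα (ha.trans haa12))) (he0 := fun x hM α₀ hα ha U hU hU' => (hmodel12 x hM α₀ hα (ha.trans haZ0) U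 hU hU').1.e0) (he1d := fun x hM α₀ hα ha U hU hU' => (hG0C x hM α₀ hα (ha.trans haZ0) U hU hU').1.e1d) (he2 := fun x hM α₀ hα ha U hU hU' => (hG0P x (hM12g.trans hM) α₀ hα (ha.trans haa12) U hU hU').1) (h43RG := fun x hM α₀ hα ha U hU hU' => (hG0P x (hM12g.trans hM) α₀ hα (ha.trans haa12) U hU hU').2)
      (hgQs1 := fun x hM α₀ hα ha U hU hU' => (hZ4 x (hM12g.trans hM) α₀ hα (ha.trans haa12) U hU hU').2.1) (hpXQs := (fun x hM α₀ hα ha => hpXQs x (hM12g.trans hM) α₀ hα (ha.trans haa12))) (hDirR := fun x hM α₀ hα ha U hU hU' => (hG0C x hM α₀ hα (ha.trans haZ0) U hU hU').2.1) (hDir := fun x hM α₀ hα ha U hU hU' => (hG0C x hM α₀ hα (ha.trans haZ0) U hU hU').1.h44m) (hdgDvd := fun x hM α₀ hα ha U hU hU' ν ε hε hε₁ => hdgDvd13 x (hM12g.trans hM) α₀ hα (ha.trans haa12) U hU hU' ν ε hε hε₁) (he1 := fun x hM α₀ hα ha => he1G x hM α₀ hα (ha.trans haZ0)) (h43L :=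 fun x hM α₀ hα ha U hU hU' => (hG0C x hM α₀ hα (ha.trans haZ0) U hU hU').1.h43L) (h43d := fun x hM α₀ hα ha U hU hU' => (hG0C x hM α₀ hα (ha.trans haZ0) U hU hU').1.h43d)
      (hdgDH := fun x hM α₀ hα ha U hU hU' => (hDg x (hMDgT.trans (hMM.trans hM)) α₀ hα (ha.trans haa12) U hU hU').2) (hdgDHd := fun x hM α₀ hα ha U hU hU' => (hDg x (hMDgT.trans (hMM.trans hM)) α₀ hα (ha.trans haa12) U hU hU').1) (hYd := fun x hM α₀ hα ha => hYd x (hMYT.trans (hMM.trans hM)) α₀ hα (ha.trans haa12)) (hXd := fun x hM α₀ hα ha => hXd x (hMXT.trans (hMM.trans hM)) α₀ hα (ha.trans haa12))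
  obtain ⟨B12F, hBF1, hBF2, hBF3, hBF4⟩ : ∃ B12F : ℝ, B12₃ ≤ B12F ∧ 2 * ADS ≤ B12F ∧ CA3 ≤ B12F ∧ (((θ.ℓ₆ + 1 : ℕ) : ℝ)) ^ 2 * Real.exp (2 * δ12₃ * ((θ.ℓ₆ : ℝ) + 4)) ≤ B12F :=
    ⟨max (max B12₃ (2 * ADS)) (max CA3 ((((θ.ℓ₆ + 1 : ℕ) : ℝ)) ^ 2 * Real.exp (2 * δ12₃ * ((θ.ℓ₆ : ℝ) + 4)))), (le_max_left _ _).trans (le_max_left _ _), (le_max_right _ _).trans (le_max_left _ _), (le_max_left _ _).trans (le_max_right _ _), (le_max_right _ _).trans (le_max_right _ _)⟩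
  have hq12c : 0 < δ12₃ * (2 * ((θ.ℓ₆ : ℝ) + 1) ^ 2 - 1) := mul_pos (by linarith only [hρ₃12, hρ12, hσ12]) (by nlinarith only [Nat.cast_nonneg (α := ℝ) θ.ℓ₆]); set M₀' : ℝ := max (max (max M₀ (max (max MD MQ) Mc)) MTS) (max Mr2 (2 * Real.log (((θ.ℓ₆ + 1 : ℕ) : ℝ)) / (δ12₃ * (2 * ((θ.ℓ₆ : ℝ) + 1) ^ 2 - 1)))) with hM₀'def; have hM0le : M₀ ≤ M₀' := ((le_max_left _ _).trans (le_max_left _ _)).trans (le_max_left _ _); have hMQD : max (max MD MQ) Mc ≤ M₀' := ((le_max_right _ _).trans (le_max_left _ _)).trans (le_max_left _ _); have hMTS : MTS ≤ M₀' := (le_max_right _ _).trans (le_max_left _ _); have hMr2' : Mr2 ≤ M₀' := (le_max_left _ _).trans (le_max_right _ _); have hMq' : 2 * Real.log (((θ.ℓ₆ + 1 : ℕ) : ℝ)) / (δ12₃ * (2 * ((θ.ℓ₆ : ℝ) + 1) ^ 2 - 1)) ≤ M₀' := (le_max_right _ _).trans (le_max_right _ _)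
  have hMcle : Mc ≤ M₀' := (le_max_right _ Mc).trans hMQD; have hMQle : MQ ≤ M₀' := (le_max_right MD MQ).trans ((le_max_left _ Mc).trans hMQD); have hMM' : M12 ≤ M₀' := hM12T.trans (hMM.trans hM0le); have hwGp13 := fun (x : MemberY θ.d₆ θ.ℓ₆ θ.hd' θ.hL' θ.b₀ θ.b₁ Mstar) (hM : M₀' ≤ (geo9Y x).M) (α₀ : ℝ) (hα : 0 < α₀) (ha : (geo9Y x).M * α₀ ≤ aZ) (U : (𝔅 x).Cfg) (hU : (𝔅 x).Reg335 c α₀ U) (hU' : (𝔅 x).Reg336 c α₀ U) =>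
    (h13 x ((hM13T.trans (hMM.trans hM0le)).trans hM) α₀ hα (ha.trans (le_min (haaZ.trans ha12T) (le_min (haaZ.trans ha31T) (haaZ.trans ha49T)))) U hU hU').mono (kernel_mono (hgeoOK x) hB12₃ hBF1 le_rfl); have hrgdH := fun (x : MemberY θ.d₆ θ.ℓ₆ θ.hd' θ.hL' θ.b₀ θ.b₁ Mstar) (hM : M₀' ≤ (geo9Y x).M) (α₀ : ℝ) (hα : 0 < α₀) (ha : (geo9Y x).M * α₀ ≤ aZ) (U : (𝔅 x).Cfg) (hU : (𝔅 x).Reg335 c α₀ U) (hU' : (𝔅 x).Reg336 c α₀ U) =>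
    hrg x ((hMrgT.trans (hMM.trans hM0le)).trans hM) α₀ hα (ha.trans (le_min (haaZ.trans ha12T) (le_min (haaZ.trans ha31T) (haaZ.trans ha49T)))) U hU hU' (hids x (hM0le.trans hM) α₀ hα ha U hU hU').2; obtain ⟨t312, t313⟩ := t312_t313_of_pins_stateSUZ4 (N := N)
    (θ := θ.toStage3Params) (Mstar := Mstar) (hGR := hGR) (c := c) (𝔯 := 𝔯) (𝔢 := (sectEYOfRecordV6 N θ.toStage3Params Mstar 𝔢₀)) (𝔴 := 𝔴) (𝔈 := 𝔈) (bI := bI) (hβI := hβI) (hlev := hlev) (hβ1 := hβ1) (hM₀ := hM₀) (𝔭A := 𝔭A) (Dd := (fun x => (𝔡A x).Dd)) (Dds := (fun x => (𝔡A x).Dsd)) (hDd := h𝔡Ad) (hDds := h𝔡As) (𝔬12 := 𝔬12) (H12 := H) (bH13 := bH13) (θD12 := θD12) (r12 := r12) (B12₀ := B12₀) (δ12₀ := δ12₀) (δK12 := δK12) (σ12 := σ12) (ρ12 := ρ12) (a12 := aZ) (M12 := M₀') (B12₃ := B12F) (δ12₃ := δ12₃) (ρ13 := ρ13) (α12 :=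 α12) (κ13 := (max κ13 1)) (hθD12 := hθD12) (hr12 := hr12) (θ2₁₂ := θ2S) (B12₂ := B12₂) (ρf12 := ρf12) (θH12 := θH12) (Bh12 := Bh12) (Bi12 := Bi12) (Bq12 := BQ)
      (Bi2₁₂ := Bi2₁₂) (hθH12 := hθH12) (hθ2₁₂ := hθ2S) (hB12₂ := hB12₂) (hρf12 := hρf12) (hρf1 := hρf1) (hρf2 := hρf2) (hBh12 := hBh12) (hBi12 := hBi12) (hBi2₁₂ := hBi2₁₂) (hBq12 := hBQ) (bHX12 := bHXA) (hB12₀ := hB12₀) (hB12₃ := hB12₃.trans hBF1) (hσ12 := hσ12) (hρ12 := hρ12) (hρS12 := hρS12) (hρδ12 := hρδ12) (hρ₃12 := hρ₃12) (ha12 := haZg) (hM12 := (lt_of_lt_of_le hM₀g hM0le)) (hα12 := hα12) (hα12' := hα12') (hκ13 := (fun x U => (hκ13 x U).trans (le_max_left κ13 1))) (hρ13 := hρ13) (hρ13ρ := hρ13ρ) (hσρ13 := hσρ13) (B13₄ := B4c) (Br13 := Br13) (BhD13 := BhD13) (Bx13 := Bx13) (Bd13 := Bd13) (Bd2₁₃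 := Bd2₁₃) (hB13₄ := (hB13₄.trans hB4c)) (hBr13 := hBr13)
      (hBhD13 := hBhD13) (hBx13 := hBx13) (hBd13 := hBd13) (hBd2₁₃ := hBd2₁₃) (bHW13 := (fun x _ => bHX x)) (hκW13 := (fun x _ ε => by rw [hbHX x]; exact le_max_right κ13 1)) (Gp := (fun (x : MemberY θ.d₆ θ.ℓ₆ θ.hd' θ.hL' θ.b₀ θ.b₁ Mstar) (U : (𝔅 x).Cfg) => GcoS x.toKIdx (trBasis N) (𝔅 x) (fun U => U) (GpY x.toKIdx (parSymY x.toKIdx)) U)) (bXH := bXH) (hκX := (fun x U => (hκX x U).trans (le_max_left κ13 1))) (hmodel12 := (fun x hM α₀ hα ha U hU hU' => (hmodel12 x (hM0le.trans hM) α₀ hα (ha.trans haZ0) U hU hU').2)) (wZ := (fun x => (fun y => ((((θ.ℓ₆ + 1 : ℕ) : ℝ) ^ (θ.d₆ + 1)) ^ lvl x.hN x.D x.hk y)⁻¹))) (hwZ := (fun x y => plateau_pos x.toKIdx y))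
      (hlettersH12 := (fun x hM α₀ hα ha U hU hU' => lettersHZ_mono (hgeoOK x) hB12₃ hBF1 le_rfl (hlettersH12 x (hMM'.trans hM) α₀ hα (ha.trans haa12) U hU hU'))) (hpinE := hpinE) (hpinH := hpinH) (hpinK := hpinK) (hblk12 := hblk12) (hblkY12 := hblkY12) (hGco12 := hGco12) (hG1co12 := hG1co12) (hGGco12 := hGGco12) (hDco12 := hDco12) (hDsco12 := hDsco12) (hblkZ12 := hblkZ12) (hHm12 := hHm12) (hH1m12 := hH1m12) (hH1N := hH1N) (hIF := hIF) (hHCN := hHCN) (hsymD := hsymD) (hG0C := (fun x hM α₀ hα ha => hG0C x (hM0le.trans hM) α₀ hα (ha.trans haZ0))) (hStL := (fun x hM α₀ hα ha => hstepL2 x ((hMM.trans hM0le).trans hM) α₀ hα (ha.trans haaZ))) (hLHH := (fun x hM α₀ hα ha => hLHHQ x (hMQle.trans hM) α₀ hα (ha.trans haZ0)))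
      (hLH3 := (fun x hM α₀ hα ha U hU hU' => Letters313HZc.of_HZ (hLH3 x ((hMM.trans hM0le).trans hM) α₀ hα (ha.trans haa12) U hU hU') (hWE x ((hMM.trans hM0le).trans hM) α₀ hα (ha.trans (le_min haa12 (haaZ.trans ha49T))) U hU hU'))) (vZ := (fun x => (fun y => Real.sqrt ((((θ.ℓ₆ + 1 : ℕ) : ℝ) ^ (θ.d₆ + 1)) ^ lvl x.hN x.D x.hk y)⁻¹))) (hvZ := (fun x y => Real.sqrt_pos.2 (plateau_pos x.toKIdx y)))
      (hLL2 := (fun x hM α₀ hα ha U hU hU' => ⟨Letters313L2Pc.of_kept ((hLL2 x (hMM'.trans hM) α₀ hα (ha.trans haa12) U hU hU').1.mono (hgeoOK x) hB13₄ hB4c le_rfl) ((hcut x (hMcle.trans hM) α₀ hα ha U hU hU').1) ((hcut x (hMcle.trans hM) α₀ hα ha U hU hU').2), letters313L2MZ_mono_const (hgeoOK x) hB13₄ hB4c ((hLL2 x (hMM'.trans hM) α₀ hα (ha.trans haa12) U hU hU').2)⟩)) (hrgdd13 := (fun x hM α₀ hα ha => hrgdd13 x (hMM'.trans hM) α₀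 hα (ha.trans haa12))) (hdgDvd13 := (fun x hM α₀ hα ha => hdgDvd13 x (hMM'.trans hM) α₀ hα (ha.trans haa12))) (hpdgDvd13 := (fun x hM α₀ hα ha => hpdgDvd13 x (hMM'.trans hM) α₀ hα (ha.trans haa12))) (hZ4 := (fun x hM α₀ hα ha U hU hU' => have h := hZ4 x (hMM'.trans hM) α₀ hα (ha.trans haa12) U hU hU'; ⟨h.1.mono (kernel_mono (hgeoOK x) hB12₃ hBF1 le_rfl), h.2.1.mono (kernel_mono (hgeoOK x) hB12₃ hBF1 le_rfl), h.2.2.1.mono (kernel_mono (hgeoOK x) hB12₃ hBF1 le_rfl), h.2.2.2.mono (kernel_mono (hgeoOK x) hB12₃ hBF1 le_rfl)⟩)) (hQco12 := hQco12) (hM12q := by rw [show δ12₃ * (2 * ((θ.ℓ₆ : ℝ) + 1) ^ 2 - 1) * M₀' = M₀' * (δ12₃ * (2 * ((θ.ℓ₆ : ℝ) + 1) ^ 2 - 1)) from by ring]; exact (div_le_iff₀ hq12c).1 hMq') (hB12₃q := hBF4) (hrgd2_13 := (fun x hM α₀ hα ha U hU hU' => (hr2 x (hMr2'.trans hM) α₀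 hα (ha.trans (le_min (haaZ.trans ha12T) (le_min (haaZ.trans ha31T) (haaZ.trans ha49T)))) U hU hU' (hids x (hM0le.trans hM) α₀ hα ha U hU hU').2).mono (kernel_mono (hgeoOK x) hCA30 hBF3 le_rfl))) (hwGp13 := (fun x hM α₀ hα ha => hwGp13 x hM α₀ hα ha)) (hADB12 := hBF2) (h152 := (fun x hM α₀ hα ha U hU hU' => (hids x (hM0le.trans hM) α₀ hα ha U hU hU').2))
      (hlettersD13 := (fun x hM α₀ hα ha U hU hU' => ⟨letters313DZ_mono (hgeoOK x) hB12₃ hBF1 le_rfl ⟨(hlettersH12 x (hMM'.trans hM) α₀ hα (ha.trans haa12) U hU hU').dgQs, hrgdH x hM α₀ hα ha U hU hU', (hDg x ((hMDgT.trans (hMM.trans hM0le)).trans hM) α₀ hα (ha.trans haa12) U hU hU').2⟩, letters313DMZ_mono (hgeoOK x) hB12₃ hBF1 (fun β _ _ => hBQ β) (fun _ _ _ => le_rfl) le_rfl (hDMQ x U (hDMZ x ((hMM.trans hM0le).trans hM) α₀ hα (ha.trans haa12) U hU hU'))⟩)) (θS := θS) (κS := κ13) (A₀S := A₀S) (AW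 := AWS) (AQ := AQS) (AD := ADS) (AQ1 := AQ1S) (CR := CRS) (δP := δP) (AI := AIS) (AV := AVS) (hθS := hθS) (hκS := (by show (1 : ℝ) ≤ 1 + CLip θ.d₆ θ.ℓ₆; linarith [CLip_nonneg θ.d₆ θ.ℓ₆])) (hκ13S := (max_le le_rfl (by show (1 : ℝ) ≤ 1 + CLip θ.d₆ θ.ℓ₆; linarith [CLip_nonneg θ.d₆ θ.ℓ₆]))) (hA₀S := hA₀S) (hAW := hAWS) (hAQ := hAQS) (hAD := hADS)
      (hAQ1 := hAQ1S) (hCR := hCRS) (hAI := hAIS) (hAV := hAVS) (hρP12 := hρP12) (hδP₀ := (by linarith)) (hδP₃ := (by linarith)) (he1 := (fun x hM α₀ hα ha => he1G x (hM0le.trans hM) α₀ hα (ha.trans haZ0))) (hdomX := (fun x ε hε => by simp only [hbHXA x]; exact exists_l1_control_bHK x.toKIdx (bI x) ε)) (hdomW := (fun x _ ε hε => by simp only [hbHX x]; exact exists_l1_control_bHS x.toKIdx (sIK x.toKIdx (bI x)) ε)) (hst20 := (fun x hM α₀ hα ha U hU hU' => (hST x (hMTS.trans hM) α₀ hα ha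 U hU hU').1)) (hst10 := (fun x hM α₀ hα ha U hU hU' => (hST x (hMTS.trans hM) α₀ hα ha U hU hU').2.1)) (hst21 := (fun x hM α₀ hα ha U hU hU' => (hST x (hMTS.trans hM) α₀ hα ha U hU hU').2.2.1))
      (hst11 := (fun x hM α₀ hα ha U hU hU' => (hST x (hMTS.trans hM) α₀ hα ha U hU hU').2.2.2))
  have s3132 := s3132Nu_opsYSectE_of_stepS_R_of_refinesY (θ := θ.toStage3Params) (Mstar := Mstar) (R₁ := R₁) (R₂ := R₂) (hG := hGR) (c' := c) (hY := fun x α₀ U h h' => ⟨regY335_of_regYP335 x c35Y_le_ten (hRP1 x α₀ U h).1 (hRP1 x α₀ U h).2 hL3c, regY336_of_regYP336 x c35Y_le_ten (hRP2 x α₀ U h').1 (hRP2 x α₀ U h').2 hL4c⟩) (bK := trBasis N) (𝔬 := 𝔬12) (H₀ := H) (T := fun x => (lettersYOfRecordV4P N θ.toStage3Params Mstar 𝔯 x).GD) (T₁ := fun x => (lettersYOfRecordV4P N θ.toStage3Params Mstar 𝔯 x).G₁)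
    (T₀ := fun x => (lettersYOfRecordV4P N θ.toStage3Params Mstar 𝔯 x).GA) (hT₀ := fun _ _ => rfl) (hblk := hblk12) (hGco := hGco12) (hG1co := hG1co12) (hG0co := hG0co12) (hlev := hlev) (hβ1 := hβ1) (hnbr := B9GeoNbrCountKLevelV1.hnbr_of_le hM₀') 
    (hgeo := hgeoOK) (𝔖 := (fun x U => weightNorm (bXH x U) (rwt (geo9Y x) (-1)) (rwt_nonneg (fun y => (geo9Y_len_pos x y).le) (-1)))) (θS := θS) (A₀ := A₀S) (CR := CRS) (κS := κ13) (δK := δK12) (δP := δP) (σ := σ12) (δ := ρ12) (a₁ := aZ) (M₁ := M₀') (hθS := hθS) (hA₀ := hA₀S) (hCR := hCRS)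
    (hκS := by show (0 : ℝ) ≤ 1 + CLip θ.d₆ θ.ℓ₆; linarith [CLip_nonneg θ.d₆ θ.ℓ₆]) (hσ := hσ12) (hδ := hρ12) (hδK := hρδ12) (hδP := by linarith) (ha₁ := haZg) (hM₁ := lt_of_lt_of_le hM₀g hM0le)
    (hstate := fun x hM α₀ hα ha U hU hU' => ⟨((hST x (hMTS.trans hM) α₀ hα ha U hU hU').1).1, ((hST x (hMTS.trans hM) α₀ hα ha U hU hU').1).2.2.2.1, ((hST x (hMTS.trans hM) α₀ hα ha U hU hU').1).2.2.2.2.2.1,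
      ((hST x (hMTS.trans hM) α₀ hα ha U hU hU').1).2.2.2.2.2.2.1, ((hST x (hMTS.trans hM) α₀ hα ha U hU hU').1).2.2.2.2.2.2.2, (hmodel12 x (hM0le.trans hM) α₀ hα (ha.trans haZ0) U hU hU').2.2⟩) (a311 := q.a₁ / c) (M311 := MR) (ha311 := hac) (hM311 := hMR)
    (hΔA := hΔA) (𝔏 := lettersYOfRecordV4P N θ.toStage3Params Mstar 𝔯) (𝔈 := 𝔈) (𝔢 := sectEYOfRecordV6 N θ.toStage3Params Mstar 𝔢₀) (𝔴 := 𝔴) (hQ := fun _ => rfl) (hQ₁ := fun _ => rfl)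
  have s349 : B9.Stmt349Printed (θ.d₆ + 1) c geo9Y (bg9YR (Matrix (Fin N) (Fin N) ℂ) (specialUnitaryUnits (Fin N)) R₁ R₂) (fun x => fineKernelR R₁ R₂ ((opsYNuStOfRecordV4PE N θ.toStage3Params Mstar 𝔯 (sectEStYOfRecordV7 N θ.toStage3Params Mstar 𝔢₀) 𝔴 𝔈) x).P349) :=
    s349_site_of_t37_display348_of_R θ.toStage3Params Mstar R₁ R₂ hGR (lettersYOfRecordV4P N θ.toStage3Params Mstar 𝔯) (fun _ => rfl) (fun _ => rfl) (trBasis N) hlev hβ1 (hnbr_two_of_le hM₀) 𝔬 rd H hp t37' hblkS hblkYS hGpS hDS hc hB39.le (hr39.trans_le hrδ39) ha39 hM39 h348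
  have h37f : (fun x => rwExpansionR R₁ R₂ ((opsYNuStOfRecordV4PE N θ.toStage3Params Mstar 𝔯 (sectEStYOfRecordV7 N θ.toStage3Params Mstar 𝔢₀) 𝔴 𝔈) x).E37) = fun x => E37YPairMDir (bg := bg9YR (Matrix (Fin N) (Fin N) ℂ) (specialUnitaryUnits (Fin N)) R₁ R₂) (2 * (θ.d₆ + 1)) (nbrCountY θ.d₆ θ.ℓ₆ θ.hd' θ.hL' θ.b₀ θ.b₁ 2) (Real.sqrt ((θ.d₆ + 1) * Fintype.card (TrIdx N))) ((θ.d₆ + 1 : ℕ) : ℝ) p q (⟨p3.N3, 2 * p3.B3, 0⟩ : PairPrims) (⟨q3.N3, 2 * q3.B3, 0⟩ : PairPrims) pM qM (𝔬 x) (𝔡 x) (𝔩 x) (rd x) (H x)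
      (kernelFamilyR R₁ R₂ ((opsYNuStOfRecordV4PE N θ.toStage3Params Mstar 𝔯 (sectEStYOfRecordV7 N θ.toStage3Params Mstar 𝔢₀) 𝔴 𝔈) x).Gp) := funext hE37
  have h310f : (fun x => rwExpansionR R₁ R₂ ((opsYNuStOfRecordV4PE N θ.toStage3Params Mstar 𝔯 (sectEStYOfRecordV7 N θ.toStage3Params Mstar 𝔢₀) 𝔴 𝔈) x).E310) = fun x => E310YPairM (bg := bg9YR (Matrix (Fin N) (Fin N) ℂ) (specialUnitaryUnits (Fin N)) R₁ R₂) (2 * (θ.d₆ + 1)) (nbrCountY θ.d₆ θ.ℓ₆ θ.hd' θ.hL' θ.b₀ θ.b₁ 2) (Real.sqrt ((θ.d₆ + 1) * Fintype.card (TrIdx N))) ((θ.d₆ + 1 : ℕ) : ℝ) p q (⟨p3.N3, 2 * p3.B3, 0⟩ : PairPrims) (⟨q3.N3, 2 * q3.B3, 0⟩ : PairPrims) pM qM (𝔬A x) (rdA x) (H x)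
      (kernelFamilyR R₁ R₂ ((opsYNuStOfRecordV4PE N θ.toStage3Params Mstar 𝔯 (sectEStYOfRecordV7 N θ.toStage3Params Mstar 𝔢₀) 𝔴 𝔈) x).GA) := funext hE310
  have t37 : B9.Thm37Printed c geo9Y (bg9YR (Matrix (Fin N) (Fin N) ℂ) (specialUnitaryUnits (Fin N)) R₁ R₂) (fun x => rwExpansionR R₁ R₂ ((opsYNuStOfRecordV4PE N θ.toStage3Params Mstar 𝔯 (sectEStYOfRecordV7 N θ.toStage3Params Mstar 𝔢₀) 𝔴 𝔈) x).E37) := h37f ▸ t37'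
  have c38 : B9.Cor38Printed c geo9Y (bg9YR (Matrix (Fin N) (Fin N) ℂ) (specialUnitaryUnits (Fin N)) R₁ R₂) (fun x => rwExpansionR R₁ R₂ ((opsYNuStOfRecordV4PE N θ.toStage3Params Mstar 𝔯 (sectEStYOfRecordV7 N θ.toStage3Params Mstar 𝔢₀) 𝔴 𝔈) x).E37) := h37f ▸ c38'
  have t310 : B9.Thm310Printed c geo9Y (bg9YR (Matrix (Fin N) (Fin N) ℂ) (specialUnitaryUnits (Fin N)) R₁ R₂) (fun x => rwExpansionR R₁ R₂ ((opsYNuStOfRecordV4PE N θ.toStage3Params Mstar 𝔯 (sectEStYOfRecordV7 N θ.toStage3Params Mstar 𝔢₀) 𝔴 𝔈) x).E310) := h310f ▸ t310'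
  have hsum : B9.RWSumsYieldIneqs geo9Y (bg9YR (Matrix (Fin N) (Fin N) ℂ) (specialUnitaryUnits (Fin N)) R₁ R₂) (fun x => rwExpansionR R₁ R₂ ((opsYNuStOfRecordV4PE N θ.toStage3Params Mstar 𝔯 (sectEStYOfRecordV7 N θ.toStage3Params Mstar 𝔢₀) 𝔴 𝔈) x).E37) (fun x => rwExpansionR R₁ R₂ ((opsYNuStOfRecordV4PE N θ.toStage3Params Mstar 𝔯 (sectEStYOfRecordV7 N θ.toStage3Params Mstar 𝔢₀) 𝔴 𝔈) x).E310)
      (fun x => kernelFamilyR R₁ R₂ ((opsYNuStOfRecordV4PE N θ.toStage3Params Mstar 𝔯 (sectEStYOfRecordV7 N θ.toStage3Params Mstar 𝔢₀) 𝔴 𝔈) x).Gp) (fun x => kernelFamilyR R₁ R₂ ((opsYNuStOfRecordV4PE N θ.toStage3Params Mstar 𝔯 (sectEStYOfRecordV7 N θ.toStage3Params Mstar 𝔢₀) 𝔴 𝔈) x).GA) := by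
    rw [h37f, h310f]; exact hsum'
  have hE4 := hE4_of_hGA_e4 (opsYNuStOfRecordV4PE N θ.toStage3Params Mstar 𝔯 (sectEStYOfRecordV7 N θ.toStage3Params Mstar 𝔢₀) 𝔴 𝔈) (hGA_e4_opsYOfLetters N θ.toStage3Params Mstar (lettersYOfRecordV4P N θ.toStage3Params Mstar 𝔯) 𝔈)
  have hH2 := hH2_of_hGA_h2 (opsYNuStOfRecordV4PE N θ.toStage3Params Mstar 𝔯 (sectEStYOfRecordV7 N θ.toStage3Params Mstar 𝔢₀) 𝔴 𝔈) (hGA_h2_opsYOfLetters N θ.toStage3Params Mstar (lettersYOfRecordV4P N θ.toStage3Params Mstar 𝔯) 𝔈)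
  have h1U : ClassIncl (regC335 (Matrix (Fin N) (Fin N) ℂ) (specialUnitaryUnits (Fin N)) (extraYPb (Matrix (Fin N) (Fin N) ℂ) (specialUnitaryUnits (Fin N)))) c35Y R₁ c := fun x α₀ U hα h => hP1 x α₀ U hα (classIncl_regC335Pb_regYPb335 c35Y c35Y x α₀ U hα h).2
  have h2U : ClassIncl (regC336 (Matrix (Fin N) (Fin N) ℂ) (specialUnitaryUnits (Fin N)) (extraYPb (Matrix (Fin N) (Fin N) ℂ) (specialUnitaryUnits (Fin N)))) c35Y R₂ c := fun x α₀ U hα h => hP2 x α₀ U hα (classIncl_regC336Pb_regYPb336 c35Y c35Y x α₀ U hα h).2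
  have honeU : ∀ (j : J) (α₀ : ℝ), 0 < α₀ → regC335 (Matrix (Fin N) (Fin N) ℂ) (specialUnitaryUnits (Fin N)) (extraYPb (Matrix (Fin N) (Fin N) ℂ) (specialUnitaryUnits (Fin N))) (f j) c35Y α₀ (bg9YC (Matrix (Fin N) (Fin N) ℂ) (specialUnitaryUnits (Fin N)) (extraYPb (Matrix (Fin N) (Fin N) ℂ) (specialUnitaryUnits (Fin N))) (f j)).one :=
    fun j α₀ hα => classIncl_regYPb335_regC335Pb c35Y c35Y (f j) α₀ _ hα ⟨hα.le, regYP335_one (x := f j) c35Y hα⟩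
  -- (t5, edition 79) the (α3) Sect.-B step through dag-n06-c's CLOSED face: its GUARDED Thm-3.11 input `hunitA` is dag-n06-j's THEOREM `hunitA_of_sections` (Thm 3.3 via Thm 3.10 on print's class, for the section-carrying sub-family `(f, ιB, hι)`)
  have hBU := fun h32 h33 => sectBStepU_C37GY_su_extraYPb_closed θ.toStage3Params Mstar f bR ιB C38 hN hι hM₀B h32 h33
  show B9LeafX (carriersYU (extraYPb (Matrix (Fin N) (Fin N) ℂ) (specialUnitaryUnits (Fin N))) (specialUnitaryUnits (Fin N)) f bR ιB C38 (opsYNuStOfRecordV4PE N θ.toStage3Params Mstar 𝔯 (sectEStYOfRecordV7 N θ.toStage3Params Mstar 𝔢₀) 𝔴 𝔈))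
  exact b9LeafX_carriersYU (extraYPb (Matrix (Fin N) (Fin N) ℂ) (specialUnitaryUnits (Fin N))) (specialUnitaryUnits (Fin N)) f C38 bR ιB (opsYNuStOfRecordV4PE N θ.toStage3Params Mstar 𝔯 (sectEStYOfRecordV7 N θ.toStage3Params Mstar 𝔢₀) 𝔴 𝔈) θ.δ₀ _ _ honeU
    (hGp_e_opsYOfLetters N θ.toStage3Params Mstar (lettersYOfRecordV4P N θ.toStage3Params Mstar 𝔯) 𝔈) (hGp_h1_opsYOfLetters N θ.toStage3Params Mstar (lettersYOfRecordV4P N θ.toStage3Params Mstar 𝔯) 𝔈)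
    (hC_opsYOfLetters N θ.toStage3Params Mstar (lettersYOfRecordV4P N θ.toStage3Params Mstar 𝔯) 𝔈) (hGA_e_opsYOfLetters N θ.toStage3Params Mstar (lettersYOfRecordV4P N θ.toStage3Params Mstar 𝔯) 𝔈)
    (hGA_h1_opsYOfLetters N θ.toStage3Params Mstar (lettersYOfRecordV4P N θ.toStage3Params Mstar 𝔯) 𝔈) (hGA_e4_opsYOfLetters N θ.toStage3Params Mstar (lettersYOfRecordV4P N θ.toStage3Params Mstar 𝔯) 𝔈)
    (hGA_h2_opsYOfLetters N θ.toStage3Params Mstar (lettersYOfRecordV4P N θ.toStage3Params Mstar 𝔯) 𝔈) (hGA_l2_opsYOfLetters N θ.toStage3Params Mstar (lettersYOfRecordV4P N θ.toStage3Params Mstar 𝔯) 𝔈)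
    hE4 hH2 (residualGpAtOne_R (fun x => ((opsYNuStOfRecordV4PE N θ.toStage3Params Mstar 𝔯 (sectEStYOfRecordV7 N θ.toStage3Params Mstar 𝔢₀) 𝔴 𝔈) x).Gp) hGp) (residualGAGlobAtOne_R (fun x => ((opsYNuStOfRecordV4PE N θ.toStage3Params Mstar 𝔯 (sectEStYOfRecordV7 N θ.toStage3Params Mstar 𝔢₀) 𝔴 𝔈) x).GA) hGA) (fun _ => rfl) (fun _ => rfl) (fun _ => rfl) hBU (thm37Printed_antitone (R₂ := (regC336 (Matrix (Fin N) (Fin N) ℂ) (specialUnitaryUnits (Fin N)) (extraYPb (Matrix (Fin N) (Fin N) ℂ) (specialUnitaryUnits (Fin N))))) (R₂' := R₂) h1U (fun x => ((opsYNuStOfRecordV4PE N θ.toStage3Params Mstar 𝔯 (sectEStYOfRecordV7 N θ.toStage3Params Mstar 𝔢₀) 𝔴 𝔈) x).E37) t37) (cor38Printed_antitone (R₂ := (regC336 (Matrix (Fin N) (Fin N) ℂ) (specialUnitaryUnits (Fin N)) (extraYPb (Matrix (Fin N) (Fin N) ℂ) (specialUnitaryUnits (Fin N))))) (R₂' :=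 R₂) h1U (fun x => ((opsYNuStOfRecordV4PE N θ.toStage3Params Mstar 𝔯 (sectEStYOfRecordV7 N θ.toStage3Params Mstar 𝔢₀) 𝔴 𝔈) x).E37) c38)
    (thm39Printed_antitone (R₂ := (regC336 (Matrix (Fin N) (Fin N) ℂ) (specialUnitaryUnits (Fin N)) (extraYPb (Matrix (Fin N) (Fin N) ℂ) (specialUnitaryUnits (Fin N))))) (R₂' := R₂) h1U (fun x => ((opsYNuStOfRecordV4PE N θ.toStage3Params Mstar 𝔯 (sectEStYOfRecordV7 N θ.toStage3Params Mstar 𝔢₀) 𝔴 𝔈) x).EK39) t39) (thm310Printed_antitone (R₂ := (regC336 (Matrix (Fin N) (Fin N) ℂ) (specialUnitaryUnits (Fin N)) (extraYPb (Matrix (Fin N) (Fin N) ℂ) (specialUnitaryUnits (Fin N))))) (R₂' := R₂) h1U (fun x => ((opsYNuStOfRecordV4PE N θ.toStage3Params Mstar 𝔯 (sectEStYOfRecordV7 N θ.toStage3Params Mstar 𝔢₀) 𝔴 𝔈) x).E310) t310) (rwSumsYieldIneqs_R (fun x => ((opsYNuStOfRecordV4PE N θ.toStage3Params Mstar 𝔯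 (sectEStYOfRecordV7 N θ.toStage3Params Mstar 𝔢₀) 𝔴 𝔈) x).E37) (fun x => ((opsYNuStOfRecordV4PE N θ.toStage3Params Mstar 𝔯 (sectEStYOfRecordV7 N θ.toStage3Params Mstar 𝔢₀) 𝔴 𝔈) x).E310) (fun x => ((opsYNuStOfRecordV4PE N θ.toStage3Params Mstar 𝔯 (sectEStYOfRecordV7 N θ.toStage3Params Mstar 𝔢₀) 𝔴 𝔈) x).Gp) (fun x => ((opsYNuStOfRecordV4PE N θ.toStage3Params Mstar 𝔯 (sectEStYOfRecordV7 N θ.toStage3Params Mstar 𝔢₀) 𝔴 𝔈) x).GA) hsum)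
    (rwKernelSumYields_R (fun x => ((opsYNuStOfRecordV4PE N θ.toStage3Params Mstar 𝔯 (sectEStYOfRecordV7 N θ.toStage3Params Mstar 𝔢₀) 𝔴 𝔈) x).EK39) (fun x => ((opsYNuStOfRecordV4PE N θ.toStage3Params Mstar 𝔯 (sectEStYOfRecordV7 N θ.toStage3Params Mstar 𝔢₀) 𝔴 𝔈) x).Cinv) hksum) (thm311Printed_antitone (R₂ := (regC336 (Matrix (Fin N) (Fin N) ℂ) (specialUnitaryUnits (Fin N)) (extraYPb (Matrix (Fin N) (Fin N) ℂ) (specialUnitaryUnits (Fin N))))) (R₂' := R₂) h1U (fun x => ((opsYNuStOfRecordV4PE N θ.toStage3Params Mstar 𝔯 (sectEStYOfRecordV7 N θ.toStage3Params Mstar 𝔢₀) 𝔴 𝔈) x).PosDef) t311) (thm312Printed_antitone h1U h2U (fun x => ((opsYNuStOfRecordV4PE N θ.toStage3Params Mstar 𝔯 (sectEStYOfRecordV7 N θ.toStage3Params Mstar 𝔢₀) 𝔴 𝔈) x).GD) (fun x => ((opsYNuStOfRecordV4PE N θ.toStage3Params Mstar 𝔯 (sectEStYOfRecordV7 N θ.toStage3Params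 Mstar 𝔢₀) 𝔴 𝔈) x).G₁) (fun x => ((opsYNuStOfRecordV4PE N θ.toStage3Params Mstar 𝔯 (sectEStYOfRecordV7 N θ.toStage3Params Mstar 𝔢₀) 𝔴 𝔈) x).H) (fun x => ((opsYNuStOfRecordV4PE N θ.toStage3Params Mstar 𝔯 (sectEStYOfRecordV7 N θ.toStage3Params Mstar 𝔢₀) 𝔴 𝔈) x).H₁) (fun x => ((opsYNuStOfRecordV4PE N θ.toStage3Params Mstar 𝔯 (sectEStYOfRecordV7 N θ.toStage3Params Mstar 𝔢₀) 𝔴 𝔈) x).HasRWExp) (fun x => ((opsYNuStOfRecordV4PE N θ.toStage3Params Mstar 𝔯 (sectEStYOfRecordV7 N θ.toStage3Params Mstar 𝔢₀) 𝔴 𝔈) x).HasRWExpH) (fun x => ((opsYNuStOfRecordV4PE N θ.toStage3Params Mstar 𝔯 (sectEStYOfRecordV7 N θ.toStage3Params Mstar 𝔢₀) 𝔴 𝔈) x).PosDefK) t312)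
    (thm313Printed_antitone h1U h2U (fun x => ((opsYNuStOfRecordV4PE N θ.toStage3Params Mstar 𝔯 (sectEStYOfRecordV7 N θ.toStage3Params Mstar 𝔢₀) 𝔴 𝔈) x).GG) (fun x => ((opsYNuStOfRecordV4PE N θ.toStage3Params Mstar 𝔯 (sectEStYOfRecordV7 N θ.toStage3Params Mstar 𝔢₀) 𝔴 𝔈) x).HasRWExp) (fun x => ((opsYNuStOfRecordV4PE N θ.toStage3Params Mstar 𝔯 (sectEStYOfRecordV7 N θ.toStage3Params Mstar 𝔢₀) 𝔴 𝔈) x).PosDefK) t313) (thm314Printed_antitone (R₂ := (regC336 (Matrix (Fin N) (Fin N) ℂ) (specialUnitaryUnits (Fin N)) (extraYPb (Matrix (Fin N) (Fin N) ℂ) (specialUnitaryUnits (Fin N))))) (R₂' := R₂) h1U (fun x => ((opsYNuStOfRecordV4PE N θ.toStage3Params Mstar 𝔯 (sectEStYOfRecordV7 N θ.toStage3Params Mstar 𝔢₀) 𝔴 𝔈) x).Kdiff) dOmegaY t314) (thm315FullPrinted_antitone h1U h2U (fun x => ((opsYNuStOfRecordV4PE N θ.toStage3Params Mstar 𝔯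 (sectEStYOfRecordV7 N θ.toStage3Params Mstar 𝔢₀) 𝔴 𝔈) x).Ck) inΛY unitDistY (fun x => ((opsYNuStOfRecordV4PE N θ.toStage3Params Mstar 𝔯 (sectEStYOfRecordV7 N θ.toStage3Params Mstar 𝔢₀) 𝔴 𝔈) x).GivenBy3185) (fun x => ((opsYNuStOfRecordV4PE N θ.toStage3Params Mstar 𝔯 (sectEStYOfRecordV7 N θ.toStage3Params Mstar 𝔢₀) 𝔴 𝔈) x).HasRWExpC) t315)
    (stmt349Printed_antitone (R₂ := (regC336 (Matrix (Fin N) (Fin N) ℂ) (specialUnitaryUnits (Fin N)) (extraYPb (Matrix (Fin N) (Fin N) ℂ) (specialUnitaryUnits (Fin N))))) (R₂' := R₂) h1U (fun x => ((opsYNuStOfRecordV4PE N θ.toStage3Params Mstar 𝔯 (sectEStYOfRecordV7 N θ.toStage3Params Mstar 𝔢₀) 𝔴 𝔈) x).P349) s349) (stmt3132Printed_antitone h1U h2U (fun x => ((opsYNuStOfRecordV4PE N θ.toStage3Params Mstar 𝔯 (sectEStYOfRecordV7 N θ.toStage3Params Mstar 𝔢₀) 𝔴 𝔈) x).QGQinv)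 (fun x => ((opsYNuStOfRecordV4PE N θ.toStage3Params Mstar 𝔯 (sectEStYOfRecordV7 N θ.toStage3Params Mstar 𝔢₀) 𝔴 𝔈) x).QG1Qinv) s3132) (thm314LocalPrinted_antitone (R₂ := (regC336 (Matrix (Fin N) (Fin N) ℂ) (specialUnitaryUnits (Fin N)) (extraYPb (Matrix (Fin N) (Fin N) ℂ) (specialUnitaryUnits (Fin N))))) (R₂' := R₂) h1U (fun x => ((opsYNuStOfRecordV4PE N θ.toStage3Params Mstar 𝔯 (sectEStYOfRecordV7 N θ.toStage3Params Mstar 𝔢₀) 𝔴 𝔈) x).Kdiff) OmKY dOmegaY t314loc) (b6BlockParam_D6OfRecord θ.toStage3Params hθ.1.1.1.1.1)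

end Pointed
end Summit.QuantumFields.YangMills.BalabanUVNodes.N06AtOpsYNuOfRecordV6EPairUF
end
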